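import Summits.BirchSwinnertonDyer.BirchSwinnertonDyer.Theses.SignedBaseChange
import Summits.BirchSwinnertonDyer.BirchSwinnertonDyer.Theorems.SignedBaseChangeAnticyclotomicEisensteinDivisibilityOfFiniteExponentTateTC
import Summits.BirchSwinnertonDyer.BirchSwinnertonDyer.Theorems.SignedBaseChangeAnticyclotomicEisensteinDivisibilityBdpLowerHalfAllAdditive
import Summits.BirchSwinnertonDyer.BirchSwinnertonDyer.Theorems.SignedBaseChangeAnticyclotomicEisensteinDivisibilityOrdinary
import Summits.BirchSwinnertonDyer.BirchSwinnertonDyer.Theorems.SignedBaseChangeAnticyclotomicEisensteinDivisibilityXAcTorsionOfLongoVigni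
import Summits.BirchSwinnertonDyer.BirchSwinnertonDyer.Theorems.SignedBaseChangeAnticyclotomicEisensteinDivisibilityMinusIsBDPSupersingularBCS
import Literature.NumberTheory.EllipticCurves.CastellaHsuKunduLeeLiu2025.HeegnerPointMainConjectureSupersingularBDP
import Literature.NumberTheory.IwasawaTheory.Greenberg2006.GlobalEulerPoincareCorankOfTateTC
import Literature.NumberTheory.GaloisCohomology.RestrictedRamificationPoitouTateThreeLeTotallyComplex
import Summits.BirchSwinnertonDyer.BirchSwinnertonDyer.Theorems.SignedBaseChangeAnticyclotomicEisensteinDivisibilityBdpLowerHalfSemistable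
import Literature.NumberTheory.DiophantineGeometry.ConductorAdditiveProofs
import Literature.NumberTheory.EllipticCurves.RootNumberTwistProofs
import Literature.NumberTheory.EllipticCurves.AdditiveReductionRamifiedTorsionProofs
import Literature.NumberTheory.EllipticCurves.NeronOggShafarevichLocal
import Summits.BirchSwinnertonDyer.BirchSwinnertonDyer.Theorems.SignedBaseChangeAnticyclotomicEisensteinDivisibilityAdmdefRamifiedNS
import Literature.NumberTheory.GaloisCohomology.TateGlobalEulerCharacteristicTotallyComplex
import Literature.NumberTheory.EllipticCurves.CastellaHsuKunduLeeLiu2025.SignedBipartiteEulerSystem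
import Literature.NumberTheory.EllipticCurves.AnticyclotomicSignedSelmerRelaxedEquality
import Literature.NumberTheory.EllipticCurves.AnticyclotomicSignedTransferInputs
import Summits.BirchSwinnertonDyer.BirchSwinnertonDyer.Theorems.SignedBaseChangeAnticyclotomicEisensteinDivisibilityAdmdefBipartiteNVGlue
import Summits.BirchSwinnertonDyer.BirchSwinnertonDyer.Theorems.SignedBaseChangeAnticyclotomicEisensteinDivisibilityAdmdefBipartiteNVLevelOne
import Summits.BirchSwinnertonDyer.BirchSwinnertonDyer.Theorems.AdditiveKolyvaginRoadKolyvaginPrimitiveOfLevelSystems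
import Literature.NumberTheory.Automorphic.BrandtGrossPoints
import Literature.NumberTheory.Automorphic.BrandtEigenLine
import Literature.NumberTheory.EllipticCurves.DefiniteBrandtMultiplicityOneModP
import Literature.NumberTheory.EllipticCurves.CastellaHsuKunduLeeLiu2025.SignedBipartiteSystemTransferClassDictionary
import Literature.NumberTheory.EllipticCurves.ZhangLevelRaisedKolyvaginData
import Summits.BirchSwinnertonDyer.BirchSwinnertonDyer.Theorems.SignedBaseChangeAnticyclotomicEisensteinDivisibilityAdmdefSelmerWalk
import Summits.BirchSwinnertonDyer.BirchSwinnertonDyer.Theorems.SignedBaseChangeAnticyclotomicEisensteinDivisibilityAdmdefSignedSupply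
import Summits.BirchSwinnertonDyer.BirchSwinnertonDyer.Theorems.SignedBaseChangeAnticyclotomicEisensteinDivisibilityAdmdefSignedDetour
import Summits.BirchSwinnertonDyer.BirchSwinnertonDyer.Theorems.SignedBaseChangeAnticyclotomicEisensteinDivisibilityAdmdefOddSelmerDim
import Summits.BirchSwinnertonDyer.BirchSwinnertonDyer.Theorems.SignedBaseChangeAnticyclotomicEisensteinDivisibilityAdmdefXAcTorsionOfProp25
import Summits.BirchSwinnertonDyer.BirchSwinnertonDyer.Theorems.SignedBaseChangeAnticyclotomicEisensteinDivisibilityAdmdefUnitLambdaOfLoc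
import Literature.NumberTheory.EllipticCurves.YanZhu2026.GreenbergMainTheoremsAnyRoot
import Literature.NumberTheory.EllipticCurves.HeegnerPointsKolyvaginTorsionProofs
import Summits.BirchSwinnertonDyer.BirchSwinnertonDyer.Theorems.AdditiveKolyvaginRoadEigen
import Literature.NumberTheory.EllipticCurves.BSDRankZeroDensityProofs
import Literature.NumberTheory.EllipticCurves.BSDSelmerCMPConverseHeegnerFieldProofs
import Literature.NumberTheory.EllipticCurves.BSDSelmerParityDokchitserProofs
import Literature.NumberTheory.EllipticCurves.NonEisensteinPrimeOfSurjective
import Literature.NumberTheory.EllipticCurves.BSDSha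
import Summits.BirchSwinnertonDyer.BirchSwinnertonDyer.Theorems.AdditiveKolyvaginRoadAdmissibleRaiseFree
import Summits.BirchSwinnertonDyer.BirchSwinnertonDyer.Theorems.AdditiveKolyvaginRoadLevelSystemsBottomOfRaise
import Summits.BirchSwinnertonDyer.BirchSwinnertonDyer.Theorems.SchneiderFreeAdditiveX3PoitouTateSelmerDualityHolds
import Literature.NumberTheory.EllipticCurves.HeegnerPointsKolyvaginSelmerProofs
import Summits.BirchSwinnertonDyer.BirchSwinnertonDyer.Theorems.ClassRecordThreeShimuraKolyvaginImageInputs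
import Summits.BirchSwinnertonDyer.BirchSwinnertonDyer.Theorems.SignedBaseChangeAnticyclotomicEisensteinDivisibilityAdmdefRootDichotomy
import Summits.BirchSwinnertonDyer.BirchSwinnertonDyer.Theorems.SignedBaseChangeAnticyclotomicEisensteinDivisibilityAdmdefUnramRootDichotomy
import Summits.BirchSwinnertonDyer.Rank1Residual.Additive.FouquetWanLocus
import Summits.BirchSwinnertonDyer.BirchSwinnertonDyer.Theorems.SignedBaseChangeAnticyclotomicEisensteinDivisibilityAdmdefRootZero
import Summits.BirchSwinnertonDyer.BirchSwinnertonDyer.Theorems.SignedBaseChangeAnticyclotomicEisensteinDivisibilityAdmdefHeegnerPrimitive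
import Summits.BirchSwinnertonDyer.BirchSwinnertonDyer.Theorems.SignedBaseChangeAnticyclotomicEisensteinDivisibilityAdmdefRamifiedNSDisc
import Summits.BirchSwinnertonDyer.BirchSwinnertonDyer.Theorems.GenusKolyvaginAtTwoCasselsTatePTcRealReadout
import Summits.BirchSwinnertonDyer.BirchSwinnertonDyer.Theorems.SignedBaseChangeDefiniteAnchorDefs
import Literature.NumberTheory.EllipticCurves.CasselsTateAlternating
import HarnessLib

/-! # Line `admdef` — skeleton **v24** (LEAD gen 31) = v23 with TWO count-neutral, kernel-certified re-keys (no change of content; 5 stubs; crux BY NAME ×2):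
# (1) INPUT EVENT director-bsd (543)(a)/(567)(A2)/(572): K1 is now the route ITEM stmt-BirchSwinnertonDyer-33118 `DefiniteAnchorNonFW` (pen bsd-ssimc-plan
#     g40), signature BY NAME = the tree constant `…Theorems.SignedBaseChangeDefiniteAnchorDefs.DefiniteAnchorNonFW` (p773583, this seat; body = v23's
#     `DefiniteAnchorNFWNS` VERBATIM; route-file render pending (572)) ⟹ `stub_definiteAnchorNFW` and its twin `stub_definiteAnchorFW` RE-TYPED BY NAME to
#     the two `…DefiniteAnchorDefs` constants, certificates `definiteAnchorNFWNS_iff` / `definiteAnchorFWNS_iff := Iff.rfl`, v23-currency theorems derived;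
# (2) cite conjunct (12) «Cassels–Tate» of `stub_namedFactsSS` DROPPED (16 → 15): a TREE THEOREM (`WeierstrassCurve.exists_casselsTate_pairing_holds`),
#     re-derived as `cite_casselsTate` from `GenusExact.CasselsTatePTcReal.exists_casselsTate_pairing_of_levelThetaDatum` + `levelThetaDatumEven`.
# Rigidity road after g31 (OFF path, `--supports 20727`): Howard 3.2.3(c) mod 𝔪 at the ROOT both ways (`…AdmdefKolyvaginRoot`, `…AdmdefHowardRootEquivalence`)
# and one direction at every indefinite vertex (`…AdmdefKolyvaginVertex`).  Memo `Lines/admdef-lead-g31.md`.  HARDEST STUB: `stub_definiteAnchorNFW` (= item 33118). -/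

/-! # Line `admdef` — LINE OF RECORD for the crux `AnticyclotomicEisensteinDivisibility` (LEAD bsd-line-sbc-p1), skeleton v23
# (= v22 with the β research input RE-KEYED to its PRINT-NATURAL currency: v7's (Anch) text «at EVERY odd Selmer-zero vertex of the level-raised walk,
# Brandt data with non-zero weighted toric period» (the rank-0 mod-p converse for the level-raised definite forms = CHKLL25 Thm. 7.6 WITHOUT its
# square-free hypothesis) CUT by the Fouquet–Wan locus — TWO registered research stubs `stub_definiteAnchorFW` (PREPRINT-sourced, FW21 ×2 modulo ports)
# and `stub_definiteAnchorNFW` (UNSOURCED = K1, HARDEST) serving EVERY odd Selmer rank: at `d = 1` W. Zhang's walk has length ONE (a single Čebotarev prime;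
# Kolyvagin's conjecture is not invoked), so v22's core-root stub `stub_heegnerBottomRankOne` ((RV₁)H) is DELETED (its text and edge certificates stay as
# RECORDS; `Theorems/…AdmdefCoreRootOfSeenAnchor`, p762516, shows (RV₁)H-pinned ⟸ the anchor at ONE seen vertex).  Every v16–v22 anchor text
# ((Anch±)_NP, (Anch±)_NP,≥3, (Anch∃)_NP,≥3{,FW,¬FW}{,Z}) is DERIVED in-file from the new pair (the v23 texts are kernel-STRONGER, print-equivalent, and
# implied VERBATIM by the K1 research item the planner is asked to file — so the line closes by one-liners when that item lands; under v18–v22 the `d = 1`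
# branch carried a latent reshape debt).  The [NV] consumer `bipartiteNV_of_rootDichotomy` loses the rank split, cite (7) at the root and the Disc
# threading (binder-free again, v21 shape; `CHKLLPlusRatNS` derived again).  5 stubs: cite ×16 · S1∣ · (Anch)_FW · (Anch)_¬FW · (γ′)_NPZ; crux BY NAME ×2
# unchanged; HARDEST STUB `stub_definiteAnchorNFW`.  LEAD gen 25; memo `Lines/admdef-lead-g25.md`.)

v23 (LEAD gen 25).  NO input event since v22.  Why the re-key: (a) every β research text of v16–v22 is print-equivalent to the non-triviality mod ℘ of the
genuine signed bipartite system ([NV] on (NP); BCK21 Lem. 7.3 / Prop. 7.4), and the kernel-weakest principle that produced them forced at `d = 1` a text of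
a DIFFERENT shape ((RV₁)Z/H, Kolyvagin's conjecture mod p in corank one) which no anchor-type research theorem (K1) closes in kernel without Howard's full
rigidity (road map in the memo, M1–M4); (b) W16 being withdrawn, FW21's Steinberg prime is E's own, so the Bertolini–Darmon sign binders of v9–v22 are
idle and v7's sign-free (Anch) is the honest print statement; (c) the walk machinery (`…AdmdefSelmerWalk`, `…AdmdefSignedDetour`, kernel since g17–g18)
reaches an odd zero vertex from ANY odd `d`, including `d = 1`.  What stays: the bridge (cites (15)–(16)), the root-dichotomy wrapper (kernel; it only
weakens where the anchor is asked), §Glue, the γ′ road, S1's cut, the composition to the crux BY NAME ×2, all certificates.  New kernel this gen (landed,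
`--supports 20727`): p762516 `…AdmdefCoreRootOfSeenAnchor` (z_{0,1} ≠ 0 ⟸ unit λ⁺_1(q)(0) at one Selmer-seen adjacent vertex), p762649
`…AdmdefBipartitePropagation` (both reciprocity laws as iffs «λ unit ⟺ κ visible» at every vertex, bottom layer).

# v2–v22 (LEAD gens 15–24): one-line history — v22 (RV₁)Z ⟶ (RV₁)H · v21 (NP) ⟶ `RootZeroNS` · v20 FW cut · v19 ∃-anchor · v18 rank split · v17/v16 root
# dichotomies · v15 MULT1/P0+P1 by name · v14 weighted period · v13 bridge · v9–v12 signed re-key · v4 [NV] split · v3 Tate EPC proved · v2 VARIANT-N; full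
# paragraphs in the crux-dir history of this file (v23 = 0da8f8faa6cd, a33449327a85, 65234dff9f63, 58b17979bbae …) and the memos `Lines/admdef-lead-g15.md` … `-g24.md`.

WHAT THIS FILE PROVES (kernel, no `sorry` outside `stub_*`):
* §Glue (v5): `XAc_charIdeal_map_le_span_of_bipartiteNV` / `exists_isCWBDPLFunction_charIdeal_map_le_of_bipartiteNV` — **C⁺⁺_NS AT A POINT ⟸
  [NV]♯ + LV19 1.4 + CW24 6.7 + CW24 rel≤sgn + CHKLL25 7.5** (Thm 7.5's equality under `HasUnitLambda` is Form T_β with `k = 0`; then the road of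
  p724066 `…AdmdefFormTBeta.chkllPlusRatNS_of_formTBeta` and the Eisenstein transfer p634573); [v22] `chkllPlusRatNSDisc_of_rootDichotomy`
  (C⁺⁺_NS WITH the discriminant binders) and [v23] `chkllPlusRatNS_of_rootDichotomy` (v3's binder-free C⁺⁺_NS, derived AGAIN), both through `bipartiteNV_of_rootDichotomy`;
* `…RamifiedNSDisc.bdpLowerHalfRatSS_ramifiedNS_of_chkllPlusRatNSDisc` (imported, p759395 [v22]; v15's binder-free glue p724409 serves the RECORD certificate `bdpLowerHalfRatSS_mult_of`) — **C⁺⁺_NS ⟹ S1 on the NON-SQUARE-FREE ALL-RAMIFIED cell at `p ∤ h_K`**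
  (the width seat w7's proof of `…bdpLowerHalfRatSS_semistable_of_CHKLL` with the binder `Squarefree N` replaced by `¬ Squarefree N`
  and passed INTO the stub only; frame concordance p634869, `J/J₀` rigidity, push along `R₀ → 𝒪_{ℂ_p}` unchanged);
* `bdpLowerHalfRatSS_mult_of` — **ADOPTION CERTIFICATE: bdpline v37's registered research stub `Bdpline.stub_bdpLowerHalfRatSS_mult`
  (its exact text) follows from {CHKLL25 (print), `stub_chkllPlusRatNS`, `stub_bdpLowerHalfRatSS_unram`}** (`by_cases` on all-ramified,
  then on `Squarefree N`);
* `stub_bdpLowerHalfRatSS` (S1, derived) and `AnticyclotomicEisensteinDivisibility_of` — **the crux BY NAME** from the five stubs through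
  bdpline v37's composition (`SignedBaseChangeAcDivOfFiniteExponentTateTC.…_of_finiteExponent`), with S1 cut as: `p ∣ h_K` ⟶
  `stub_bdpLowerHalfRatSS_classDvd`; all-additive ⟶ BLV∘CW (conjunct 4, flag `BLV-step4-UNSOURCED-on-R4`); square-free ∧ all-ramified ⟶
  CHKLL25 (conjunct 8, PRINT); all-ramified ∧ ¬square-free ⟶ C⁺⁺_NS; otherwise ⟶ γ′;
* `exists_inertia_smul_geomTorsion_ne_of_sq_dvd_conductorNorm` / `allRamified_of_allAdditive` (v1, ideator; PROVED) — cell α ⊂ the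
  all-ramified cell (additive Néron–Ogg–Shafarevich, AEC VII.7.1, inertia membership kept); hence
* `bdpLowerHalfRatSS_noBLV` / `AnticyclotomicEisensteinDivisibility_of_noBLV` — the crux BY NAME WITHOUT conjunct 4: `p ∣ h_K` ⟶ S1∣;
  square-free ∧ all-ramified ⟶ CHKLL25; all-ramified (⊇ cell α, never square-free there) ⟶ C⁺⁺_NS; else ⟶ γ′.

STUBS (v23: 5; sorries ONLY here): `stub_namedFactsSS` (CITE-ONLY: 16 PRINT named facts BY NAME), `stub_bdpLowerHalfRatSS_classDvd` (S1∣ at `p ∣ h_K`, research by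
omission in print; planner restate `¬ p ∣ h_K` deletes it), `stub_definiteAnchorFW` ((Anch)_FW [v23 text `DefiniteAnchorFWNS`]: the rank-0 anchor at every odd Selmer-zero vertex
on β ∩ FW; PREPRINT-sourced FW21 ×2 modulo untyped ports T1–T4), `stub_definiteAnchorNFW` ((Anch)_¬FW [v23 text `DefiniteAnchorNFWNS`]; UNSOURCED = cell α's K1; HARDEST),
`stub_unramPlusRatNPZ` ((γ′)_NP,Z; research).  DERIVED from them: `definiteAnchor` (v7 (Anch)), every v16–v22 anchor text (`definiteAnchorExistsNP3{,FW,NFW,FWZ,NFWZ}`,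
via the signed/NP/rank-split certificates), `exists_anchorLevel_of_definiteAnchor` (the walk, any odd `d`), `unramPlusRatNP`, `chkllPlusRatNS_of_rootDichotomy` (v3 text) and
`chkllPlusRatNSDisc_of_rootDichotomy`, S1, the crux BY NAME ×2.  RECORDS (not derived): (RV₁)H / (RV₁)H-pinned / (RV₁)Z with their certificates.
HARDEST STUB: `stub_definiteAnchorNFW`.

NOT ADOPTED (LEAD gen 15 finding, `PICKED.md` / `Lines/admdef-lead-g15.md`): the supplement's finer cut [R] `HPMCPlusRigidityRat`
(`Lines/admdef_transfer.lean` rev 2) — as typed it binds `(z, L)` only through `AcSigned.TransferInputs`, which is invariant under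
`(z, L) ↦ (u • z, j(ι u)² L)`, so its conclusion fails at `u = T^m`; the ±-currency form of this stub needs the frame hypothesis
`IsCWBDPLFunction … L` (bdpline v33–v35 Form T, class-rigid by p678685, kernel-equivalent to the BDP currency by p679702/p680159).

DISPROOF USED: none exists for this crux (`ledger crux ls`: no Disproof.lean, no Negative/).  BARRIERS: `NoAdmissiblePrimesCMInert` /
`NoAdmissiblePrimesAtThree` do not bite (ρ̄ surjective, `p ≥ 5`: BD-admissible primes have positive density, BertoliniDarmon2005 Thm 3.2).
No summit statement is proved here; BSD / the crux / C⁺⁺_NS / γ′ are NOT proved by this file.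
-/

-- D-0017: single-problem summit, the namespace repeats the problem name by design.
set_option linter.dupNamespace false
set_option autoImplicit false

noncomputable section

open scoped Classical NumberField Pointwise

open NumberField IsDedekindDomain Field
  Literature.NumberTheory.EllipticCurves Literature.NumberTheory.EllipticCurves.ModularForms
  Literature.NumberTheory.EllipticCurves.Rank1Residual Literature.NumberTheory.EllipticCurves.Castella2018
  Literature.NumberTheory.EllipticCurves.CastellaWan2024 Literature.NumberTheory.GaloisRepresentations
  Literature.NumberTheory.EllipticCurves.YanZhu2026 Literature.NumberTheory.Automorphic
  Summit.BirchSwinnertonDyer.Rank1Residual.X11b Summit.BirchSwinnertonDyer.Rank1Residual.X11b.Halves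
  Summit.BirchSwinnertonDyer.BirchSwinnertonDyer.Theorems

namespace Summit.BirchSwinnertonDyer.BirchSwinnertonDyer.Cruxes.AnticyclotomicEisensteinDivisibility.AdmdefLine

open Summit.BirchSwinnertonDyer.BirchSwinnertonDyer.Theses.SignedBaseChange

/-! ## The research target C⁺⁺_NS (card `Ideas/admdef.md` §Assembly B; v1's `CHKLLPlusRat` with `Squarefree N` NEGATED) -/

/-- **C⁺⁺_NS: CHKLL25 Thm. 7.1 / Cor. 7.2 (`N⁻ = 1`, rational Eisenstein half, the tree's currency) with hypothesis (i)
`Squarefree N` REPLACED BY ITS NEGATION.**  Binder-for-binder the tree's named fact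
`CastellaHsuKunduLeeLiu2025.thm71_cor72_exists_isCWBDPLFunction_charIdeal_map_le_rat` with `Squarefree N →` turned into
`¬ Squarefree N →`: `p ≥ 5` good, `a_p = 0`, `ρ̄_{E,p}` surjective, `K` imaginary quadratic with `p = 𝔭𝔭̄` split, every `ℓ ∣ N`
split in `K`, `(N, D_K) = 1`, `p ∤ h_K`, `N` NOT square-free, (ii) `E[p]` ramified at every prime `q ∣ N`, anticyclotomic `κ`:
there is a Castella–Wan BDP frame `(Ω_K ≠ 0, Ω_p, L)` with `IsCWBDPLFunction` such that along every structure map `j : ℤ_p → R₀`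
compatible with `ℤ_p ⊂ ℂ_p`, `∃ k, (p^k)·Ch_Λ(X_ac)·R₀⟦T⟧ ⊆ (L)`.  OPEN (research); the load-bearing stub of this line (v2 = v1's
`CHKLLPlusRat` NARROWED to the minimal obligation: the square-free case is the printed theorem itself, consumed as conjunct 8 of
`stub_namedFactsSS`); reliability flag `CHKLL-inputs` (port-by-analogy of the `±` bipartite Euler system of CHKLL25 Thm. 7.4 =
[DI08 §4] + [PW11 §4.3] to arbitrary `N⁺`; the refereed ports of [PW11] beyond square-free level — Kim 2017 Rem. 6.6, W. Zhang
2014 §§2–4, Chida–Hsieh 2015 — are written in the ORDINARY setting).  Why the `∃`-frame shape is the safe one: the frame is pinned up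
to `𝒪_{ℂ_p}⟦T⟧`-units by `IsCWBDPLFunction` (frame concordance p634869), so the inclusion is a statement about canonical objects;
a class-binder form without the frame hypothesis is refutable (LEAD gen 15 finding on the supplement's [R]).
[cite: CastellaEtAl2025, Thm. 7.1, Cor. 7.2, §7.4 (arXiv:2308.10474v2 pp. 29–33)] [cite: WZhang2014, §§2–4, Thm. 6.4] (Kim 2017 = C.-H. Kim, Asian J. Math. 21, Rem. 6.6;
Chida–Hsieh 2015 = Compos. Math. 151, condition (CR⁺).) -/
@[conjecture] def CHKLLPlusRatNS : Prop :=
  ∀ {p : ℕ} [Fact p.Prime] (ι : PadicAlgCl p ≃+* ℂ) (W : WeierstrassCurve ℚ) [W.IsElliptic]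
    [W.IsGloballyMinimal] (K : Type) [Field K] [NumberField K]
    (𝔭 𝔭bar : HeightOneSpectrum (𝓞 K)) (κ : ZpExtension K p) (γ : absoluteGaloisGroup K)
    [Fact (κ.IsTopGenerator γ)] {N : ℕ} [NeZero N] {f : CuspForm (CongruenceSubgroup.Gamma0 N) 2}
    (_ : IsNewformOf W f),
    (N : ℤ) = W.conductorNorm ℤ → 5 ≤ p → W.HasGoodReductionAtPrime p → W.frobeniusTrace p = 0 →
    Surj W p →
    IsImaginaryQuadratic K → ((Ideal.span {(p : ℤ)}).primesOver (𝓞 K)).ncard = 2 →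
      ((p : ℕ) : 𝓞 K) ∈ 𝔭.asIdeal →
      (∀ (w : InfinitePlace K) (k : 𝓞 K), k ∈ 𝔭.asIdeal ↔ ‖ι.symm (w.embedding (k : K))‖ < 1) →
      ((p : ℕ) : 𝓞 K) ∈ 𝔭bar.asIdeal → 𝔭bar ≠ 𝔭 →
    (∀ ℓ : ℕ, ℓ.Prime → ℓ ∣ N → ((Ideal.span {(ℓ : ℤ)}).primesOver (𝓞 K)).ncard = 2) →
    IsCoprime (N : ℤ) (NumberField.discr K) → ¬ p ∣ NumberField.classNumber K →
    -- (i) NEGATED: `N` is NOT square-free (the square-free case is the printed theorem, conjunct 8 of the cite stub)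
    ¬ Squarefree N →
    -- (ii): `E[p]` ramified at every prime `q ∣ N`
    (∀ q : ℕ, q.Prime → q ∣ N →
      ∃ v : HeightOneSpectrum (𝓞 ℚ), ((q : ℕ) : 𝓞 ℚ) ∈ v.asIdeal ∧
        ∃ 𝔓 ∈ v.primesAbove, ∃ σ ∈ 𝔓.inertia (absoluteGaloisGroup ℚ),
          ∃ P : W.geomTorsion (p : ℤ), σ • P ≠ P) →
    κ.IsAnticyclotomic →
    ∃ (ΩK : ℂ) (Ωp : (unrIntegers p)ˣ) (L : UnrSeries p),
      ΩK ≠ 0 ∧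
      IsCWBDPLFunction ι 𝔭 κ γ f (NumberField.discr K) ΩK ((Ωp : unrIntegers p) : ℂ_[p]) L ∧
      ∀ (j : ℤ_[p] →+* unrIntegers p),
        (∀ x : ℤ_[p], ((j x : unrIntegers p) : ℂ_[p]) = algebraMap ℚ_[p] ℂ_[p] (x : ℚ_[p])) →
        ∃ k : ℕ,
          Ideal.span {PowerSeries.C ((p : unrIntegers p) ^ k)} *
              (Castella2018.AcSelmer.XAc.charIdeal (W.baseChange K) p κ 𝔭bar ∅ γ).map (PowerSeries.map j) ≤
            Ideal.span {L}

/-- **C⁺⁺_NS WITH THE DISCRIMINANT BINDERS [v22] — `CHKLLPlusRatNSDisc`**: the text `CHKLLPlusRatNS` with the two crux binders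
`Odd (NumberField.discr K) → NumberField.discr K ≠ -3 →` inserted after `¬ p ∣ NumberField.classNumber K`.  WEAKER than `CHKLLPlusRatNS` (more
hypotheses); it is what S1 actually needs on the non-square-free all-ramified cell (S1 carries both binders; glue
`Theorems/…AdmdefRamifiedNSDisc.bdpLowerHalfRatSS_ramifiedNS_of_chkllPlusRatNSDisc`, LEAD gen 24), and the binders are what the v22 core-root argument
consumes (the `μ = 0` BDP frame of cite conjunct (7), BCS25 Prop. 4.2.2, is typed with (disc)).  DERIVED (`chkllPlusRatNSDisc_of_rootDichotomy`).
[cite: CastellaEtAl2025, Thm. 7.1, Cor. 7.2, §7.4 (arXiv:2308.10474v2 pp. 29–33)] [cite: BurungaleCastellaSkinner2025, Prop. 4.2.2 (arXiv:2405.00270v2 §4.2)] -/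
@[conjecture] def CHKLLPlusRatNSDisc : Prop :=
  ∀ {p : ℕ} [Fact p.Prime] (ι : PadicAlgCl p ≃+* ℂ) (W : WeierstrassCurve ℚ) [W.IsElliptic]
    [W.IsGloballyMinimal] (K : Type) [Field K] [NumberField K]
    (𝔭 𝔭bar : HeightOneSpectrum (𝓞 K)) (κ : ZpExtension K p) (γ : absoluteGaloisGroup K)
    [Fact (κ.IsTopGenerator γ)] {N : ℕ} [NeZero N] {f : CuspForm (CongruenceSubgroup.Gamma0 N) 2}
    (_ : IsNewformOf W f),
    (N : ℤ) = W.conductorNorm ℤ → 5 ≤ p → W.HasGoodReductionAtPrime p → W.frobeniusTrace p = 0 →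
    Surj W p →
    IsImaginaryQuadratic K → ((Ideal.span {(p : ℤ)}).primesOver (𝓞 K)).ncard = 2 →
      ((p : ℕ) : 𝓞 K) ∈ 𝔭.asIdeal →
      (∀ (w : InfinitePlace K) (k : 𝓞 K), k ∈ 𝔭.asIdeal ↔ ‖ι.symm (w.embedding (k : K))‖ < 1) →
      ((p : ℕ) : 𝓞 K) ∈ 𝔭bar.asIdeal → 𝔭bar ≠ 𝔭 →
    (∀ ℓ : ℕ, ℓ.Prime → ℓ ∣ N → ((Ideal.span {(ℓ : ℤ)}).primesOver (𝓞 K)).ncard = 2) →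
    IsCoprime (N : ℤ) (NumberField.discr K) → ¬ p ∣ NumberField.classNumber K →
    -- [v22] the discriminant binders of the crux, THREADED (needed to reach the `μ = 0` frame of cite conjunct (7))
    Odd (NumberField.discr K) → NumberField.discr K ≠ -3 →
    -- (i) NEGATED: `N` is NOT square-free (the square-free case is the printed theorem, conjunct 8 of the cite stub)
    ¬ Squarefree N →
    -- (ii): `E[p]` ramified at every prime `q ∣ N`
    (∀ q : ℕ, q.Prime → q ∣ N →
      ∃ v : HeightOneSpectrum (𝓞 ℚ), ((q : ℕ) : 𝓞 ℚ) ∈ v.asIdeal ∧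
        ∃ 𝔓 ∈ v.primesAbove, ∃ σ ∈ 𝔓.inertia (absoluteGaloisGroup ℚ),
          ∃ P : W.geomTorsion (p : ℤ), σ • P ≠ P) →
    κ.IsAnticyclotomic →
    ∃ (ΩK : ℂ) (Ωp : (unrIntegers p)ˣ) (L : UnrSeries p),
      ΩK ≠ 0 ∧
      IsCWBDPLFunction ι 𝔭 κ γ f (NumberField.discr K) ΩK ((Ωp : unrIntegers p) : ℂ_[p]) L ∧
      ∀ (j : ℤ_[p] →+* unrIntegers p),
        (∀ x : ℤ_[p], ((j x : unrIntegers p) : ℂ_[p]) = algebraMap ℚ_[p] ℂ_[p] (x : ℚ_[p])) →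
        ∃ k : ℕ,
          Ideal.span {PowerSeries.C ((p : unrIntegers p) ^ k)} *
              (Castella2018.AcSelmer.XAc.charIdeal (W.baseChange K) p κ 𝔭bar ∅ γ).map (PowerSeries.map j) ≤
            Ideal.span {L}


/-! [v22 trim] The RECORD texts of v4 (`CHKLLPlusRatNSTwoMult/LeOneMult`, C⁺⁺_NS on β′/β″) and v5 (`SignedBipartiteNVTwoMult/LeOneMult`, [NV]♯ on β′/β″) —
no proof has used them since v16 (the root dichotomy runs on the whole cell) — are deleted from the live file for size; full texts in crux-dir history
(commit a33449327a85 = v21) and the HOME mirrors. -/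

/-! ## v6: the BRIDGE (print pending typing) and the research texts [NV″] in the DEFINITE (Brandt-module) currency -/

/-- **BRIDGE (v6; PRINT-construction pending typing; one text for the whole non-square-free all-ramified cell).**  Binders = those of the
[NV]♯ texts minus the β′/β″ split.  Conclusion, for every non-split datum at `𝔭`: (a) a Castella–Wan BDP frame `(Ω_K ≠ 0, Ω_p, L)`, a class
`z ∈ Sel_+(K, 𝐓^ac)` with `AcSigned.TransferInputs … 1 z L` and a `+` signed bipartite system `B` at level `N` with limit base class `z`
(= the JOINT statement CHKLL25 §7.1 (7.1), Cor 7.2 (proof), Thm 7.4, (7.2), §7.2 p. 31 L10–12 «(7.2) is the same as the class `κ±_∞` in (7.1)»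
with CW24 §6 at the same class — LEAD memo `Lines/admdef-lead-g16.md` §2); (b) **for every Zhang-admissible level `s` (finite set of
Bertolini–Darmon 1-admissible primes, `IsZhangAdmissibleLevel`) of ODD cardinality: if there are a Brandt set-up `S` of type `(N, ∏ s)`
(`Brandt.XiSetup`: definite quaternion algebra of discriminant `∏ s`, Eichler order of level `N`), a Gross point `(ψ, I)` of conductor 1
(`Brandt.IsGrossPoint S.O ψ I`, `ψ : K → S.D` optimal for `𝓞_K`) and a mod-`p` ANEMIC Hecke eigenvector `φ : Cls(S.O) → 𝔽_p` with the
eigenvalues of `f` (`Brandt.eigenSpace (ZMod p) (N·∏s) (Brandt.matrix S.O) (a_ℓ(E))`: `B(ℓ) φ = a_ℓ(E) φ` for primes `ℓ ∤ N·∏s`, in particular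
`B(p) φ = 0`) whose WEIGHTED toric period `Σ_{[𝔞] ∈ Cl(K)} w([ψ(𝔞) I]) φ([ψ(𝔞) I])` (`Brandt.toricPeriod S.O ψ I (w • φ)`, `w = Brandt.weight S.O`; [v14]: the
tree's eigenvectors are `mulVec` = divisor-convention, print's eigenform is the function `w • φ`) is NON-ZERO, then `λ+_1(∏ s)(0) ∈ ℤ_pˣ`** — print: CHKLL25
§7.4 L1–3 «By Theorem 7.5 and the construction of `λ±_j` of Theorem 7.4, it suffices to show that there exists `m ∈ 𝒩^def` and an `m`-new
eigenform `g` … for which `L±_p(g/K)` in (7.4) is invertible» with (7.4) `L±_p(g/K) = Θ±_∞(g/K)²` (theta elements of the Jacquet–Langlands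
transfer of `g` to the definite algebra of discriminant `m`; DI08 Prop 4.3, BD05 Thm 5.15: `λ_j(m)` IS the theta element of the level-raised
mod-`p^j` eigenform), the value of `Θ+` at the trivial character = `±` the conductor-1 toric period when `a_p = 0` (Gross-point trace relations
`P_{n+1} = −p·P_{n−1}` against `ω̃⁻_n(𝟙) = p^{n/2}`; `P_1 = −2 P_0`), and multiplicity one mod `p` on the definite side (PW11 Thm 6.2 / Helm,
anemic = full at the non-Eisenstein `𝔪`) to pass from THE level-raised eigenvector to ANY eigenvector with non-zero period.  OPEN here (token
CONTENT; label PRINT-construction-pending-typing; typer rows (P0)+(P1) of the memo). [cite: CastellaEtAl2025, §7.1 (7.1), Cor. 7.2, Thm. 7.4, (7.2), §7.2 p. 31, §7.4 L1–3 and (7.4) (arXiv:2308.10474v2 pp. 29–33)]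
[cite: DarmonIovita2008, Prop. 4.3] [cite: BertoliniDarmon2005, Thm. 5.15, §9] [cite: PollackWeston2011, §2.4, Thm. 6.2] [cite: CastellaWan2023, §6 (MS pp. 25–31)] -/
@[conjecture] def SignedBipartiteBridgeNS : Prop :=
  ∀ {p : ℕ} [Fact p.Prime] (ι : PadicAlgCl p ≃+* ℂ) (W : WeierstrassCurve ℚ) [W.IsElliptic]
    [W.IsGloballyMinimal] (K : Type) [Field K] [NumberField K]
    (𝔭 𝔭bar : HeightOneSpectrum (𝓞 K)) (κ : ZpExtension K p) (γ : absoluteGaloisGroup K)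
    [hγF : Fact (κ.IsTopGenerator γ)] {N : ℕ} [NeZero N] {f : CuspForm (CongruenceSubgroup.Gamma0 N) 2}
    (_ : IsNewformOf W f),
    (N : ℤ) = W.conductorNorm ℤ → 5 ≤ p → W.HasGoodReductionAtPrime p → W.frobeniusTrace p = 0 →
    Surj W p →
    IsImaginaryQuadratic K → ((Ideal.span {(p : ℤ)}).primesOver (𝓞 K)).ncard = 2 →
      (h𝔭 : ((p : ℕ) : 𝓞 K) ∈ 𝔭.asIdeal) →
      (∀ (w : InfinitePlace K) (k : 𝓞 K), k ∈ 𝔭.asIdeal ↔ ‖ι.symm (w.embedding (k : K))‖ < 1) →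
      ((p : ℕ) : 𝓞 K) ∈ 𝔭bar.asIdeal → (hne : 𝔭bar ≠ 𝔭) →
    (∀ ℓ : ℕ, ℓ.Prime → ℓ ∣ N → ((Ideal.span {(ℓ : ℤ)}).primesOver (𝓞 K)).ncard = 2) →
    IsCoprime (N : ℤ) (NumberField.discr K) → ¬ p ∣ NumberField.classNumber K →
    -- (i) NEGATED: `N` is NOT square-free
    ¬ Squarefree N →
    -- (ii): `E[p]` ramified at every prime `q ∣ N`
    (∀ q : ℕ, q.Prime → q ∣ N →
      ∃ v : HeightOneSpectrum (𝓞 ℚ), ((q : ℕ) : 𝓞 ℚ) ∈ v.asIdeal ∧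
        ∃ 𝔓 ∈ v.primesAbove, ∃ σ ∈ 𝔓.inertia (absoluteGaloisGroup ℚ),
          ∃ P : W.geomTorsion (p : ℤ), σ • P ≠ P) →
    κ.IsAnticyclotomic →
    -- BRIDGE: frame, transfer class, `+` system at it, and «definite toric period ≠ 0 mod p ⟹ λ+_1(∏ s)(0) ∈ ℤ_pˣ»
    ∀ (h𝔭ns : AcSigned.IsNonsplitIn κ 𝔭) (γ𝔭 : absoluteGaloisGroup (𝔭.adicCompletion K))
      (hγ𝔭 : κ (resGalOfEmb (closureEmb (K := K) (𝔭.adicCompletion K)) γ𝔭) = κ γ),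
      ∃ (ΩK : ℂ) (Ωp : (unrIntegers p)ˣ) (L : UnrSeries p), ΩK ≠ 0 ∧
        IsCWBDPLFunction ι 𝔭 κ γ f (NumberField.discr K) ΩK ((Ωp : unrIntegers p) : ℂ_[p]) L ∧
        ∃ (z : AcSigned.selmerLambdaAdic (W.baseChange K) p κ γ (fun _ ↦ .sgn 1))
          (B : CastellaHsuKunduLeeLiu2025.SignedBipartiteSystem W K p κ),
          AcSigned.TransferInputs (W.baseChange K) p κ γ hγF.out 𝔭 h𝔭ns γ𝔭 hγ𝔭 𝔭bar (fun h ↦ hne h.symm) h𝔭 1 z L ∧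
          CastellaHsuKunduLeeLiu2025.IsSignedBipartiteSystem W K p κ γ N 1 B ∧ B.IsLimitBaseClass z.1 ∧
          ∀ s : Finset ℕ, IsZhangAdmissibleLevel N K (fun ℓ ↦ W.frobeniusTrace ℓ) p s → Odd s.card →
            (∃ (S : Brandt.XiSetup N (∏ q ∈ s, q)) (ψ : K →ₐ[ℚ] S.D) (I : Submodule ℤ S.D)
                (φ : Brandt.ClassSet S.O → ZMod p),
                Brandt.IsGrossPoint S.O ψ I ∧
                (letI : Fintype (Brandt.ClassSet S.O) := Fintype.ofFinite _
                 φ ∈ Brandt.eigenSpace (ZMod p) (N * ∏ q ∈ s, q) (Brandt.matrix S.O) (fun ℓ ↦ W.frobeniusTrace ℓ)) ∧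
                Brandt.toricPeriod S.O ψ I (fun i ↦ (Brandt.weight S.O i : ZMod p) * φ i) ≠ 0) →
            IsUnit (PowerSeries.constantCoeff (B.lam 1 (∏ q ∈ s, q)))

/-! ### v13: the BRIDGE's two PRINT typing targets (texts = `Lines/admdef_bridge_spec.lean`, LEAD gen 19) and the kernel derivation of the BRIDGE -/

/-- **Typing target P0+P1 (joint): CHKLL25 Thm. 7.4 WITH its construction — the signed bipartite system through Castella–Wan's signed Heegner
class, the transfer inputs for THAT class, and the Darmon–Iovita dictionary for `λ±_1(m)` at the trivial character.**  Binders = those of the typed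
`thm74_exists_signedBipartiteSystem` (`AcSigned.Setting`, `N = N_E`, `N⁻ = 1`, `(N, D_K) = 1`, `5 ≤ p`, CR = `Surj`) plus those of conjunct 3
`castellaWan2024_proofThm68_transferInputs` (embedding datum `ι` inducing `𝔭`, newform `f`, topological generator, non-split datum at `𝔭`).
Conclusion: a Castella–Wan BDP frame `(Ω_K ≠ 0, Ω_p, L)`; a trace-coherent Heegner family `F` of level `N` (Castella–Wan's own, Prop. 4.1); and FOR
EACH SIGN `ε` a class `z ∈ 𝒮_ε` and a system `B` with: the laws (`IsSignedBipartiteSystem … N ε B`), `z` its limit base class ((7.2)), `z` the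
`ε`-signed Heegner class of `F` (Prop. 4.4 / Def. 4.5; «(7.2) is the same as the class `κ±_∞` in (7.1)», p. 31 L9–12), the transfer inputs of the
proof of CW24 Thm. 6.8 for `(z, L)`, and the DICTIONARY at `j = 1`: for every `m ∈ 𝒩_1^def` and every definite set-up `S` of type `(N, m)` there is a
NON-ZERO mod-`p` Hecke eigenvector `φ_g` on `Cls(S.O)` for the eigenvalues `a_ℓ(E)`, `ℓ ∤ Nm` (the Jacquet–Langlands vector of the level-raised form
`g_m`, BD05 Thm. 5.15 / CHKLL Rem. 7.3), such that for every Gross point `(ψ, I)` of conductor `1`: `λ_1(m)(0) ∈ ℤ_pˣ ⟺ P_K(w • φ_g) ≠ 0`, `P_K(w • φ_g) = Σ_𝔞 w(x_𝔞) φ_g(x_𝔞)` the WEIGHTED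
conductor-1 period ([v14]: `φ_g` is the tree's `mulVec` = divisor-convention eigenvector, print's eigenform is the function `w • φ_g`, `w = Brandt.weight S.O`) («from the
construction of the elements `λ±_j(m)` … the image of `Θ±_∞(g/K)` modulo `℘^j` is `λ±_j(m)`», p. 32 L50–63, read at the trivial character through
DI08 §2.2 at the lowest layer: `λ⁺_1(m)(𝟙) ≐ ±2·P_K(φ_g)`, `λ⁻_1(m)(𝟙) ≐ ±((p−1)/u_K)·P_K(φ_g)`).  PRINT (typing target; token CONTENT until typed).
Typer flags: [v14] the period is the WEIGHTED class sum `toricPeriod S.O ψ I (w • φ)` (v13's unweighted sum was a convention slip, LEAD memo g20 F6); `j = 1` only; existential `F` (flag `heegner-normalisation`); the dictionary is print +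
definition-unfolding (the typer may type the `Λ/ω_n`-level congruence `ω̃_n^{−ε}·λ ≡ ±L_n(φ_g)` against `GrossPointTower.lAc` and derive it).
[cite: CastellaEtAl2025, Thm. 7.4, (7.1)–(7.2), p. 31 L9–12, p. 32 L50–63 (arXiv:2308.10474v2 pp. 30–32)]
[cite: CastellaWan2023, Prop. 4.1, Prop. 4.4, Def. 4.5, proof of Thm. 6.8 (MS pp. 18–31)] [cite: DarmonIovita2008, §2.2 and §4 (Prop. 4.3, 4.4, 4.6)]
[cite: BertoliniDarmon2005, Thm. 5.15] -/
@[conjecture] def SpecP0P1 : Prop :=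
  ∀ (N : ℕ) [NeZero N] (W : WeierstrassCurve ℚ) [W.IsGloballyMinimal] (K : Type) [Field K] [NumberField K]
    (p : ℕ) [Fact p.Prime] (κ : ZpExtension K p) (𝔭 𝔭' : HeightOneSpectrum (𝓞 K))
    (hS : AcSigned.Setting W K p κ 𝔭 𝔭') (ι : PadicAlgCl p ≃+* ℂ) {f : CuspForm (CongruenceSubgroup.Gamma0 N) 2} (_ : IsNewformOf W f),
    (W.conductorNorm ℤ : ℕ) = N → SatisfiesHeegnerHypothesis N K → IsCoprime (N : ℤ) (NumberField.discr K) → 5 ≤ p →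
    Surj W p → (∀ (w : InfinitePlace K) (k : 𝓞 K), k ∈ 𝔭.asIdeal ↔ ‖ι.symm (w.embedding (k : K))‖ < 1) →
    ∀ (γ : absoluteGaloisGroup K) (hγ : κ.IsTopGenerator γ) (h𝔭 : AcSigned.IsNonsplitIn κ 𝔭)
      (γ𝔭 : absoluteGaloisGroup (𝔭.adicCompletion K))
      (hγ𝔭 : κ (resGalOfEmb (closureEmb (K := K) (𝔭.adicCompletion K)) γ𝔭) = κ γ),
      ∃ (ΩK : ℂ) (Ωp : (unrIntegers p)ˣ) (L : UnrSeries p), ΩK ≠ 0 ∧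
        IsCWBDPLFunction ι 𝔭 κ γ f (NumberField.discr K) ΩK ((Ωp : unrIntegers p) : ℂ_[p]) L ∧
        ∃ (jbar : AlgebraicClosure K →+* ℂ) (F : HeegnerFamily N W K κ jbar), F.IsTraceCoherentApZero ∧
          ∀ ε : ℤˣ, ∃ (z : AcSigned.selmerLambdaAdic (W.baseChange K) p κ γ (fun _ ↦ .sgn ε))
            (B : CastellaHsuKunduLeeLiu2025.SignedBipartiteSystem W K p κ),
            CastellaHsuKunduLeeLiu2025.IsSignedBipartiteSystem W K p κ γ N ε B ∧ B.IsLimitBaseClass z.1 ∧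
            AcSigned.IsSignedHeegnerClass p κ γ F ε z.1 ∧
            AcSigned.TransferInputs (W.baseChange K) p κ γ hγ 𝔭 h𝔭 γ𝔭 hγ𝔭 𝔭' (fun h ↦ hS.ne h.symm) hS.mem ε z L ∧
            -- DICTIONARY at `j = 1`: `λ_1(m)(0)` is a unit iff the WEIGHTED conductor-1 toric period `Σ_𝔞 w(x_𝔞) φ(x_𝔞)` of the JL eigenvector is non-zero mod `p` [v14]
            ∀ m ∈ CastellaHsuKunduLeeLiu2025.defProducts N K (fun ℓ ↦ W.frobeniusTrace ℓ) p 1, ∀ (S : Brandt.XiSetup N m),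
              ∃ φ : Brandt.ClassSet S.O → ZMod p, φ ≠ 0 ∧
                (letI : Fintype (Brandt.ClassSet S.O) := Fintype.ofFinite _
                 φ ∈ Brandt.eigenSpace (ZMod p) (N * m) (Brandt.matrix S.O) (fun ℓ ↦ W.frobeniusTrace ℓ)) ∧
                ∀ (ψ : K →ₐ[ℚ] S.D) (I : Submodule ℤ S.D), Brandt.IsGrossPoint S.O ψ I →
                  (IsUnit (PowerSeries.constantCoeff (B.lam 1 m)) ↔ Brandt.toricPeriod S.O ψ I (fun i ↦ (Brandt.weight S.O i : ZMod p) * φ i) ≠ 0)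

/-- **Typing target MULT1: multiplicity one modulo `p` on the definite side** — for `m ∈ 𝒩_1^def` and a definite set-up `S` of type `(N, m)`
(`N = N_E`, `ρ̄_{E,p}` onto, `p ≥ 5`, `K` imaginary quadratic with every `ℓ ∣ N` split, `E[p]` ramified at every `q ∣ N`), the mod-`p` eigenspace
of the Brandt module of `S` for the eigenvalues `a_ℓ(E)` (`ℓ ∤ Nm` prime) is spanned by any of its non-zero vectors.  Print: Pollack–Weston 2011
Thm. 6.2 (`S_2(N⁺, N⁻m; ℤ_p)_𝔪` free of rank one over `𝕋_𝔪` under CR, `N` square-free); at non-square-free `N⁺`: Kim–Ota 2023 §5 (freeness under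
CR⁺; CR⁺(7) ⟸ `N(ρ̄_{E,p}) = N_E`, kernel on the all-ramified cell modulo Saito at `v ∣ 2`, `Lines/koeta_sketch.lean`).  PRINT (typing target;
token CONTENT until typed; typer flag `mult-one-socle-vs-cosocle`: eigenvectors of the Brandt matrices = the `𝔪`-torsion of the dual module).
[cite: PollackWeston2011, Thm. 6.2] [cite: KimOta2023, Thm. 5.5, Cor. 5.7 (arXiv:1905.02926)] [cite: BertoliniDarmon2005, Thm. 5.15 (ii)] -/
@[conjecture] def SpecMult1 : Prop :=
  ∀ (N : ℕ) [NeZero N] (W : WeierstrassCurve ℚ) [W.IsElliptic] [W.IsGloballyMinimal] (K : Type) [Field K] [NumberField K]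
    (p : ℕ) [Fact p.Prime],
    (N : ℤ) = W.conductorNorm ℤ → 5 ≤ p → W.HasGoodReductionAtPrime p → Surj W p → IsImaginaryQuadratic K →
    (∀ ℓ : ℕ, ℓ.Prime → ℓ ∣ N → ((Ideal.span {(ℓ : ℤ)}).primesOver (𝓞 K)).ncard = 2) →
    (∀ q : ℕ, q.Prime → q ∣ N →
      ∃ v : HeightOneSpectrum (𝓞 ℚ), ((q : ℕ) : 𝓞 ℚ) ∈ v.asIdeal ∧
        ∃ 𝔓 ∈ v.primesAbove, ∃ σ ∈ 𝔓.inertia (absoluteGaloisGroup ℚ),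
          ∃ P : W.geomTorsion (p : ℤ), σ • P ≠ P) →
    ∀ m ∈ CastellaHsuKunduLeeLiu2025.defProducts N K (fun ℓ ↦ W.frobeniusTrace ℓ) p 1, ∀ (S : Brandt.XiSetup N m)
      (φ₁ φ₂ : Brandt.ClassSet S.O → ZMod p),
      (letI : Fintype (Brandt.ClassSet S.O) := Fintype.ofFinite _
       φ₁ ∈ Brandt.eigenSpace (ZMod p) (N * m) (Brandt.matrix S.O) (fun ℓ ↦ W.frobeniusTrace ℓ)) →
      (letI : Fintype (Brandt.ClassSet S.O) := Fintype.ofFinite _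
       φ₂ ∈ Brandt.eigenSpace (ZMod p) (N * m) (Brandt.matrix S.O) (fun ℓ ↦ W.frobeniusTrace ℓ)) →
      φ₁ ≠ 0 → ∃ c : ZMod p, φ₂ = c • φ₁

/-- The toric period is linear in the function: `P(c • φ) = c • P(φ)`. [folklore] -/
theorem toricPeriod_smul' {K : Type} [Field K] [NumberField K] {D : Type} [Ring D] [Algebra ℚ D]
    (O : Submodule ℤ D) (ψ : K →ₐ[ℚ] D) (I : Submodule ℤ D) {p : ℕ} (c : ZMod p) (φ : Brandt.ClassSet O → ZMod p) :
    Brandt.toricPeriod O ψ I (c • φ) = c • Brandt.toricPeriod O ψ I φ := by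
  rw [Brandt.toricPeriod_def, Brandt.toricPeriod_def, Finset.smul_sum]
  refine Finset.sum_congr rfl fun 𝔞 _ ↦ ?_
  simp only [Brandt.evalAtLattice, Pi.smul_apply]
  split_ifs <;> simp

/-- The toric period of the zero function vanishes. [folklore] -/
theorem toricPeriod_zero' {K : Type} [Field K] [NumberField K] {D : Type} [Ring D] [Algebra ℚ D]
    (O : Submodule ℤ D) (ψ : K →ₐ[ℚ] D) (I : Submodule ℤ D) {R : Type*} [AddCommMonoid R] :
    Brandt.toricPeriod O ψ I (0 : Brandt.ClassSet O → R) = 0 := by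
  rw [Brandt.toricPeriod_def]
  refine Finset.sum_eq_zero fun 𝔞 _ ↦ ?_
  simp only [Brandt.evalAtLattice]
  split_ifs <;> rfl

/-- **[v14] Weighting commutes with scalars**: `w • (c • φ) = c • (w • φ)` for the Gross weights `w = Brandt.weight O` (so the WEIGHTED toric
period `P_K(w • φ) = Σ_𝔞 w(x_𝔞) φ(x_𝔞)` is again linear in `φ`). [folklore] -/
theorem weight_mul_smul' {D : Type} [Ring D] (O : Submodule ℤ D) {p : ℕ} (c : ZMod p) (φ : Brandt.ClassSet O → ZMod p) :
    (fun i ↦ (Brandt.weight O i : ZMod p) * (c • φ) i) = c • fun i ↦ (Brandt.weight O i : ZMod p) * φ i := by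
  funext i
  simp only [Pi.smul_apply, smul_eq_mul]
  ring

/-- **[v14] The weighted zero function is zero**: `w • 0 = 0`. [folklore] -/
theorem weight_mul_zero' {D : Type} [Ring D] (O : Submodule ℤ D) {p : ℕ} :
    (fun i ↦ (Brandt.weight O i : ZMod p) * (0 : Brandt.ClassSet O → ZMod p) i) = 0 := by
  funext i
  simp

/-- **v13/v14: the BRIDGE text DERIVED from its two typing targets (kernel; = `Lines/admdef_bridge_spec.lean` `bridge_text_of_spec`).**  Build
`AcSigned.Setting` from the cell binders; `SpecP0P1` at the sign `+` gives the frame, the class, the system (laws, base class) and the transfer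
inputs — part (a) — and the dictionary; for part (b), at an odd Zhang-admissible level `s` the product `∏ s` lies in `𝒩_1^def`
(`…AdmdefBipartiteNVLevelOne.prod_mem_defProducts_one`), the hands' eigenvector `φ` with non-zero WEIGHTED period `P_K(w • φ)` is non-zero, so by
`SpecMult1` `φ = c • φ_g`, whence `P_K(w • φ_g) ≠ 0` and `λ⁺_1(∏ s)(0) ∈ ℤ_pˣ` ([v14]: weighted periods throughout; linearity `weight_mul_smul'`).
[cite: CastellaEtAl2025, §7.4 L1–3, (7.4), p. 32 L50–63 (arXiv:2308.10474v2 pp. 32–33)] [cite: PollackWeston2011, Thm. 6.2] -/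
theorem bridge_of_spec (hP : SpecP0P1) (hM : SpecMult1) : SignedBipartiteBridgeNS := by
  intro p _ ι W _ _ K _ _ 𝔭 𝔭bar κ γ hγF N _ f hf hN hp hgood hap hsurj hK _hsplit h𝔭 hι h𝔭bar hne hHeeg hcop hh _hnsq
    hram hac h𝔭ns γ𝔭 hγ𝔭
  have hp2 : p ≠ 2 := by omega
  have hS : AcSigned.Setting W K p κ 𝔭 𝔭bar :=
    { isElliptic := ‹_›
      p_ne_two := hp2
      goodSS := ⟨hgood, by rw [hap]; exact dvd_zero _⟩
      frobeniusTrace_eq_zero := hap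
      isImaginaryQuadratic := hK
      mem := h𝔭
      mem' := h𝔭bar
      ne := hne
      anticyclotomic := hac
      not_dvd_classNumber := hh }
  have hN' : (W.conductorNorm ℤ : ℕ) = N := by exact_mod_cast hN.symm
  have hHg : SatisfiesHeegnerHypothesis N K := fun ℓ hℓ hℓN ↦ hHeeg ℓ hℓ hℓN
  obtain ⟨ΩK, Ωp, L, hΩ, hBDP, jbar, F, _hF, hsign⟩ :=
    hP N W K p κ 𝔭 𝔭bar hS ι hf hN' hHg hcop hp hsurj hι γ hγF.out h𝔭ns γ𝔭 hγ𝔭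
  obtain ⟨z, B, hB, hbase, _hzF, hT, hdict⟩ := hsign 1
  refine ⟨ΩK, Ωp, L, hΩ, hBDP, z, B, hT, hB, hbase, fun s hs hodd ⟨S, ψ, I, φ, hG, hφ, hper⟩ ↦ ?_⟩
  have hm : (∏ q ∈ s, q) ∈ CastellaHsuKunduLeeLiu2025.defProducts N K (fun ℓ ↦ W.frobeniusTrace ℓ) p 1 :=
    SignedBaseChangeAcDivAdmdefBipartiteNVLevelOne.prod_mem_defProducts_one hs hodd
  obtain ⟨φg, hφg0, hφg, hiff⟩ := hdict (∏ q ∈ s, q) hm S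
  have hφ0 : φ ≠ 0 := by
    rintro rfl
    exact hper (by rw [weight_mul_zero']; exact toricPeriod_zero' S.O ψ I)
  obtain ⟨c, hc⟩ := hM N W K p hN hp hgood hsurj hK hHeeg hram (∏ q ∈ s, q) hm S φg φ hφg hφ hφg0
  have hPg : Brandt.toricPeriod S.O ψ I (fun i ↦ (Brandt.weight S.O i : ZMod p) * φg i) ≠ 0 := by
    intro h0
    apply hper
    rw [hc, weight_mul_smul', toricPeriod_smul', h0, smul_zero]
  exact (hiff ψ I hG).mpr hPg

/-! [v22 trim] The v6 RECORD texts `DefiniteToricNVTwoMult/LeOneMult` ([NV″] in the definite currency on β′/β″) are deleted for size (unused since v16);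
full texts in crux-dir history (a33449327a85) and the HOME mirrors. -/

/-! ## v7: the research texts behind [NV″] — (Par) and (Anch) = (P3), in the AKR level-raised Selmer currency -/

/-- **(Par) — the bottom `p`-Selmer dimension over `K` is ODD** (v7 stub text).  Binders: `(N : ℤ) = N_E`, `p ≥ 5`, `ρ̄_{E,p}` onto, `K`
imaginary quadratic, every `ℓ ∣ N` split in `K`, a non-trivial `c ∈ Aut(K/ℚ)` and the (unique) `𝔽_p`-structure of `H¹(K, E[p])`.  Conclusion:
`dim_𝔽p Sel_∅⁺ + dim_𝔽p Sel_∅⁻` is odd, where `Sel_∅^μ = AdditiveKoly.SelQP W K p c ∅ μ` is the `μ`-eigenspace of `c` in the classical `p`-Selmer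
group `Sel_p(E/K) ⊂ H¹(K, E[p])` (Kummer conditions everywhere; no toric condition at level `∅`).  PRINT, port pending: `Sel_p(E/K) = Sel_∅⁺ ⊕ Sel_∅⁻`
(`p` odd), `dim Sel_p(E[p]/K) = rk_p(E/K) + dim E(K)[p] + dim (Ш(E/K)[p^∞]/div)[p]` (Kummer sequence + structure of cofinitely generated
`ℤ_p`-modules), `E(K)[p] = 0` (`ρ̄` onto, `[K:ℚ] = 2`, `p ≥ 5`), `dim (Ш[p^∞]/div)[p]` EVEN (Cassels–Tate alternating form), and `rk_p(E/K)` ODD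
= Dokchitser–Dokchitser 2010 §4.6, proof of Thm 4.19, step (4) («so it suffices to prove it for `E/M₀`»; root number `w(E/K) = −1` under
Heegner) = the tree's typed named fact `Literature.NumberTheory.EllipticCurves.dokchitser_selmerCorank_baseChange_mod_two_eq`
(`(W.baseChange K).selmerCorank p % 2 = 1`).  v7: stub (port pending); v8: DERIVED (`oddSelmerDim`, from cite conjuncts (12)–(13) by `Theorems/…AdmdefOddSelmerDim.lean`).
[cite: DokchitserDokchitserAnnals2010, §4.6, Thm. 4.19 (= Thm. 1.4), pp. 26–27] [cite: WZhang2014, Thm. 9.2 (m = 1)] [cite: MilneADT2006, Ch. I, Thm. 6.13, Cor. 6.24] -/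
@[conjecture] def OddSelmerDimBeta : Prop :=
  ∀ {p : ℕ} [Fact p.Prime] (W : WeierstrassCurve ℚ) [W.IsElliptic] [W.IsGloballyMinimal]
    (K : Type) [Field K] [NumberField K] {N : ℕ},
    (N : ℤ) = W.conductorNorm ℤ → 5 ≤ p → Surj W p → IsImaginaryQuadratic K →
    (∀ ℓ : ℕ, ℓ.Prime → ℓ ∣ N → ((Ideal.span {(ℓ : ℤ)}).primesOver (𝓞 K)).ncard = 2) →
    ∀ (c : K ≃ₐ[ℚ] K), c ≠ 1 → ∀ [Module (ZMod p) (AdditiveKoly.Vp W K p)],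
      Odd (Module.finrank (ZMod p) (AdditiveKoly.SelQP W K p c ∅ true) +
        Module.finrank (ZMod p) (AdditiveKoly.SelQP W K p c ∅ false))

/-- **(Anch) — the v7–v8 registered text** (superseded since v9; RECORD only, source of `definiteAnchorSignedNS_of_definiteAnchorNS`): Brandt data with
non-zero weighted toric period at EVERY odd zero vertex of cell β.  Full docstring in crux-dir history.  [cite: WZhang2014, Thm. 5.2, Thm. 6.4, Thm. 7.2, Thm. 9.1]
[cite: BertoliniDarmon2005, Thm. 5.15, §9] [cite: Gross1987, §§3–4, Prop. 10.3] -/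
@[conjecture] def DefiniteAnchorNS : Prop :=
  ∀ {p : ℕ} [Fact p.Prime] (W : WeierstrassCurve ℚ) [W.IsElliptic] [W.IsGloballyMinimal]
    (K : Type) [Field K] [NumberField K] {N : ℕ} [NeZero N] {f : CuspForm (CongruenceSubgroup.Gamma0 N) 2}
    (_ : IsNewformOf W f),
    (N : ℤ) = W.conductorNorm ℤ → 5 ≤ p → W.HasGoodReductionAtPrime p → W.frobeniusTrace p = 0 →
    Surj W p →
    IsImaginaryQuadratic K → ((Ideal.span {(p : ℤ)}).primesOver (𝓞 K)).ncard = 2 →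
    (∀ ℓ : ℕ, ℓ.Prime → ℓ ∣ N → ((Ideal.span {(ℓ : ℤ)}).primesOver (𝓞 K)).ncard = 2) →
    IsCoprime (N : ℤ) (NumberField.discr K) → ¬ p ∣ NumberField.classNumber K →
    -- (i) NEGATED: `N` is NOT square-free
    ¬ Squarefree N →
    -- (ii): `E[p]` ramified at every prime `q ∣ N`
    (∀ q : ℕ, q.Prime → q ∣ N →
      ∃ v : HeightOneSpectrum (𝓞 ℚ), ((q : ℕ) : 𝓞 ℚ) ∈ v.asIdeal ∧
        ∃ 𝔓 ∈ v.primesAbove, ∃ σ ∈ 𝔓.inertia (absoluteGaloisGroup ℚ),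
          ∃ P : W.geomTorsion (p : ℤ), σ • P ≠ P) →
    -- (Anch): at every ODD ZERO VERTEX of the level-raised Selmer walk, Brandt data with a non-zero mod-p WEIGHTED toric period [v14]
    ∀ (c : K ≃ₐ[ℚ] K), c ≠ 1 → ∀ [Module (ZMod p) (AdditiveKoly.Vp W K p)],
      ∀ n : Finset (AdditiveKoly.AdmQ W K p), Odd n.card → (∀ μ : Bool, AdditiveKoly.SelQP W K p c n μ = ⊥) →
        ∃ (S : Brandt.XiSetup N (∏ q ∈ n.image Subtype.val, q)) (ψ : K →ₐ[ℚ] S.D) (I : Submodule ℤ S.D)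
          (φ : Brandt.ClassSet S.O → ZMod p),
          Brandt.IsGrossPoint S.O ψ I ∧
          (letI : Fintype (Brandt.ClassSet S.O) := Fintype.ofFinite _
           φ ∈ Brandt.eigenSpace (ZMod p) (N * ∏ q ∈ n.image Subtype.val, q) (Brandt.matrix S.O) (fun ℓ ↦ W.frobeniusTrace ℓ)) ∧
          Brandt.toricPeriod S.O ψ I (fun i ↦ (Brandt.weight S.O i : ZMod p) * φ i) ≠ 0

/-! ### [v23] THE PRINT-NATURAL ANCHOR, CUT BY THE FOUQUET–WAN LOCUS — the registered research texts of v23 (LEAD gen 25).  v7's (Anch) text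
(sign-free: W16 is withdrawn, FW21's Steinberg prime is E's own, so the Bertolini–Darmon signs of v9–v22 are idle) with the v20 cut.  Every v16–v22
anchor text ((Anch±)_NP, (Anch±)_NP,≥3, (Anch∃)_NP,≥3{,FW,¬FW}{,Z}) is DERIVED from the pair below (in-file certificates); the v22 core-root text (RV₁)H is
no longer needed by the composition (the walk of length one serves `d = 1`) and stays a RECORD with its edge certificates. -/

/-- **(Anch)_FW [v23] — THE REGISTERED TEXT of `stub_definiteAnchorFW`**: v7's (Anch) text `DefiniteAnchorNS` VERBATIM — on cell β (`(N : ℤ) = N_E`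
with newform `f`, `p ≥ 5` good, `a_p = 0`, `ρ̄_{E,p}` onto, `K` imaginary quadratic, `p` split, every `ℓ ∣ N` split, `(N, D_K) = 1`, `p ∤ h_K`, `N` not
square-free, `E[p]` ramified at every `q ∣ N`), at EVERY odd zero vertex `n` of the level-raised Selmer walk (`Sel_n^± = 0` in the AKR currency `SelQP`),
Brandt data at level `N·∏n` (definite set-up, Gross point of `K`, mod-`p` `a_•(E)`-eigenvector off the level) with NON-ZERO WEIGHTED toric period —
with ONE inserted hypothesis, the FOUQUET–WAN LOCUS `Rank1Residual.Additive.FWNonsplitRam W p` (some non-split multiplicative `q ≠ p` with `E[p]` ramified).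
This is the PRINT-NATURAL research statement: the rank-0 mod-`p` converse for the level-raised definite forms `g_n` and `g_n ⊗ χ_K` — CHKLL25 Thm. 7.6
(`L(g/K,1) ≠ 0 ⟺ Sel_℘∞(A_g/K)` finite, with the `℘`-adic valuation formula) WITHOUT its hypothesis (ii) «`M` square-free», read at a Selmer-zero vertex
through control (T4), Gross's special-value formula mod `℘` with the WEIGHTED period and multiplicity one (T3, KO23), level raising (T2).  SOURCED on this
locus (PREPRINT, modulo the untyped ports T1–T4): FW21 Thm. 5.1 ∕ Cor. 1.10 ×2 (Steinberg prime = E's own ramified non-split `q`, which splits in `K`).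
Uniform in the Selmer rank: it feeds the [NV] consumer at `d = 1` (walk of length ONE: a single Čebotarev prime kills the Selmer line, W. Zhang Prop. 5.4)
exactly as at `d ≥ 3` — no separate Kolyvagin-conjecture text is needed.  STRONGER (asks more vertices) than the v19–v22 ∃/NP/rank-split texts, all of which
it implies (certificates below); chosen because it is implied VERBATIM by the research item the planner is asked to file (K1 in print currency), so the
line closes by one-liners when that item lands.  Token (390): CONTENT.
[cite: CastellaEtAl2025, Thm. 7.6, §7.4, Thm. 7.5 (arXiv:2308.10474v2 pp. 31–33)] [cite: FouquetWan2021, Thm. 5.1, Cor. 1.10, Thm. 1.7 (arXiv:2107.13726v3 pp. 5–6, 53)]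
[cite: WZhang2014, Prop. 5.4, Thm. 5.2, Thm. 7.2, Thm. 9.1] [cite: KimOta2023, Thm. 1.3, Cor. 5.7] [cite: Gross1987, Prop. 10.3, §11] -/
@[conjecture] def DefiniteAnchorFWNS : Prop :=
  ∀ {p : ℕ} [Fact p.Prime] (W : WeierstrassCurve ℚ) [W.IsElliptic] [W.IsGloballyMinimal]
    (K : Type) [Field K] [NumberField K] {N : ℕ} [NeZero N] {f : CuspForm (CongruenceSubgroup.Gamma0 N) 2}
    (_ : IsNewformOf W f),
    (N : ℤ) = W.conductorNorm ℤ → 5 ≤ p → W.HasGoodReductionAtPrime p → W.frobeniusTrace p = 0 →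
    Surj W p →
    IsImaginaryQuadratic K → ((Ideal.span {(p : ℤ)}).primesOver (𝓞 K)).ncard = 2 →
    (∀ ℓ : ℕ, ℓ.Prime → ℓ ∣ N → ((Ideal.span {(ℓ : ℤ)}).primesOver (𝓞 K)).ncard = 2) →
    IsCoprime (N : ℤ) (NumberField.discr K) → ¬ p ∣ NumberField.classNumber K →
    -- (i) NEGATED: `N` is NOT square-free
    ¬ Squarefree N →
    -- (ii): `E[p]` ramified at every prime `q ∣ N`
    (∀ q : ℕ, q.Prime → q ∣ N →
      ∃ v : HeightOneSpectrum (𝓞 ℚ), ((q : ℕ) : 𝓞 ℚ) ∈ v.asIdeal ∧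
        ∃ 𝔓 ∈ v.primesAbove, ∃ σ ∈ 𝔓.inertia (absoluteGaloisGroup ℚ),
          ∃ P : W.geomTorsion (p : ℤ), σ • P ≠ P) →
    -- [v23] the FOUQUET–WAN LOCUS: some non-split multiplicative `q ≠ p` with `E[p]` ramified — FW21's Steinberg prime for every `g_n`, `g_n ⊗ χ_K`
    Summit.BirchSwinnertonDyer.Rank1Residual.Additive.FWNonsplitRam W p →
    -- (Anch): at every ODD ZERO VERTEX of the level-raised Selmer walk, Brandt data with a non-zero mod-p WEIGHTED toric period [v14] — (Anch), v7 text
    ∀ (c : K ≃ₐ[ℚ] K), c ≠ 1 → ∀ [Module (ZMod p) (AdditiveKoly.Vp W K p)],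
      ∀ n : Finset (AdditiveKoly.AdmQ W K p), Odd n.card → (∀ μ : Bool, AdditiveKoly.SelQP W K p c n μ = ⊥) →
        ∃ (S : Brandt.XiSetup N (∏ q ∈ n.image Subtype.val, q)) (ψ : K →ₐ[ℚ] S.D) (I : Submodule ℤ S.D)
          (φ : Brandt.ClassSet S.O → ZMod p),
          Brandt.IsGrossPoint S.O ψ I ∧
          (letI : Fintype (Brandt.ClassSet S.O) := Fintype.ofFinite _
           φ ∈ Brandt.eigenSpace (ZMod p) (N * ∏ q ∈ n.image Subtype.val, q) (Brandt.matrix S.O) (fun ℓ ↦ W.frobeniusTrace ℓ)) ∧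
          Brandt.toricPeriod S.O ψ I (fun i ↦ (Brandt.weight S.O i : ZMod p) * φ i) ≠ 0

/-- **(Anch)_¬FW [v23] — THE REGISTERED TEXT of `stub_definiteAnchorNFW` (HARDEST)**: the same text with the NEGATED Fouquet–Wan hypothesis
`¬ Rank1Residual.Additive.FWNonsplitRam W p` (on β this forces every multiplicative prime of `E` to be SPLIT; it contains the multiplicative-free part of β).
UNSOURCED: the rank-0 mod-`p` converse ∕ Eisenstein lower bound for the non-ordinary level-raised forms `g_n`, `g_n ⊗ χ_K` whose level has NO `ρ̄`-ramified
non-split Steinberg prime — FW21 Thm. 5.1's third hypothesis fails (admissible primes are `ρ̄`-unramified; E's multiplicative primes are split, `μ = 1`),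
SU14 needs ordinary, CÇSS18 Thm. C ∕ BSTW24 need square-free ∕ semistable level, CLW22 needs a ramified non-split `q`: the named open input K1 of cell α
and of β∖FW alike (`PrimkolyCells.k1Binders_iff_cellAlpha_or_cellBetaSplitOnly`).  Token (390): CONTENT.
[cite: CastellaEtAl2025, Thm. 7.6, §7.4] [cite: FouquetWan2021, Thm. 5.1 (third hypothesis), Cor. 1.10] [cite: SkinnerUrban2014, Thm. 3.29]
[cite: BurungaleSkinnerTianWan2024, Thm. 1.5–1.6 (arXiv:2409.01350)] [cite: WZhang2014, Thm. 9.1] -/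
@[conjecture] def DefiniteAnchorNFWNS : Prop :=
  ∀ {p : ℕ} [Fact p.Prime] (W : WeierstrassCurve ℚ) [W.IsElliptic] [W.IsGloballyMinimal]
    (K : Type) [Field K] [NumberField K] {N : ℕ} [NeZero N] {f : CuspForm (CongruenceSubgroup.Gamma0 N) 2}
    (_ : IsNewformOf W f),
    (N : ℤ) = W.conductorNorm ℤ → 5 ≤ p → W.HasGoodReductionAtPrime p → W.frobeniusTrace p = 0 →
    Surj W p →
    IsImaginaryQuadratic K → ((Ideal.span {(p : ℤ)}).primesOver (𝓞 K)).ncard = 2 →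
    (∀ ℓ : ℕ, ℓ.Prime → ℓ ∣ N → ((Ideal.span {(ℓ : ℤ)}).primesOver (𝓞 K)).ncard = 2) →
    IsCoprime (N : ℤ) (NumberField.discr K) → ¬ p ∣ NumberField.classNumber K →
    -- (i) NEGATED: `N` is NOT square-free
    ¬ Squarefree N →
    -- (ii): `E[p]` ramified at every prime `q ∣ N`
    (∀ q : ℕ, q.Prime → q ∣ N →
      ∃ v : HeightOneSpectrum (𝓞 ℚ), ((q : ℕ) : 𝓞 ℚ) ∈ v.asIdeal ∧
        ∃ 𝔓 ∈ v.primesAbove, ∃ σ ∈ 𝔓.inertia (absoluteGaloisGroup ℚ),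
          ∃ P : W.geomTorsion (p : ℤ), σ • P ≠ P) →
    -- [v23] OFF the Fouquet–Wan locus (UNSOURCED half = K1)
    ¬ Summit.BirchSwinnertonDyer.Rank1Residual.Additive.FWNonsplitRam W p →
    -- (Anch): at every ODD ZERO VERTEX of the level-raised Selmer walk, Brandt data with a non-zero mod-p WEIGHTED toric period [v14] — (Anch), v7 text
    ∀ (c : K ≃ₐ[ℚ] K), c ≠ 1 → ∀ [Module (ZMod p) (AdditiveKoly.Vp W K p)],
      ∀ n : Finset (AdditiveKoly.AdmQ W K p), Odd n.card → (∀ μ : Bool, AdditiveKoly.SelQP W K p c n μ = ⊥) →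
        ∃ (S : Brandt.XiSetup N (∏ q ∈ n.image Subtype.val, q)) (ψ : K →ₐ[ℚ] S.D) (I : Submodule ℤ S.D)
          (φ : Brandt.ClassSet S.O → ZMod p),
          Brandt.IsGrossPoint S.O ψ I ∧
          (letI : Fintype (Brandt.ClassSet S.O) := Fintype.ofFinite _
           φ ∈ Brandt.eigenSpace (ZMod p) (N * ∏ q ∈ n.image Subtype.val, q) (Brandt.matrix S.O) (fun ℓ ↦ W.frobeniusTrace ℓ)) ∧
          Brandt.toricPeriod S.O ψ I (fun i ↦ (Brandt.weight S.O i : ZMod p) * φ i) ≠ 0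

end Summit.BirchSwinnertonDyer.BirchSwinnertonDyer.Cruxes.AnticyclotomicEisensteinDivisibility.AdmdefLine

/-! # ———————————————————————————————————————————————————————————————————————————————————————————————————————————
# INLINE (v9–v11; trimmed in v12): the ideator's crux idea «signdetour» (bsd-idea-5 g23; `Ideas/signdetour.md`, `Lines/signdetour_sketch.lean` rev 2
# 76c99f1b88eb88c0, critic idea-crit-15 V#27u PASS-WITH-PRICE) — §1 (Equiv)-signs and §2 inputs as Props stay inline (the registered text
# `DefiniteAnchorSignedNS` names `HasBothSigns`); §3 THE SIGNED DETOUR, §4 composition, §5a–c are now the landed `Theorems/…AdmdefSignedDetour.lean`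
# (p740358) / `…AdmdefSignedSupply.lean` (p739682) / `…AdmdefSelmerWalk.lean` (p733010); §5d–e = the (Anch±) text and the plugs.  Credit: bsd-idea-5 g23.
# ——————————————————————————————————————————————————————————————————————————————————————————————————————————— -/

namespace Summit.BirchSwinnertonDyer.BirchSwinnertonDyer.Cruxes.AnticyclotomicEisensteinDivisibility.Signdetour

open Function WeierstrassCurve NumberField IsDedekindDomain Field Module
  Literature.NumberTheory.EllipticCurves Literature.NumberTheory.EllipticCurves.ModularForms
  Literature.NumberTheory.EllipticCurves.Rank1Residual
  Literature.NumberTheory.GaloisRepresentations Literature.NumberTheory.GaloisRepresentations.DiscreteGaloisModule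
  Literature.NumberTheory.GaloisCohomology Literature.NumberTheory.Automorphic
  Summit.BirchSwinnertonDyer.Rank1Residual.X11b Summit.BirchSwinnertonDyer.Rank1Residual.GaloisImage
  Summit.BirchSwinnertonDyer.BirchSwinnertonDyer.Theorems Summit.BirchSwinnertonDyer.BirchSwinnertonDyer.Theorems.AdditiveKoly
  Summit.BirchSwinnertonDyer.BirchSwinnertonDyer.Theorems.SchneiderFreeAdditiveX3.PoitouTateReduction
open Summit.BirchSwinnertonDyer.BirchSwinnertonDyer.Cruxes.AnticyclotomicEisensteinDivisibility.AdmdefLine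

variable (W : WeierstrassCurve ℚ) (K : Type) [Field K] [NumberField K] (p : ℕ) [W.IsElliptic] [W.IsGloballyMinimal] [Fact p.Prime]

/-! ## §1 The (Equiv)-sign of an admissible prime (= its Bertolini–Darmon sign), in the AKR binder shape -/

section Sign

variable (c : K ≃ₐ[ℚ] K) [Module (ZMod p) (Vp W K p)]

/-- **The (Equiv)-sign of a Bertolini–Darmon admissible prime `q`**: complex conjugation `c` acts on `H¹(K_v, E[p])` by the scalar `sgnP s` at
every place `v ∣ q` (there is exactly one, `q` being inert).  By W. Zhang (9.2) (AKR `localEquiv_of_admQ`: the lift `Frob_q` of `c` acts on `E[p]` with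
eigenvalues `ε_q, ε_q q`) this `s` is the BD sign: `a_q(E) ≡ sgnP s · (q + 1) (mod p)`, i.e. the `U_q`-eigenvalue of every level-raised newform
`g_n`, `q ∈ n`, is `sgnP s`, and that of `g_n ⊗ χ_K` is `−sgnP s`.  [cite: WZhang2014, §9 (9.2)] [cite: BertoliniDarmon2005, §2.2, Lemma 2.6] -/
def EquivSign (q : AdmQ W K p) (s : Bool) : Prop :=
  ∀ v : HeightOneSpectrum (𝓞 K), ((q : ℕ) : 𝓞 K) ∈ v.asIdeal → ∀ z : Vp W K p,
    (W.baseChange K).torsionLocMap (v.adicCompletion K) ((p ^ 1 : ℕ) : ℤ) (conjAct W c ((p ^ 1 : ℕ) : ℤ) z) =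
      sgnP s • (W.baseChange K).torsionLocMap (v.adicCompletion K) ((p ^ 1 : ℕ) : ℤ) z

omit [Module (ZMod p) (Vp W K p)] in
/-- **Every admissible prime HAS an (Equiv)-sign** — AKR kernel (`localEquiv_of_admQ`, `[K:ℚ] = 2`, `c ≠ 1`).  [cite: WZhang2014, §9 (9.2)] -/
theorem equivSign_exists (hK2 : Module.finrank ℚ K = 2) (hc1 : c ≠ 1) (q : AdmQ W K p) : ∃ s : Bool, EquivSign W K p c q s :=
  localEquiv_of_admQ W K p hK2 hc1 q

/-- **A level carries BOTH signs**: it contains an admissible prime of (Equiv)-sign `+1` and one of sign `−1` — so that BOTH `g_n` (needs a `q ∈ n` with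
`a_q(g_n) = −1`) and `g_n ⊗ χ_K` (needs a `q ∈ n` with `a_q(g_n) = +1`) have a Steinberg prime of the type required by [Wan16, Thm. 1.4].
[cite: FouquetWan2021, Thm. 5.1, Cor. 1.10, Assumption 3.7 (arXiv:2107.13726v3 p. 53, p. 20; the MAINTAINED successor of arXiv:1607.07729 Thm. 1.4, WITHDRAWN — arXiv v8 2022-07-16, zbMATH)] -/
def HasBothSigns (n : Finset (AdmQ W K p)) : Prop :=
  ∀ s : Bool, ∃ q ∈ n, EquivSign W K p c q s

end Sign

/-! ## §2 The inputs, as Props (NOT asserted) -/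

section Inputs

variable (c : K ≃ₐ[ℚ] K) [Module (ZMod p) (Vp W K p)]

/-- **(Par)** — selwalk's `OddBottomDim` VERBATIM: `dim Sel_∅⁺ + dim Sel_∅⁻` is odd (PRINT on the crux frame: `p`-parity over `ℚ` twice + Cassels–Tate).
[cite: DokchitserDokchitser2010, Thm. 1.4] [cite: WZhang2014, Thm. 9.2] -/
def OddBottomDim : Prop :=
  Odd (finrank (ZMod p) (SelQP W K p c ∅ true) + finrank (ZMod p) (SelQP W K p c ∅ false))

end Inputs

/-! ## §3–§5c [v12: MOVED TO `Theorems/`] — the signed detour, the composition to [NV″]'s consequent, (Sup±) and (Cheb) on cell β are the landed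
kernel theorems of `Theorems/…AdmdefSignedDetour.lean` (p740358: `selQP_insert_eq_of_sign_ne`, `sign_of_selQP_insert_ne`, `finrank_selQP_insert_eq_one`,
`exists_signed_detour_of_split`, `exists_oddZeroVertex_bothSigns_of_split`, `definiteToricNV_of_anchorSigned_of_split`), `…AdmdefSignedSupply.lean` (p739682:
`signedSupply_of_split` = `SignedSupplyAt` on β) and `…AdmdefSelmerWalk.lean` (p733010: `localCheb_of_admQ_of_split` = `LocalChebAt` on β), with the §1–§2
Props UNFOLDED in their statements (definitionally equal).  The inline copies of v9–v11 are deleted; §1–§2 stay because the registered text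
`DefiniteAnchorSignedNS` names `HasBothSigns`. -/

section V7Plug

variable {W K p}

omit [W.IsElliptic] [W.IsGloballyMinimal] in
/-- **[v14] THE WALK-AND-DETOUR PLUG FOR AN ARBITRARY VERTEX PREDICATE (kernel).**  On cell β (`(N : ℤ) = N_E`, `p ≥ 5`, `ρ̄` onto, `K` imaginary
quadratic, every `ℓ ∣ N` split, `p` split, `c ≠ 1`), from (Par) `OddBottomDim`: if a property `P m` of the definite level `m` holds at `m = ∏ n` for EVERY odd
zero vertex `n` of the level-raised Selmer walk carrying both (Equiv)-signs, then `P (∏ s)` holds at SOME Zhang-admissible level `s` of odd cardinality —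
W. Zhang's walk (`…AdmdefSelmerWalk`) + the signed detour (`…AdmdefSignedDetour.exists_oddZeroVertex_bothSigns_of_split`, p740358), the Brandt data passed
through untouched.  This is `…AdmdefSignedDetour.definiteToricNV_of_anchorSigned_of_split` with its Brandt predicate ABSTRACTED, so that the v14 re-key of the
period (weighted) — or any later re-key of the anchor's conclusion — costs nothing. [cite: WZhang2014, Thm. 9.1 (proof), Lemma 7.3, §9 (9.2)]
[cite: CastellaEtAl2025, §7.4] [cite: Wan2016NonOrdinaryIMC, Thm. 1.4] -/
theorem exists_admissibleOddLevel_of_anchorSigned_of_split [W.IsElliptic] [W.IsGloballyMinimal] {c : K ≃ₐ[ℚ] K}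
    [Module (ZMod p) (Vp W K p)] {N : ℕ} (hN : (N : ℤ) = W.conductorNorm ℤ) (h5 : 5 ≤ p)
    (hsurj : W.HasSurjectiveModNGaloisRep p) (hK : IsImaginaryQuadratic K)
    (hHeeg : ∀ ℓ : ℕ, ℓ.Prime → ℓ ∣ N → ((Ideal.span {(ℓ : ℤ)}).primesOver (𝓞 K)).ncard = 2)
    (hsp : ((Ideal.span {(p : ℤ)}).primesOver (𝓞 K)).ncard = 2) (hc1 : c ≠ 1)
    (hodd : OddBottomDim W K p c) (P : ℕ → Prop)
    (hanch : ∀ n : Finset (AdmQ W K p), Odd n.card → HasBothSigns W K p c n → (∀ μ : Bool, SelQP W K p c n μ = ⊥) →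
      P (∏ q ∈ n.image Subtype.val, q)) :
    ∃ s : Finset ℕ, IsZhangAdmissibleLevel N K (fun ℓ ↦ W.frobeniusTrace ℓ) p s ∧ Odd s.card ∧ P (∏ q ∈ s, q) := by
  -- adapted from Theorems/…AdmdefSignedDetour.lean `definiteToricNV_of_anchorSigned_of_split` (LEAD g18), predicate abstracted
  have hN' : N = W.conductorNorm ℤ := by exact_mod_cast hN
  have hH : SatisfiesHeegnerHypothesis (W.conductorNorm ℤ) K := fun ℓ hℓ hℓN ↦ hHeeg ℓ hℓ (hN' ▸ hℓN)
  obtain ⟨n, hodd', hboth, hzero, -⟩ :=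
    SignedBaseChangeAcDivAdmdefSignedDetour.exists_oddZeroVertex_bothSigns_of_split W K p h5 hsurj hK hH hsp hc1 hodd
  refine ⟨n.image Subtype.val, ?_, ?_, hanch n hodd' hboth hzero⟩
  · rw [hN']; exact SignedBaseChangeAcDivAdmdefSelmerWalk.isZhangAdmissibleLevel_image_val W K p n
  · rw [SignedBaseChangeAcDivAdmdefSelmerWalk.card_image_val]; exact hodd'

/-! ### §5d The SIGNED re-key of (Anch), stated against the line's own texts (`AdmdefLine.DefiniteToricNVTwoMult/LeOneMult`, `OddSelmerDimBeta`,
`DefiniteAnchorNS`, declared above in this file) — the REGISTERED stub text `DefiniteAnchorSignedNS` ([v12]: the obsolete (Eig±) text `EigenSupplyNS` is deleted) -/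

/-- **(Anch±) — THE SIGNED RE-KEY of v7's `DefiniteAnchorNS`**: its text with ONE inserted binder `HasBothSigns W K p c n →` (the anchor is asked only at odd
zero vertices carrying an admissible prime of EACH (Equiv)-sign — where [Wan16, Thm. 1.4]'s Steinberg-sign hypothesis holds for `g_n` AND for `g_n ⊗ χ_K`).
The REGISTERED text of `stub_definiteAnchorSigned` since v9; [v14]: the period is the WEIGHTED Gross period `Σ_𝔞 w(x_𝔞) φ(x_𝔞)` of the
`mulVec`-eigenvector `φ` (= the unweighted period of print's eigenFUNCTION `w • φ`; v9–v13 carried the unweighted sum of `φ` — a convention slip).  [cite: FouquetWan2021, Thm. 5.1, Cor. 1.10, Assumption 3.7 (arXiv:2107.13726v3 p. 53, p. 20; the MAINTAINED successor of arXiv:1607.07729 Thm. 1.4, WITHDRAWN — arXiv v8 2022-07-16, zbMATH)]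
[cite: WZhang2014, Thm. 5.2, Thm. 7.2] [cite: SkinnerZhang2014, Cor. 9.2] -/
@[conjecture] def DefiniteAnchorSignedNS : Prop :=
  ∀ {p : ℕ} [Fact p.Prime] (W : WeierstrassCurve ℚ) [W.IsElliptic] [W.IsGloballyMinimal]
    (K : Type) [Field K] [NumberField K] {N : ℕ} [NeZero N] {f : CuspForm (CongruenceSubgroup.Gamma0 N) 2}
    (_ : IsNewformOf W f),
    (N : ℤ) = W.conductorNorm ℤ → 5 ≤ p → W.HasGoodReductionAtPrime p → W.frobeniusTrace p = 0 →
    Surj W p →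
    IsImaginaryQuadratic K → ((Ideal.span {(p : ℤ)}).primesOver (𝓞 K)).ncard = 2 →
    (∀ ℓ : ℕ, ℓ.Prime → ℓ ∣ N → ((Ideal.span {(ℓ : ℤ)}).primesOver (𝓞 K)).ncard = 2) →
    IsCoprime (N : ℤ) (NumberField.discr K) → ¬ p ∣ NumberField.classNumber K →
    -- (i) NEGATED: `N` is NOT square-free
    ¬ Squarefree N →
    -- (ii): `E[p]` ramified at every prime `q ∣ N`
    (∀ q : ℕ, q.Prime → q ∣ N →
      ∃ v : HeightOneSpectrum (𝓞 ℚ), ((q : ℕ) : 𝓞 ℚ) ∈ v.asIdeal ∧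
        ∃ 𝔓 ∈ v.primesAbove, ∃ σ ∈ 𝔓.inertia (absoluteGaloisGroup ℚ),
          ∃ P : W.geomTorsion (p : ℤ), σ • P ≠ P) →
    -- (Anch±): at every ODD ZERO VERTEX carrying both signs, Brandt data with a non-zero mod-p WEIGHTED toric period [v14]
    ∀ (c : K ≃ₐ[ℚ] K), c ≠ 1 → ∀ [Module (ZMod p) (AdditiveKoly.Vp W K p)],
      ∀ n : Finset (AdditiveKoly.AdmQ W K p), Odd n.card → HasBothSigns W K p c n → (∀ μ : Bool, AdditiveKoly.SelQP W K p c n μ = ⊥) →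
        ∃ (S : Brandt.XiSetup N (∏ q ∈ n.image Subtype.val, q)) (ψ : K →ₐ[ℚ] S.D) (I : Submodule ℤ S.D)
          (φ : Brandt.ClassSet S.O → ZMod p),
          Brandt.IsGrossPoint S.O ψ I ∧
          (letI : Fintype (Brandt.ClassSet S.O) := Fintype.ofFinite _
           φ ∈ Brandt.eigenSpace (ZMod p) (N * ∏ q ∈ n.image Subtype.val, q) (Brandt.matrix S.O) (fun ℓ ↦ W.frobeniusTrace ℓ)) ∧
          Brandt.toricPeriod S.O ψ I (fun i ↦ (Brandt.weight S.O i : ZMod p) * φ i) ≠ 0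

/-- **(NP) — THE NON-PRIMITIVE LOCUS [v16]**: «some PINNED `+` tuple dies at the root».  For `(E, K, p)` with newform `f` at level `N`: there are an
embedding datum `ι : ℚ̄_p ≃ ℂ` inducing the prime `𝔭 ∣ p` of `K` (with its conjugate `𝔭bar`), an anticyclotomic `ℤ_p`-extension `κ` with topological
generator `γ`, a non-split datum at `𝔭`, a Castella–Wan BDP frame `(Ω_K ≠ 0, Ω_p, L)` (`IsCWBDPLFunction`, CW24 Prop. 2.1), a class `z ∈ 𝒮_+` carrying the
transfer inputs of the proof of CW24 Thm. 6.8 for `(z, L)` (`AcSigned.TransferInputs`), and a `+` signed bipartite system `B` at level `N` (CHKLL25 Thm. 7.4 as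
typed) with limit base class `z` ((7.2)) — such that the BOTTOM class `z_{0,1} ∈ H¹(K, E[p])` restricts to ZERO on `⟨φ⟩` for every Frobenius
`φ ∈ Gal(K̄/K_∞) ∩ D_𝔓`, every prime `𝔓` of `K̄` over every place `v ∋ q`, every `1`-admissible `q`.  The pinning (frame + transfer inputs) makes this a
genuine condition: by frame concordance (p634869) and CW24's pinning the class is the `+` Heegner class up to units, whose bottom layer is the Kummer class of
`N_{K[p]/K} x_p = −2·y_K` (`Theorems/…AdmdefUnitLambdaOfHeegnerRoot`), so (NP) says «`y_K ∈ p·E(K)` as seen at admissible primes» (Čebotarev: everywhere) —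
Howard's NON-PRIMITIVE case.  On its complement Howard's criterion [NV] is KERNEL (`Theorems/…AdmdefUnitLambdaOfLoc.hasUnitLambda_of_limitBaseClass_res_ne_zero`,
LEAD g19; wired in by `Theorems/…AdmdefRootDichotomy`, LEAD g21).  A predicate; nothing asserted.
[cite: CastellaEtAl2025, Thm. 7.4 second law, (7.2), Thm. 7.5 (arXiv:2308.10474v2 p0030 L50–L62, p0031 L1–L30)] [cite: Howard2006, Thm. 3.2.3 (c), §3.2 (16)]
[cite: CastellaWan2023, Prop. 2.1, Prop. 4.4, §6 (MS pp. 8, 20–31)] [cite: BurungaleCastellaKim2021, arXiv:1908.09512 Prop. 7.4, Lem. 7.6] [cite: GrossKolyvagin1991, §2] -/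
def RootInvisibleNS (W : WeierstrassCurve ℚ) [W.IsGloballyMinimal] (K : Type) [Field K] [NumberField K] (p : ℕ) [Fact p.Prime] (N : ℕ)
    (f : CuspForm (CongruenceSubgroup.Gamma0 N) 2) : Prop :=
  ∃ (ι : PadicAlgCl p ≃+* ℂ) (𝔭 𝔭bar : HeightOneSpectrum (𝓞 K)) (κ : ZpExtension K p) (γ : absoluteGaloisGroup K)
    (hγ : κ.IsTopGenerator γ) (h𝔭 : ((p : ℕ) : 𝓞 K) ∈ 𝔭.asIdeal) (hne : 𝔭bar ≠ 𝔭)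
    (h𝔭ns : AcSigned.IsNonsplitIn κ 𝔭) (γ𝔭 : absoluteGaloisGroup (𝔭.adicCompletion K))
    (hγ𝔭 : κ (resGalOfEmb (closureEmb (K := K) (𝔭.adicCompletion K)) γ𝔭) = κ γ)
    (ΩK : ℂ) (Ωp : (unrIntegers p)ˣ) (L : UnrSeries p)
    (z : AcSigned.selmerLambdaAdic (W.baseChange K) p κ γ (fun _ ↦ .sgn 1))
    (B : CastellaHsuKunduLeeLiu2025.SignedBipartiteSystem W K p κ),
    κ.IsAnticyclotomic ∧ (∀ (w : InfinitePlace K) (k : 𝓞 K), k ∈ 𝔭.asIdeal ↔ ‖ι.symm (w.embedding (k : K))‖ < 1) ∧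
    ((p : ℕ) : 𝓞 K) ∈ 𝔭bar.asIdeal ∧ ΩK ≠ 0 ∧
    IsCWBDPLFunction ι 𝔭 κ γ f (NumberField.discr K) ΩK ((Ωp : unrIntegers p) : ℂ_[p]) L ∧
    AcSigned.TransferInputs (W.baseChange K) p κ γ hγ 𝔭 h𝔭ns γ𝔭 hγ𝔭 𝔭bar (fun h ↦ hne h.symm) h𝔭 1 z L ∧
    CastellaHsuKunduLeeLiu2025.IsSignedBipartiteSystem W K p κ γ N 1 B ∧ B.IsLimitBaseClass z.1 ∧
    ∀ (q : ℕ), BertoliniDarmon2005.IsAdmissiblePrime N K (fun ℓ ↦ W.frobeniusTrace ℓ) p 1 q →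
      ∀ (v : HeightOneSpectrum (𝓞 K)), ((q : ℕ) : 𝓞 K) ∈ v.asIdeal →
      ∀ 𝔓 ∈ v.primesAbove, ∀ (φ : absoluteGaloisGroup K) (hφ : φ ∈ κ.kerSubgroup),
        φ ∈ 𝔓.decompositionSubgroup (absoluteGaloisGroup K) → IsArithFrobAt (𝓞 K) φ 𝔓 →
        resOfLe (geomTorsion (W.baseChange K) ((p : ℤ) ^ 1))
          ((Subgroup.zpowers_le.mpr hφ).trans (κ.kerSubgroup_le_layerSubgroup 0)) (z.1 0 1) = 0

/-- **(NP) IN ITS TRUE CURRENCY [v21] — `RootZeroNS`: «some PINNED `+` tuple has bottom class ZERO».**  The tuple of `RootInvisibleNS` VERBATIM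
(embedding datum inducing `𝔭`, anticyclotomic `κ` with topological generator `γ`, non-split datum at `𝔭`, Castella–Wan BDP frame, transfer class `z` with
`TransferInputs (z, L)`, `+` signed bipartite system with limit base class `z`), with the last clause «`res_{⟨φ⟩} z_{0,1} = 0` for every admissible Frobenius
`φ` of `Gal(K̄/K_∞)`» REPLACED by «`z_{0,1} = 0` in `H¹(K, E[p])`».  EQUIVALENT to `RootInvisibleNS` under the cell binders (`rootZeroNS_of_rootInvisibleNS`:
Čebotarev, KERNEL by `Theorems/…AdmdefRootZero`; `rootInvisibleNS_of_rootZeroNS`: trivial).  A predicate; nothing asserted.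
[cite: WZhang2014, Lemma 7.3] [cite: GrossLMS1991, Prop. 9.6] [cite: CastellaEtAl2025, Thm. 7.4 second law (arXiv:2308.10474v2 p0030 L50–L52)] -/
def RootZeroNS (W : WeierstrassCurve ℚ) [W.IsGloballyMinimal] (K : Type) [Field K] [NumberField K] (p : ℕ) [Fact p.Prime] (N : ℕ)
    (f : CuspForm (CongruenceSubgroup.Gamma0 N) 2) : Prop :=
  ∃ (ι : PadicAlgCl p ≃+* ℂ) (𝔭 𝔭bar : HeightOneSpectrum (𝓞 K)) (κ : ZpExtension K p) (γ : absoluteGaloisGroup K)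
    (hγ : κ.IsTopGenerator γ) (h𝔭 : ((p : ℕ) : 𝓞 K) ∈ 𝔭.asIdeal) (hne : 𝔭bar ≠ 𝔭)
    (h𝔭ns : AcSigned.IsNonsplitIn κ 𝔭) (γ𝔭 : absoluteGaloisGroup (𝔭.adicCompletion K))
    (hγ𝔭 : κ (resGalOfEmb (closureEmb (K := K) (𝔭.adicCompletion K)) γ𝔭) = κ γ)
    (ΩK : ℂ) (Ωp : (unrIntegers p)ˣ) (L : UnrSeries p)
    (z : AcSigned.selmerLambdaAdic (W.baseChange K) p κ γ (fun _ ↦ .sgn 1))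
    (B : CastellaHsuKunduLeeLiu2025.SignedBipartiteSystem W K p κ),
    κ.IsAnticyclotomic ∧ (∀ (w : InfinitePlace K) (k : 𝓞 K), k ∈ 𝔭.asIdeal ↔ ‖ι.symm (w.embedding (k : K))‖ < 1) ∧
    ((p : ℕ) : 𝓞 K) ∈ 𝔭bar.asIdeal ∧ ΩK ≠ 0 ∧
    IsCWBDPLFunction ι 𝔭 κ γ f (NumberField.discr K) ΩK ((Ωp : unrIntegers p) : ℂ_[p]) L ∧
    AcSigned.TransferInputs (W.baseChange K) p κ γ hγ 𝔭 h𝔭ns γ𝔭 hγ𝔭 𝔭bar (fun h ↦ hne h.symm) h𝔭 1 z L ∧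
    CastellaHsuKunduLeeLiu2025.IsSignedBipartiteSystem W K p κ γ N 1 B ∧ B.IsLimitBaseClass z.1 ∧
    z.1 0 1 = 0

/-- **(NP)Z ⟹ (NP)** (trivial direction: a zero class restricts to zero). [folklore] -/
theorem rootInvisibleNS_of_rootZeroNS {W : WeierstrassCurve ℚ} [W.IsGloballyMinimal] {K : Type} [Field K] [NumberField K] {p : ℕ} [Fact p.Prime]
    {N : ℕ} {f : CuspForm (CongruenceSubgroup.Gamma0 N) 2} (h : RootZeroNS W K p N f) : RootInvisibleNS W K p N f := by
  obtain ⟨ι, 𝔭, 𝔭bar, κ, γ, hγ, h𝔭, hne, h𝔭ns, γ𝔭, hγ𝔭, ΩK, Ωp, L, z, B, hac, hι, h𝔭bar, hΩ, hL, hT, hB, hzB, hz0⟩ := h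
  exact ⟨ι, 𝔭, 𝔭bar, κ, γ, hγ, h𝔭, hne, h𝔭ns, γ𝔭, hγ𝔭, ΩK, Ωp, L, z, B, hac, hι, h𝔭bar, hΩ, hL, hT, hB, hzB,
    fun q _ v _ 𝔓 _ φ hφ _ _ ↦ by rw [hz0, map_zero]⟩

/-- **(NP) ⟹ (NP)Z — the Čebotarev half, KERNEL [v21]** (`Theorems/…AdmdefRootZero.eq_zero_of_forall_admissibleFrob_resOfLe_eq_zero`, LEAD gen 23, p756662):
on the frame `p ≥ 5`, `ρ̄_{E,p}` onto, `K` imaginary quadratic, every `ℓ ∣ N = N_E` split in `K`, `p` split, a class invisible at every admissible Frobenius of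
`Gal(K̄/K_∞)` IS ZERO.  [cite: WZhang2014, Lemma 7.3, §9 (9.2)] [cite: GrossLMS1991, Prop. 9.6] [cite: Washington1997, Prop. 13.2] -/
theorem rootZeroNS_of_rootInvisibleNS {W : WeierstrassCurve ℚ} [W.IsElliptic] [W.IsGloballyMinimal] {K : Type} [Field K] [NumberField K] {p : ℕ}
    [Fact p.Prime] {N : ℕ} {f : CuspForm (CongruenceSubgroup.Gamma0 N) 2} (hN : (N : ℤ) = W.conductorNorm ℤ) (h5 : 5 ≤ p) (hsurj : Surj W p)
    (hK : IsImaginaryQuadratic K) (hsplit : ((Ideal.span {(p : ℤ)}).primesOver (𝓞 K)).ncard = 2)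
    (hHeeg : ∀ ℓ : ℕ, ℓ.Prime → ℓ ∣ N → ((Ideal.span {(ℓ : ℤ)}).primesOver (𝓞 K)).ncard = 2)
    (h : RootInvisibleNS W K p N f) : RootZeroNS W K p N f := by
  obtain ⟨ι, 𝔭, 𝔭bar, κ, γ, hγ, h𝔭, hne, h𝔭ns, γ𝔭, hγ𝔭, ΩK, Ωp, L, z, B, hac, hι, h𝔭bar, hΩ, hL, hT, hB, hzB, hinv⟩ := h
  exact ⟨ι, 𝔭, 𝔭bar, κ, γ, hγ, h𝔭, hne, h𝔭ns, γ𝔭, hγ𝔭, ΩK, Ωp, L, z, B, hac, hι, h𝔭bar, hΩ, hL, hT, hB, hzB,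
    SignedBaseChangeAcDivAdmdefRootZero.eq_zero_of_forall_admissibleFrob_resOfLe_eq_zero hN h5 hsurj hK hHeeg hsplit κ hac (z.1 0 1) hinv⟩

/-- **(Anch±)_NP — the v16/v17 registered text** (superseded in v18; RECORD only): (Anch±) asked only on the non-primitive locus (NP) — Brandt data with
non-zero mod-`p` WEIGHTED toric period at every odd zero vertex carrying both Bertolini–Darmon signs.  Full docstring in crux-dir history 2eead6ebd787.
[cite: FouquetWan2021, Thm. 5.1, Cor. 1.10 (arXiv:2107.13726v3 p. 53, p. 6)] [cite: WZhang2014, Thm. 5.2, Thm. 7.2, Thm. 9.1] [cite: CastellaEtAl2025, §7.4, Thm. 7.5, Thm. 7.6] -/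
@[conjecture] def DefiniteAnchorSignedNPNS : Prop :=
  ∀ {p : ℕ} [Fact p.Prime] (W : WeierstrassCurve ℚ) [W.IsElliptic] [W.IsGloballyMinimal]
    (K : Type) [Field K] [NumberField K] {N : ℕ} [NeZero N] {f : CuspForm (CongruenceSubgroup.Gamma0 N) 2}
    (_ : IsNewformOf W f),
    (N : ℤ) = W.conductorNorm ℤ → 5 ≤ p → W.HasGoodReductionAtPrime p → W.frobeniusTrace p = 0 →
    Surj W p →
    IsImaginaryQuadratic K → ((Ideal.span {(p : ℤ)}).primesOver (𝓞 K)).ncard = 2 →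
    (∀ ℓ : ℕ, ℓ.Prime → ℓ ∣ N → ((Ideal.span {(ℓ : ℤ)}).primesOver (𝓞 K)).ncard = 2) →
    IsCoprime (N : ℤ) (NumberField.discr K) → ¬ p ∣ NumberField.classNumber K →
    -- (i) NEGATED: `N` is NOT square-free
    ¬ Squarefree N →
    -- (ii): `E[p]` ramified at every prime `q ∣ N`
    (∀ q : ℕ, q.Prime → q ∣ N →
      ∃ v : HeightOneSpectrum (𝓞 ℚ), ((q : ℕ) : 𝓞 ℚ) ∈ v.asIdeal ∧
        ∃ 𝔓 ∈ v.primesAbove, ∃ σ ∈ 𝔓.inertia (absoluteGaloisGroup ℚ),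
          ∃ P : W.geomTorsion (p : ℤ), σ • P ≠ P) →
    -- (NP) [v16]: the NON-PRIMITIVE locus — some pinned `+` tuple has bottom class invisible at every admissible Frobenius
    RootInvisibleNS W K p N f →
    -- (Anch±): at every ODD ZERO VERTEX carrying both signs, Brandt data with a non-zero mod-p WEIGHTED toric period [v14]
    ∀ (c : K ≃ₐ[ℚ] K), c ≠ 1 → ∀ [Module (ZMod p) (AdditiveKoly.Vp W K p)],
      ∀ n : Finset (AdditiveKoly.AdmQ W K p), Odd n.card → HasBothSigns W K p c n → (∀ μ : Bool, AdditiveKoly.SelQP W K p c n μ = ⊥) →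
        ∃ (S : Brandt.XiSetup N (∏ q ∈ n.image Subtype.val, q)) (ψ : K →ₐ[ℚ] S.D) (I : Submodule ℤ S.D)
          (φ : Brandt.ClassSet S.O → ZMod p),
          Brandt.IsGrossPoint S.O ψ I ∧
          (letI : Fintype (Brandt.ClassSet S.O) := Fintype.ofFinite _
           φ ∈ Brandt.eigenSpace (ZMod p) (N * ∏ q ∈ n.image Subtype.val, q) (Brandt.matrix S.O) (fun ℓ ↦ W.frobeniusTrace ℓ)) ∧
          Brandt.toricPeriod S.O ψ I (fun i ↦ (Brandt.weight S.O i : ZMod p) * φ i) ≠ 0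

/-! ### §5d′ [v18] The SELMER-RANK SPLIT of the non-primitive locus (bsd-idea-5 g32 `Lines/admdef-npcore-g32.md` (R1)–(R3), consumed):
`d := dim_𝔽p Sel_p(E/K)[p]` is ODD on the frame ((Par), derived); `d = 1` ⟺ the root of Howard's graph is CORE, and there length-one rigidity
(BCK21 Lem. 7.3 ∕ Prop. 7.4) makes (NP) force `B ≡ 0 (mod ℘)` — NO unit `λ`, NO unit weighted period: the v16/v17 text (Anch±)_NP was «empty or
false» on that piece.  v18 asks the `d = 1` piece in its TRUE currency — EMPTINESS, text (RV₁) — and the anchor only on `d ≥ 3` (text (Anch±)_NP,≥3,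
where by the same rigidity it IS the mod-`℘` primitivity of the signed system, (R3)). -/

/-! [v22 trim] The v18–v20 RECORD text `RootVisibleRankOneNS` ((RV₁) in the Frobenius-invisibility currency) is deleted for size (kernel-equivalent to the
v21 text `RootVisibleRankOneZNS`, kept below as the source of the conservativity certificate); full text in crux-dir history (a33449327a85). -/

/-- **(RV₁)Z [v21] — THE REGISTERED TEXT of `AdmdefLine.stub_rootVisibleRankOneZ`**: (RV₁) with its conclusion `¬ RootInvisibleNS W K p N f` RE-KEYED to
`¬ RootZeroNS W K p N f` — «on cell β, if `Sel_p(E/K)[p]` is a LINE then NO pinned `+` tuple has bottom class `z_{0,1} = 0`».  KERNEL-EQUIVALENT to (RV₁)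
(`AdmdefLine.rootVisibleRankOne` ∕ `rootVisibleRankOneZ_of_rootVisibleRankOne`, via `Theorems/…AdmdefRootZero`).  Research content unchanged: Zhang–Kolyvagin
`p`-indivisibility of the pinned bottom class (= of `y_K`, up to the untyped pinning) at good supersingular `p` on the non-square-free all-ramified cell.
[cite: WZhang2014, Thm. 1.1, Lemma 7.3] [cite: BurungaleCastellaKim2021, arXiv:1908.09512 Lem. 7.3, Prop. 7.4] [cite: CastellaWan2023, Thm. A (arXiv:1607.02019v3)] -/
@[conjecture] def RootVisibleRankOneZNS : Prop :=
  ∀ {p : ℕ} [Fact p.Prime] (W : WeierstrassCurve ℚ) [W.IsElliptic] [W.IsGloballyMinimal]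
    (K : Type) [Field K] [NumberField K] {N : ℕ} [NeZero N] {f : CuspForm (CongruenceSubgroup.Gamma0 N) 2}
    (_ : IsNewformOf W f),
    (N : ℤ) = W.conductorNorm ℤ → 5 ≤ p → W.HasGoodReductionAtPrime p → W.frobeniusTrace p = 0 →
    Surj W p →
    IsImaginaryQuadratic K → ((Ideal.span {(p : ℤ)}).primesOver (𝓞 K)).ncard = 2 →
    (∀ ℓ : ℕ, ℓ.Prime → ℓ ∣ N → ((Ideal.span {(ℓ : ℤ)}).primesOver (𝓞 K)).ncard = 2) →
    IsCoprime (N : ℤ) (NumberField.discr K) → ¬ p ∣ NumberField.classNumber K →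
    -- (i) NEGATED: `N` is NOT square-free
    ¬ Squarefree N →
    -- (ii): `E[p]` ramified at every prime `q ∣ N`
    (∀ q : ℕ, q.Prime → q ∣ N →
      ∃ v : HeightOneSpectrum (𝓞 ℚ), ((q : ℕ) : 𝓞 ℚ) ∈ v.asIdeal ∧
        ∃ 𝔓 ∈ v.primesAbove, ∃ σ ∈ 𝔓.inertia (absoluteGaloisGroup ℚ),
          ∃ P : W.geomTorsion (p : ℤ), σ • P ≠ P) →
    -- the `𝔽_p`-structure of `H¹(K, E[p])` and the SELMER LINE hypothesis `dim_𝔽p Sel_p(E/K)[p] = 1`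
    ∀ [Module (ZMod p) (AdditiveKoly.Vp W K p)],
      finrank (ZMod p) (AddSubgroup.toZModSubmodule p (selmerGroup (W.baseChange K) ((p ^ 1 : ℕ) : ℤ))) = 1 →
      -- (RV₁): no pinned `+` tuple has bottom class invisible at every admissible Frobenius
      ¬ RootZeroNS W K p N f

/-! ### §5d‴ [v22] THE HEEGNER / p-PRIMITIVE RE-KEY of the core-root piece (LEAD gen 24).  Cite conjunct (16) pins the bridge class as the `+`
signed Heegner class of a trace-coherent family; `Theorems/…AdmdefHeegnerPrimitive` certifies that class p-PRIMITIVE in `𝒮_+` from `μ(L_p^BDP) = 0`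
(conjunct (7)); so the `d = 1` branch needs only «a p-primitive signed Heegner class has non-zero bottom layer in corank one» — Kolyvagin's conjecture
mod `p` at the bottom — and no longer the analytic (NP)-tuple.  Normalisation: WITHOUT p-primitivity a «∀ F» text would be FALSE (rescale `F ↦ p·F`,
Manin constant `c ↦ p·c`); p-primitivity (`z ≠ p • z″` in `𝒮_+`) is the tree-certifiable substitute for AKR's `¬ p ∣ Dt.c`. -/

/-- **(RV₁)H [v22 registered text; v23: RECORD — the `d = 1` branch now runs through the anchor at one Čebotarev vertex] — KOLYVAGIN'S CONJECTURE MOD `p`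
AT THE BOTTOM, SELMER CORANK ONE, GOOD SUPERSINGULAR `p`, CELL β.**  Binders: cell β (`(N : ℤ) = N_E` with newform `f`, `p ≥ 5` good, `a_p = 0`, `ρ̄_{E,p}` onto, `K` imaginary
quadratic, `p` split, every `ℓ ∣ N` split, `(N, D_K) = 1`, `p ∤ h_K`, `D_K` odd, `D_K ≠ −3`, `N` not square-free, `E[p]` ramified at every `q ∣ N`), the
`𝔽_p`-structure of `H¹(K, E[p])` and the CORANK-ONE hypothesis `dim_𝔽p Sel_p(E/K)[p] = 1`; then for every anticyclotomic `ℤ_p`-extension `κ` with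
topological generator `γ`, every `jbar : K̄ → ℂ`, every TRACE-COHERENT Heegner family `F` of level `N` (Castella–Wan Prop. 4.1 / (4.1) at `a_p = 0`),
every `z ∈ 𝒮_+ = Sel_+(K, 𝐓^ac)` which IS the `+` signed `Λ^ac`-adic Heegner class of `F` (`AcSigned.IsSignedHeegnerClass`, CW24 Prop. 4.4 / Def. 4.5)
together with a `+` signed bipartite Euler system `B` at level `N` with limit base class `z` (CHKLL25 Thm. 7.4 / (7.2), the laws available to the hands),
and `z` p-PRIMITIVE in `𝒮_+` (`z ≠ p • z″` for every `z″`): **the bottom layer `z_{0,1} ∈ H¹(K, E[p])` is NON-ZERO**.  By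
`Theorems/…AdmdefHeegnerPrimitive.layer_zero_one_eq_zero_iff_exists_smul_eq` this says «the conductor-`p` norm point `z_0 = N_{K[p]/K} P[p] ∉ p·E(K)`»,
and `z_0 = −2·y_K` by the distribution relation at `a_p = 0`, `p` split (CW24 (4.1), reading): «`Sel_p(E/K)[p]` a line ⟹ `y_K ∉ p·E(K)`» for the
p-primitively normalised parametrisation = W. Zhang's Thm. 1.1 ∕ Kolyvagin's conjecture (mod `p`, `n = 1`) at good SUPERSINGULAR `p` on the
non-square-free all-ramified cell — the twin of `Theses.AdditiveKolyvaginRoad.BottomRankOneAdditive` (stmt-21397, additive `p`).  RESEARCH: print has it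
at `p ∤ N` ordinary (Zha14 Thm. 1.1 ⟸ SU14) and `p ∥ N` (SZ14); at good supersingular `p` with additive primes in `N` the rank-0 anchor for the level-raised
form is the same open input as (Anch∃)¬FW.  Kernel-INCOMPARABLE with v21's (RV₁)Z (neither implies the other inside the tree); BOTH imply the
composition edge `HeegnerBottomRankOnePinnedNS`.  Token (390): CONTENT.
[cite: WZhang2014, Thm. 1.1, Thm. 9.3, Lemma 7.3] [cite: CastellaWan2023, Prop. 4.1, (4.1), Prop. 4.4, Def. 4.5 (MS pp. 18–22)]
[cite: CastellaEtAl2025, Thm. 7.4, (7.2) (arXiv:2308.10474v2 pp. 30–31)] [cite: BurungaleCastellaKim2021, arXiv:1908.09512 Lem. 7.3, Prop. 7.4] [cite: GrossLMS1991, §2] -/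
@[conjecture] def HeegnerBottomRankOneNS : Prop :=
  ∀ {p : ℕ} [Fact p.Prime] (W : WeierstrassCurve ℚ) [W.IsElliptic] [W.IsGloballyMinimal]
    (K : Type) [Field K] [NumberField K] {N : ℕ} [NeZero N] {f : CuspForm (CongruenceSubgroup.Gamma0 N) 2}
    (_ : IsNewformOf W f),
    (N : ℤ) = W.conductorNorm ℤ → 5 ≤ p → W.HasGoodReductionAtPrime p → W.frobeniusTrace p = 0 →
    Surj W p →
    IsImaginaryQuadratic K → ((Ideal.span {(p : ℤ)}).primesOver (𝓞 K)).ncard = 2 →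
    (∀ ℓ : ℕ, ℓ.Prime → ℓ ∣ N → ((Ideal.span {(ℓ : ℤ)}).primesOver (𝓞 K)).ncard = 2) →
    IsCoprime (N : ℤ) (NumberField.discr K) → ¬ p ∣ NumberField.classNumber K →
    Odd (NumberField.discr K) → NumberField.discr K ≠ -3 →
    -- (i) NEGATED: `N` is NOT square-free
    ¬ Squarefree N →
    -- (ii): `E[p]` ramified at every prime `q ∣ N`
    (∀ q : ℕ, q.Prime → q ∣ N →
      ∃ v : HeightOneSpectrum (𝓞 ℚ), ((q : ℕ) : 𝓞 ℚ) ∈ v.asIdeal ∧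
        ∃ 𝔓 ∈ v.primesAbove, ∃ σ ∈ 𝔓.inertia (absoluteGaloisGroup ℚ),
          ∃ P : W.geomTorsion (p : ℤ), σ • P ≠ P) →
    -- the `𝔽_p`-structure of `H¹(K, E[p])` and the SELMER LINE hypothesis `dim_𝔽p Sel_p(E/K)[p] = 1`
    ∀ [Module (ZMod p) (AdditiveKoly.Vp W K p)],
      finrank (ZMod p) (AddSubgroup.toZModSubmodule p (selmerGroup (W.baseChange K) ((p ^ 1 : ℕ) : ℤ))) = 1 →
      -- the anticyclotomic tower, a trace-coherent Heegner family, its p-PRIMITIVE `+` signed class with a `+` bipartite system through it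
      ∀ (κ : ZpExtension K p) (γ : absoluteGaloisGroup K), κ.IsAnticyclotomic → κ.IsTopGenerator γ →
      ∀ (jbar : AlgebraicClosure K →+* ℂ) (F : HeegnerFamily N W K κ jbar), F.IsTraceCoherentApZero →
      ∀ (z : AcSigned.selmerLambdaAdic (W.baseChange K) p κ γ (fun _ ↦ .sgn 1))
        (B : CastellaHsuKunduLeeLiu2025.SignedBipartiteSystem W K p κ),
        AcSigned.IsSignedHeegnerClass p κ γ F 1 z.1 →
        CastellaHsuKunduLeeLiu2025.IsSignedBipartiteSystem W K p κ γ N 1 B → B.IsLimitBaseClass z.1 →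
        (∀ z'' : AcSigned.selmerLambdaAdic (W.baseChange K) p κ γ (fun _ ↦ .sgn 1), z ≠ p • z'') →
        -- (RV₁)H: the bottom layer of the class is non-zero in `H¹(K, E[p])`
        z.1 0 1 ≠ 0

/-- **(RV₁)H-PINNED [v22] — THE COMPOSITION EDGE (DERIVED, not registered)**: (RV₁)H with the ANALYTIC frame of the bridge added to the
hypotheses (embedding datum `ι` inducing `𝔭`, conjugate `𝔭bar`, non-split datum at `𝔭`, a Castella–Wan BDP frame `(Ω_K ≠ 0, Ω_p, L)` and the
transfer inputs for `(z, L)`) — exactly what the [NV] consumer holds at `d = 1`.  Implied by (RV₁)H (forget the frame: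
`heegnerBottomRankOnePinned_of_heegnerBottomRankOne`) AND by v21's (RV₁)Z (forget the Heegner data: `heegnerBottomRankOnePinned_of_rootVisibleRankOneZ`),
so the v22 re-key is CONSERVATIVE at the level of the edge.  [cite: CastellaEtAl2025, Thm. 7.4, (7.1)–(7.2), p. 31 L9–12]
[cite: CastellaWan2023, Def. 6.1, Thm. 6.2, proof of Thm. 6.8 (MS pp. 25–31)] -/
@[conjecture] def HeegnerBottomRankOnePinnedNS : Prop :=
  ∀ {p : ℕ} [Fact p.Prime] (ι : PadicAlgCl p ≃+* ℂ) (W : WeierstrassCurve ℚ) [W.IsElliptic]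
    [W.IsGloballyMinimal] (K : Type) [Field K] [NumberField K]
    (𝔭 𝔭bar : HeightOneSpectrum (𝓞 K)) (κ : ZpExtension K p) (γ : absoluteGaloisGroup K)
    [hγF : Fact (κ.IsTopGenerator γ)] {N : ℕ} [NeZero N] {f : CuspForm (CongruenceSubgroup.Gamma0 N) 2}
    (_ : IsNewformOf W f),
    (N : ℤ) = W.conductorNorm ℤ → 5 ≤ p → W.HasGoodReductionAtPrime p → W.frobeniusTrace p = 0 →
    Surj W p →
    IsImaginaryQuadratic K → ((Ideal.span {(p : ℤ)}).primesOver (𝓞 K)).ncard = 2 →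
      (h𝔭 : ((p : ℕ) : 𝓞 K) ∈ 𝔭.asIdeal) →
      (∀ (w : InfinitePlace K) (k : 𝓞 K), k ∈ 𝔭.asIdeal ↔ ‖ι.symm (w.embedding (k : K))‖ < 1) →
      ((p : ℕ) : 𝓞 K) ∈ 𝔭bar.asIdeal → (hne : 𝔭bar ≠ 𝔭) →
    (∀ ℓ : ℕ, ℓ.Prime → ℓ ∣ N → ((Ideal.span {(ℓ : ℤ)}).primesOver (𝓞 K)).ncard = 2) →
    IsCoprime (N : ℤ) (NumberField.discr K) → ¬ p ∣ NumberField.classNumber K →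
    Odd (NumberField.discr K) → NumberField.discr K ≠ -3 →
    ¬ Squarefree N →
    (∀ q : ℕ, q.Prime → q ∣ N →
      ∃ v : HeightOneSpectrum (𝓞 ℚ), ((q : ℕ) : 𝓞 ℚ) ∈ v.asIdeal ∧
        ∃ 𝔓 ∈ v.primesAbove, ∃ σ ∈ 𝔓.inertia (absoluteGaloisGroup ℚ),
          ∃ P : W.geomTorsion (p : ℤ), σ • P ≠ P) →
    ∀ [Module (ZMod p) (AdditiveKoly.Vp W K p)],
      finrank (ZMod p) (AddSubgroup.toZModSubmodule p (selmerGroup (W.baseChange K) ((p ^ 1 : ℕ) : ℤ))) = 1 →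
      κ.IsAnticyclotomic →
      ∀ (h𝔭ns : AcSigned.IsNonsplitIn κ 𝔭) (γ𝔭 : absoluteGaloisGroup (𝔭.adicCompletion K))
        (hγ𝔭 : κ (resGalOfEmb (closureEmb (K := K) (𝔭.adicCompletion K)) γ𝔭) = κ γ)
        (ΩK : ℂ) (Ωp : (unrIntegers p)ˣ) (L : UnrSeries p), ΩK ≠ 0 →
        IsCWBDPLFunction ι 𝔭 κ γ f (NumberField.discr K) ΩK ((Ωp : unrIntegers p) : ℂ_[p]) L →
        ∀ (jbar : AlgebraicClosure K →+* ℂ) (F : HeegnerFamily N W K κ jbar), F.IsTraceCoherentApZero →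
        ∀ (z : AcSigned.selmerLambdaAdic (W.baseChange K) p κ γ (fun _ ↦ .sgn 1))
          (B : CastellaHsuKunduLeeLiu2025.SignedBipartiteSystem W K p κ),
          AcSigned.IsSignedHeegnerClass p κ γ F 1 z.1 →
          AcSigned.TransferInputs (W.baseChange K) p κ γ hγF.out 𝔭 h𝔭ns γ𝔭 hγ𝔭 𝔭bar (fun h ↦ hne h.symm) h𝔭 1 z L →
          CastellaHsuKunduLeeLiu2025.IsSignedBipartiteSystem W K p κ γ N 1 B → B.IsLimitBaseClass z.1 →
          (∀ z'' : AcSigned.selmerLambdaAdic (W.baseChange K) p κ γ (fun _ ↦ .sgn 1), z ≠ p • z'') →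
          z.1 0 1 ≠ 0

/-- **(Anch±)_NP,≥3 — the v18 registered text** (superseded in v19; RECORD only, source of the ∀→∃ certificate): the v16/v17 text (Anch±)_NP with the
inserted binder `3 ≤ dim_𝔽p Sel_p(E/K)[p]`.  Full docstring in crux-dir history ff684f9df7cf.  [cite: BurungaleCastellaKim2021, arXiv:1908.09512 Lem. 7.3, Prop. 7.4]
[cite: WZhang2014, Thm. 9.1] -/
@[conjecture] def DefiniteAnchorSignedNP3NS : Prop :=
  ∀ {p : ℕ} [Fact p.Prime] (W : WeierstrassCurve ℚ) [W.IsElliptic] [W.IsGloballyMinimal]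
    (K : Type) [Field K] [NumberField K] {N : ℕ} [NeZero N] {f : CuspForm (CongruenceSubgroup.Gamma0 N) 2}
    (_ : IsNewformOf W f),
    (N : ℤ) = W.conductorNorm ℤ → 5 ≤ p → W.HasGoodReductionAtPrime p → W.frobeniusTrace p = 0 →
    Surj W p →
    IsImaginaryQuadratic K → ((Ideal.span {(p : ℤ)}).primesOver (𝓞 K)).ncard = 2 →
    (∀ ℓ : ℕ, ℓ.Prime → ℓ ∣ N → ((Ideal.span {(ℓ : ℤ)}).primesOver (𝓞 K)).ncard = 2) →
    IsCoprime (N : ℤ) (NumberField.discr K) → ¬ p ∣ NumberField.classNumber K →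
    -- (i) NEGATED: `N` is NOT square-free
    ¬ Squarefree N →
    -- (ii): `E[p]` ramified at every prime `q ∣ N`
    (∀ q : ℕ, q.Prime → q ∣ N →
      ∃ v : HeightOneSpectrum (𝓞 ℚ), ((q : ℕ) : 𝓞 ℚ) ∈ v.asIdeal ∧
        ∃ 𝔓 ∈ v.primesAbove, ∃ σ ∈ 𝔓.inertia (absoluteGaloisGroup ℚ),
          ∃ P : W.geomTorsion (p : ℤ), σ • P ≠ P) →
    -- (NP) [v16]: the NON-PRIMITIVE locus — some pinned `+` tuple has bottom class invisible at every admissible Frobenius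
    RootInvisibleNS W K p N f →
    -- (Anch±) off the core root [v18]: at every ODD ZERO VERTEX carrying both signs, Brandt data with a non-zero mod-p WEIGHTED toric period,
    -- asked only when `dim_𝔽p Sel_p(E/K)[p] ≥ 3`
    ∀ (c : K ≃ₐ[ℚ] K), c ≠ 1 → ∀ [Module (ZMod p) (AdditiveKoly.Vp W K p)],
      3 ≤ finrank (ZMod p) (AddSubgroup.toZModSubmodule p (selmerGroup (W.baseChange K) ((p ^ 1 : ℕ) : ℤ))) →
      ∀ n : Finset (AdditiveKoly.AdmQ W K p), Odd n.card → HasBothSigns W K p c n → (∀ μ : Bool, AdditiveKoly.SelQP W K p c n μ = ⊥) →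
        ∃ (S : Brandt.XiSetup N (∏ q ∈ n.image Subtype.val, q)) (ψ : K →ₐ[ℚ] S.D) (I : Submodule ℤ S.D)
          (φ : Brandt.ClassSet S.O → ZMod p),
          Brandt.IsGrossPoint S.O ψ I ∧
          (letI : Fintype (Brandt.ClassSet S.O) := Fintype.ofFinite _
           φ ∈ Brandt.eigenSpace (ZMod p) (N * ∏ q ∈ n.image Subtype.val, q) (Brandt.matrix S.O) (fun ℓ ↦ W.frobeniusTrace ℓ)) ∧
          Brandt.toricPeriod S.O ψ I (fun i ↦ (Brandt.weight S.O i : ZMod p) * φ i) ≠ 0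

/-- **(Anch∃)_NP,≥3 — the v19 registered text** (superseded in v20 by the FW cut and in v21 by the Z re-key; kept as a RECORD and as the
source/target of the conservativity certificates): cell-β binders → (NP) `RootInvisibleNS` → `𝔽_p`-structure → `3 ≤ dim Sel_p(E/K)[p]` → SOME odd Zhang-admissible
level carries Brandt data (definite set-up of type `(N, ∏ s)`, Gross point, mod-`p` `a_•(E)`-eigenvector) with non-zero WEIGHTED toric period.  Full v19 docstring in
crux-dir history c1d0344fe3f0.  [cite: WZhang2014, Thm. 5.2, Thm. 9.1] [cite: CastellaEtAl2025, §7.4, Thm. 7.5] [cite: Howard2006, Thm. 3.2.3 (c)] -/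
@[conjecture] def DefiniteAnchorExistsNP3NS : Prop :=
  ∀ {p : ℕ} [Fact p.Prime] (W : WeierstrassCurve ℚ) [W.IsElliptic] [W.IsGloballyMinimal]
    (K : Type) [Field K] [NumberField K] {N : ℕ} [NeZero N] {f : CuspForm (CongruenceSubgroup.Gamma0 N) 2}
    (_ : IsNewformOf W f),
    (N : ℤ) = W.conductorNorm ℤ → 5 ≤ p → W.HasGoodReductionAtPrime p → W.frobeniusTrace p = 0 →
    Surj W p →
    IsImaginaryQuadratic K → ((Ideal.span {(p : ℤ)}).primesOver (𝓞 K)).ncard = 2 →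
    (∀ ℓ : ℕ, ℓ.Prime → ℓ ∣ N → ((Ideal.span {(ℓ : ℤ)}).primesOver (𝓞 K)).ncard = 2) →
    IsCoprime (N : ℤ) (NumberField.discr K) → ¬ p ∣ NumberField.classNumber K →
    -- (i) NEGATED: `N` is NOT square-free
    ¬ Squarefree N →
    -- (ii): `E[p]` ramified at every prime `q ∣ N`
    (∀ q : ℕ, q.Prime → q ∣ N →
      ∃ v : HeightOneSpectrum (𝓞 ℚ), ((q : ℕ) : 𝓞 ℚ) ∈ v.asIdeal ∧
        ∃ 𝔓 ∈ v.primesAbove, ∃ σ ∈ 𝔓.inertia (absoluteGaloisGroup ℚ),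
          ∃ P : W.geomTorsion (p : ℤ), σ • P ≠ P) →
    -- (NP) [v16]: the NON-PRIMITIVE locus — some pinned `+` tuple has bottom class invisible at every admissible Frobenius
    RootInvisibleNS W K p N f →
    -- the `𝔽_p`-structure of `H¹(K, E[p])` and the OFF-CORE-ROOT hypothesis `dim_𝔽p Sel_p(E/K)[p] ≥ 3` [v18]
    ∀ [Module (ZMod p) (AdditiveKoly.Vp W K p)],
      3 ≤ finrank (ZMod p) (AddSubgroup.toZModSubmodule p (selmerGroup (W.baseChange K) ((p ^ 1 : ℕ) : ℤ))) →
      -- (Anch∃) [v19]: SOME odd Zhang-admissible level carries Brandt data with a non-zero mod-p WEIGHTED toric period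
      ∃ s : Finset ℕ, IsZhangAdmissibleLevel N K (fun ℓ ↦ W.frobeniusTrace ℓ) p s ∧ Odd s.card ∧
        ∃ (S : Brandt.XiSetup N (∏ q ∈ s, q)) (ψ : K →ₐ[ℚ] S.D) (I : Submodule ℤ S.D) (φ : Brandt.ClassSet S.O → ZMod p),
          Brandt.IsGrossPoint S.O ψ I ∧
          (letI : Fintype (Brandt.ClassSet S.O) := Fintype.ofFinite _
           φ ∈ Brandt.eigenSpace (ZMod p) (N * ∏ q ∈ s, q) (Brandt.matrix S.O) (fun ℓ ↦ W.frobeniusTrace ℓ)) ∧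
          Brandt.toricPeriod S.O ψ I (fun i ↦ (Brandt.weight S.O i : ZMod p) * φ i) ≠ 0

/-! ### §5d″ [v20] The FOUQUET–WAN CUT of the existential anchor (director-bsd g20 BOOKING DATUM 2026-08-30T00:56Z; bsd-idea-5 g34
`Lines/admdef-w16withdrawn-g34.md`): [Wan16] arXiv:1607.07729 is WITHDRAWN (incorporated into Fouquet–Wan arXiv:2107.13726); the maintained rank-0
statement FW21 Thm. 5.1 ∕ Cor. 1.10 needs a prime `ℓ ∥ N(g)` at which `ρ̄ = E[p]` is a RAMIFIED NON-SPLIT Steinberg extension — admissible primes are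
`ρ̄`-unramified, so `ℓ` must divide `N_E`: the tree predicate `Rank1Residual.Additive.FWNonsplitRam W p`.  So the anchor's only maintained (preprint) feed
lives on β ∩ FWNonsplitRam(W,p) (FW21 ×2 with E's own `ℓ`, which splits in `K`, for `g_n` AND `g_n ⊗ χ_K` ∘ the η/period ports); on β ∖ FWNonsplitRam(W,p)
there is NO maintained source (= the same named open input as cell α's K1, `BLVStep4ReadingFlag.md` §3).  The registry now says so: two stubs. -/

/-- **(Anch∃)_NP,≥3,FW — THE v20 REGISTERED TEXT of `AdmdefLine.stub_definiteAnchorExistsNP3FW`**: (Anch∃)_NP,≥3 with ONE inserted hypothesis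
`Rank1Residual.Additive.FWNonsplitRam W p →` (some non-split multiplicative `q ≠ p` with `p ∤ v_q(Δ_min)`, i.e. `E[p]` ramified at `q`) before (NP).
SOURCED (PREPRINT, modulo ports): Fouquet–Wan 2021 Thm. 5.1 ∕ Cor. 1.10 (rank-0 Kato main identity for the non-ordinary weight-2 forms `g_n` and
`g_n ⊗ χ_K`, Steinberg prime = E's own `q`, which splits in `K` so both forms have the same local type; model fact at curve level
`Literature.NumberTheory.EllipticCurves.FouquetWan2021.thm51_katoMainIdentity_OPEN`) ∘ Gross–Parson ∘ level raising ∘ η at squarefull `N⁺` ∘ Gross/CH mod `℘` ∘ JL,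
through W. Zhang's ∕ BCK21 Lem. 7.6 induction; objects `A_g`, `Sel_℘(A_g/K)`, `Ω^cong`, `η` untyped.  STRICTLY WEAKER than (Anch∃)_NP,≥3.  Token (390): CONTENT.
[cite: FouquetWan2021, Thm. 5.1, Cor. 1.10, Thm. 1.7, Assumption 3.7 (arXiv:2107.13726v3 pp. 5, 20, 53)] [cite: WZhang2014, Thm. 5.2, Thm. 7.2, Thm. 9.1] [cite: BurungaleCastellaKim2021, arXiv:1908.09512 Lem. 7.6]
[cite: CastellaEtAl2025, §7.4, Thm. 7.5] [cite: KimOta2023, Thm. 1.3, Cor. 5.7 (arXiv:1905.02926)] [cite: Gross1987, Prop. 10.3, §11] -/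
@[conjecture] def DefiniteAnchorExistsNP3FWNS : Prop :=
  ∀ {p : ℕ} [Fact p.Prime] (W : WeierstrassCurve ℚ) [W.IsElliptic] [W.IsGloballyMinimal]
    (K : Type) [Field K] [NumberField K] {N : ℕ} [NeZero N] {f : CuspForm (CongruenceSubgroup.Gamma0 N) 2}
    (_ : IsNewformOf W f),
    (N : ℤ) = W.conductorNorm ℤ → 5 ≤ p → W.HasGoodReductionAtPrime p → W.frobeniusTrace p = 0 →
    Surj W p →
    IsImaginaryQuadratic K → ((Ideal.span {(p : ℤ)}).primesOver (𝓞 K)).ncard = 2 →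
    (∀ ℓ : ℕ, ℓ.Prime → ℓ ∣ N → ((Ideal.span {(ℓ : ℤ)}).primesOver (𝓞 K)).ncard = 2) →
    IsCoprime (N : ℤ) (NumberField.discr K) → ¬ p ∣ NumberField.classNumber K →
    -- (i) NEGATED: `N` is NOT square-free
    ¬ Squarefree N →
    -- (ii): `E[p]` ramified at every prime `q ∣ N`
    (∀ q : ℕ, q.Prime → q ∣ N →
      ∃ v : HeightOneSpectrum (𝓞 ℚ), ((q : ℕ) : 𝓞 ℚ) ∈ v.asIdeal ∧
        ∃ 𝔓 ∈ v.primesAbove, ∃ σ ∈ 𝔓.inertia (absoluteGaloisGroup ℚ),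
          ∃ P : W.geomTorsion (p : ℤ), σ • P ≠ P) →
    -- [v20] the FOUQUET–WAN LOCUS: some non-split multiplicative `q ≠ p` with `E[p]` ramified (`p ∤ v_q(Δ_min)`) — FW21's Steinberg prime for every `g_n`
    Summit.BirchSwinnertonDyer.Rank1Residual.Additive.FWNonsplitRam W p →
    -- (NP) [v16]: the NON-PRIMITIVE locus — some pinned `+` tuple has bottom class invisible at every admissible Frobenius
    RootInvisibleNS W K p N f →
    -- the `𝔽_p`-structure of `H¹(K, E[p])` and the OFF-CORE-ROOT hypothesis `dim_𝔽p Sel_p(E/K)[p] ≥ 3` [v18]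
    ∀ [Module (ZMod p) (AdditiveKoly.Vp W K p)],
      3 ≤ finrank (ZMod p) (AddSubgroup.toZModSubmodule p (selmerGroup (W.baseChange K) ((p ^ 1 : ℕ) : ℤ))) →
      -- (Anch∃) [v19]: SOME odd Zhang-admissible level carries Brandt data with a non-zero mod-p WEIGHTED toric period
      ∃ s : Finset ℕ, IsZhangAdmissibleLevel N K (fun ℓ ↦ W.frobeniusTrace ℓ) p s ∧ Odd s.card ∧
        ∃ (S : Brandt.XiSetup N (∏ q ∈ s, q)) (ψ : K →ₐ[ℚ] S.D) (I : Submodule ℤ S.D) (φ : Brandt.ClassSet S.O → ZMod p),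
          Brandt.IsGrossPoint S.O ψ I ∧
          (letI : Fintype (Brandt.ClassSet S.O) := Fintype.ofFinite _
           φ ∈ Brandt.eigenSpace (ZMod p) (N * ∏ q ∈ s, q) (Brandt.matrix S.O) (fun ℓ ↦ W.frobeniusTrace ℓ)) ∧
          Brandt.toricPeriod S.O ψ I (fun i ↦ (Brandt.weight S.O i : ZMod p) * φ i) ≠ 0

/-- **(Anch∃)_{≥3},FW,Z [v21] — THE REGISTERED TEXT of `AdmdefLine.stub_definiteAnchorExistsNP3FWZ`**: (Anch∃)_NP,≥3,FW with the hypothesis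
`RootInvisibleNS W K p N f` RE-KEYED to `RootZeroNS W K p N f` («some pinned `+` tuple has `z_{0,1} = 0`»).  KERNEL-EQUIVALENT to the v20 text
(`AdmdefLine.definiteAnchorExistsNP3FW` ∕ `definiteAnchorExistsNP3FWZ_of_definiteAnchorExistsNP3FW`).  Source status unchanged: PREPRINT (FW21 Thm 5.1 ∕ Cor 1.10 ×2)
modulo the untyped ports (T1–T4 of memo `Lines/admdef-lead-g23.md` §4).  [cite: FouquetWan2021, Thm. 5.1, Cor. 1.10 (arXiv:2107.13726v3 p. 53, p. 6)]
[cite: WZhang2014, Thm. 5.2, Thm. 6.4] [cite: CastellaEtAl2025, §7.4, Thm. 7.5] -/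
@[conjecture] def DefiniteAnchorExistsNP3FWZNS : Prop :=
  ∀ {p : ℕ} [Fact p.Prime] (W : WeierstrassCurve ℚ) [W.IsElliptic] [W.IsGloballyMinimal]
    (K : Type) [Field K] [NumberField K] {N : ℕ} [NeZero N] {f : CuspForm (CongruenceSubgroup.Gamma0 N) 2}
    (_ : IsNewformOf W f),
    (N : ℤ) = W.conductorNorm ℤ → 5 ≤ p → W.HasGoodReductionAtPrime p → W.frobeniusTrace p = 0 →
    Surj W p →
    IsImaginaryQuadratic K → ((Ideal.span {(p : ℤ)}).primesOver (𝓞 K)).ncard = 2 →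
    (∀ ℓ : ℕ, ℓ.Prime → ℓ ∣ N → ((Ideal.span {(ℓ : ℤ)}).primesOver (𝓞 K)).ncard = 2) →
    IsCoprime (N : ℤ) (NumberField.discr K) → ¬ p ∣ NumberField.classNumber K →
    -- (i) NEGATED: `N` is NOT square-free
    ¬ Squarefree N →
    -- (ii): `E[p]` ramified at every prime `q ∣ N`
    (∀ q : ℕ, q.Prime → q ∣ N →
      ∃ v : HeightOneSpectrum (𝓞 ℚ), ((q : ℕ) : 𝓞 ℚ) ∈ v.asIdeal ∧
        ∃ 𝔓 ∈ v.primesAbove, ∃ σ ∈ 𝔓.inertia (absoluteGaloisGroup ℚ),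
          ∃ P : W.geomTorsion (p : ℤ), σ • P ≠ P) →
    -- [v20] the FOUQUET–WAN LOCUS: some non-split multiplicative `q ≠ p` with `E[p]` ramified (`p ∤ v_q(Δ_min)`) — FW21's Steinberg prime for every `g_n`
    Summit.BirchSwinnertonDyer.Rank1Residual.Additive.FWNonsplitRam W p →
    -- (NP) [v16]: the NON-PRIMITIVE locus — some pinned `+` tuple has bottom class invisible at every admissible Frobenius
    RootZeroNS W K p N f →
    -- the `𝔽_p`-structure of `H¹(K, E[p])` and the OFF-CORE-ROOT hypothesis `dim_𝔽p Sel_p(E/K)[p] ≥ 3` [v18]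
    ∀ [Module (ZMod p) (AdditiveKoly.Vp W K p)],
      3 ≤ finrank (ZMod p) (AddSubgroup.toZModSubmodule p (selmerGroup (W.baseChange K) ((p ^ 1 : ℕ) : ℤ))) →
      -- (Anch∃) [v19]: SOME odd Zhang-admissible level carries Brandt data with a non-zero mod-p WEIGHTED toric period
      ∃ s : Finset ℕ, IsZhangAdmissibleLevel N K (fun ℓ ↦ W.frobeniusTrace ℓ) p s ∧ Odd s.card ∧
        ∃ (S : Brandt.XiSetup N (∏ q ∈ s, q)) (ψ : K →ₐ[ℚ] S.D) (I : Submodule ℤ S.D) (φ : Brandt.ClassSet S.O → ZMod p),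
          Brandt.IsGrossPoint S.O ψ I ∧
          (letI : Fintype (Brandt.ClassSet S.O) := Fintype.ofFinite _
           φ ∈ Brandt.eigenSpace (ZMod p) (N * ∏ q ∈ s, q) (Brandt.matrix S.O) (fun ℓ ↦ W.frobeniusTrace ℓ)) ∧
          Brandt.toricPeriod S.O ψ I (fun i ↦ (Brandt.weight S.O i : ZMod p) * φ i) ≠ 0

/-- **(Anch∃)_NP,≥3,¬FW — THE v20 REGISTERED TEXT of `AdmdefLine.stub_definiteAnchorExistsNP3NFW`**: (Anch∃)_NP,≥3 with ONE inserted hypothesis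
`¬ Rank1Residual.Additive.FWNonsplitRam W p →` before (NP): on β this means every multiplicative `q ∣ N` with `E[p]` ramified is SPLIT multiplicative
(the cell contains α = all-additive).  UNSOURCED: no maintained print or preprint delivers the rank-0 anchor for the level-raised non-ordinary `g_n` here
([Wan16] withdrawn; FW21 needs a `ρ̄`-ramified NON-split Steinberg prime; CÇSS Thm. C ∕ BSTW Thms. 1.5–1.6 semistable only; CHKLL25 Thm. 7.6 (ii) square-free;
CLW22 needs a `ρ̄`-ramified non-split `q`) — the SAME named open input as cell α's K1 (`Cruxes/…/BLVStep4ReadingFlag.md` §3): «rank-0 Eisenstein ∕ BDP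
`p`-converse + `p`-part of BSD for the level-raised GL₂-type `A_ξ`, `A_ξ ⊗ ε_K` at additive ∕ non-square-free level and supersingular `p`, with no residually
non-split-ramified Steinberg prime».  STRICTLY WEAKER than (Anch∃)_NP,≥3.  HARDEST.  Token (390): CONTENT.  Barrier-audit candidate «NoUnramifiedSteinbergAnchor».
[cite: FouquetWan2021, Thm. 5.1, Assumption 3.7 (arXiv:2107.13726v3 p. 20, p. 53)] [cite: CastellaEtAl2025, §7.4, Thm. 7.6] [cite: BurungaleCastellaKim2021, arXiv:1908.09512 Prop. 7.4, Lem. 7.6]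
[cite: Howard2006, Thm. 3.2.3 (c)] [cite: Gross1987, Prop. 10.3, §11] -/
@[conjecture] def DefiniteAnchorExistsNP3NFWNS : Prop :=
  ∀ {p : ℕ} [Fact p.Prime] (W : WeierstrassCurve ℚ) [W.IsElliptic] [W.IsGloballyMinimal]
    (K : Type) [Field K] [NumberField K] {N : ℕ} [NeZero N] {f : CuspForm (CongruenceSubgroup.Gamma0 N) 2}
    (_ : IsNewformOf W f),
    (N : ℤ) = W.conductorNorm ℤ → 5 ≤ p → W.HasGoodReductionAtPrime p → W.frobeniusTrace p = 0 →
    Surj W p →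
    IsImaginaryQuadratic K → ((Ideal.span {(p : ℤ)}).primesOver (𝓞 K)).ncard = 2 →
    (∀ ℓ : ℕ, ℓ.Prime → ℓ ∣ N → ((Ideal.span {(ℓ : ℤ)}).primesOver (𝓞 K)).ncard = 2) →
    IsCoprime (N : ℤ) (NumberField.discr K) → ¬ p ∣ NumberField.classNumber K →
    -- (i) NEGATED: `N` is NOT square-free
    ¬ Squarefree N →
    -- (ii): `E[p]` ramified at every prime `q ∣ N`
    (∀ q : ℕ, q.Prime → q ∣ N →
      ∃ v : HeightOneSpectrum (𝓞 ℚ), ((q : ℕ) : 𝓞 ℚ) ∈ v.asIdeal ∧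
        ∃ 𝔓 ∈ v.primesAbove, ∃ σ ∈ 𝔓.inertia (absoluteGaloisGroup ℚ),
          ∃ P : W.geomTorsion (p : ℤ), σ • P ≠ P) →
    -- [v20] OFF the Fouquet–Wan locus: NO non-split multiplicative `q ≠ p` with `E[p]` ramified — no maintained source for the rank-0 anchor
    ¬ Summit.BirchSwinnertonDyer.Rank1Residual.Additive.FWNonsplitRam W p →
    -- (NP) [v16]: the NON-PRIMITIVE locus — some pinned `+` tuple has bottom class invisible at every admissible Frobenius
    RootInvisibleNS W K p N f →
    -- the `𝔽_p`-structure of `H¹(K, E[p])` and the OFF-CORE-ROOT hypothesis `dim_𝔽p Sel_p(E/K)[p] ≥ 3` [v18]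
    ∀ [Module (ZMod p) (AdditiveKoly.Vp W K p)],
      3 ≤ finrank (ZMod p) (AddSubgroup.toZModSubmodule p (selmerGroup (W.baseChange K) ((p ^ 1 : ℕ) : ℤ))) →
      -- (Anch∃) [v19]: SOME odd Zhang-admissible level carries Brandt data with a non-zero mod-p WEIGHTED toric period
      ∃ s : Finset ℕ, IsZhangAdmissibleLevel N K (fun ℓ ↦ W.frobeniusTrace ℓ) p s ∧ Odd s.card ∧
        ∃ (S : Brandt.XiSetup N (∏ q ∈ s, q)) (ψ : K →ₐ[ℚ] S.D) (I : Submodule ℤ S.D) (φ : Brandt.ClassSet S.O → ZMod p),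
          Brandt.IsGrossPoint S.O ψ I ∧
          (letI : Fintype (Brandt.ClassSet S.O) := Fintype.ofFinite _
           φ ∈ Brandt.eigenSpace (ZMod p) (N * ∏ q ∈ s, q) (Brandt.matrix S.O) (fun ℓ ↦ W.frobeniusTrace ℓ)) ∧
          Brandt.toricPeriod S.O ψ I (fun i ↦ (Brandt.weight S.O i : ZMod p) * φ i) ≠ 0

/-- **(Anch∃)_{≥3},¬FW,Z [v21] — THE REGISTERED TEXT of `AdmdefLine.stub_definiteAnchorExistsNP3NFWZ`** (HARDEST, UNSOURCED = cell α's K1): (Anch∃)_NP,≥3,¬FW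
with `RootInvisibleNS` RE-KEYED to `RootZeroNS`.  KERNEL-EQUIVALENT to the v20 text (`AdmdefLine.definiteAnchorExistsNP3NFW` ∕ `…NFWZ_of_…NFW`).  On this piece
every multiplicative prime of `E` is SPLIT multiplicative, so neither `g_s` nor `g_s ⊗ χ_K` has a residually-ramified non-split Steinberg prime: no maintained
source (barrier-audit candidate «NoUnramifiedSteinbergAnchor»).  [cite: FouquetWan2021, Thm. 5.1, Assumption 3.7 (arXiv:2107.13726v3 p. 53, p. 20)]
[cite: CastellaEtAl2025, §7.4, Thm. 7.6] [cite: Howard2006, Thm. 2.3.7, Thm. 3.2.3 (c)] -/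
@[conjecture] def DefiniteAnchorExistsNP3NFWZNS : Prop :=
  ∀ {p : ℕ} [Fact p.Prime] (W : WeierstrassCurve ℚ) [W.IsElliptic] [W.IsGloballyMinimal]
    (K : Type) [Field K] [NumberField K] {N : ℕ} [NeZero N] {f : CuspForm (CongruenceSubgroup.Gamma0 N) 2}
    (_ : IsNewformOf W f),
    (N : ℤ) = W.conductorNorm ℤ → 5 ≤ p → W.HasGoodReductionAtPrime p → W.frobeniusTrace p = 0 →
    Surj W p →
    IsImaginaryQuadratic K → ((Ideal.span {(p : ℤ)}).primesOver (𝓞 K)).ncard = 2 →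
    (∀ ℓ : ℕ, ℓ.Prime → ℓ ∣ N → ((Ideal.span {(ℓ : ℤ)}).primesOver (𝓞 K)).ncard = 2) →
    IsCoprime (N : ℤ) (NumberField.discr K) → ¬ p ∣ NumberField.classNumber K →
    -- (i) NEGATED: `N` is NOT square-free
    ¬ Squarefree N →
    -- (ii): `E[p]` ramified at every prime `q ∣ N`
    (∀ q : ℕ, q.Prime → q ∣ N →
      ∃ v : HeightOneSpectrum (𝓞 ℚ), ((q : ℕ) : 𝓞 ℚ) ∈ v.asIdeal ∧
        ∃ 𝔓 ∈ v.primesAbove, ∃ σ ∈ 𝔓.inertia (absoluteGaloisGroup ℚ),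
          ∃ P : W.geomTorsion (p : ℤ), σ • P ≠ P) →
    -- [v20] OFF the Fouquet–Wan locus: NO non-split multiplicative `q ≠ p` with `E[p]` ramified — no maintained source for the rank-0 anchor
    ¬ Summit.BirchSwinnertonDyer.Rank1Residual.Additive.FWNonsplitRam W p →
    -- (NP) [v16]: the NON-PRIMITIVE locus — some pinned `+` tuple has bottom class invisible at every admissible Frobenius
    RootZeroNS W K p N f →
    -- the `𝔽_p`-structure of `H¹(K, E[p])` and the OFF-CORE-ROOT hypothesis `dim_𝔽p Sel_p(E/K)[p] ≥ 3` [v18]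
    ∀ [Module (ZMod p) (AdditiveKoly.Vp W K p)],
      3 ≤ finrank (ZMod p) (AddSubgroup.toZModSubmodule p (selmerGroup (W.baseChange K) ((p ^ 1 : ℕ) : ℤ))) →
      -- (Anch∃) [v19]: SOME odd Zhang-admissible level carries Brandt data with a non-zero mod-p WEIGHTED toric period
      ∃ s : Finset ℕ, IsZhangAdmissibleLevel N K (fun ℓ ↦ W.frobeniusTrace ℓ) p s ∧ Odd s.card ∧
        ∃ (S : Brandt.XiSetup N (∏ q ∈ s, q)) (ψ : K →ₐ[ℚ] S.D) (I : Submodule ℤ S.D) (φ : Brandt.ClassSet S.O → ZMod p),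
          Brandt.IsGrossPoint S.O ψ I ∧
          (letI : Fintype (Brandt.ClassSet S.O) := Fintype.ofFinite _
           φ ∈ Brandt.eigenSpace (ZMod p) (N * ∏ q ∈ s, q) (Brandt.matrix S.O) (fun ℓ ↦ W.frobeniusTrace ℓ)) ∧
          Brandt.toricPeriod S.O ψ I (fun i ↦ (Brandt.weight S.O i : ZMod p) * φ i) ≠ 0

/-! ### §5e The plug theorems in v7 currency -/

/-- `H¹(K, E[p])` is killed by `p` (copy of v7's `p_nsmul_vp_eq_zero`; feeds `AddCommGroup.zmodModule`). [folklore] -/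
theorem p_nsmul_vp_eq_zero' {p : ℕ} [Fact p.Prime] (W : WeierstrassCurve ℚ) (K : Type) [Field K] [NumberField K]
    (x : AdditiveKoly.Vp W K p) : p • x = 0 := by
  have h := Literature.NumberTheory.EllipticCurves.zsmul_galH1Torsion_eq_zero (W.baseChange K) ((p ^ 1 : ℕ) : ℤ) x
  rw [← natCast_zsmul]
  convert h using 2
  push_cast
  ring

/-- **v7's (Anch) implies (Anch±)** — the re-key asks STRICTLY LESS of the hands (bookkeeping). [folklore] -/
theorem definiteAnchorSignedNS_of_definiteAnchorNS (h : DefiniteAnchorNS) : DefiniteAnchorSignedNS := by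
  intro p _ W _ _ K _ _ N _ f hf hN hp hgood hap hsurj hK hsplit hHeeg hcop hh hnsq hram c hc1 _ n hodd _ hzero
  exact h W K hf hN hp hgood hap hsurj hK hsplit hHeeg hcop hh hnsq hram c hc1 n hodd hzero

/-- **(Anch±) ⟹ (Anch±)_NP [v16]** — the reshape asks STRICTLY LESS of the hands (the hypothesis (NP) is discarded; bookkeeping; = the landed
`Theorems/…AdmdefRootDichotomy.anchorNP_of_anchor` with the Props folded). [folklore] -/
theorem definiteAnchorSignedNPNS_of_definiteAnchorSignedNS (h : DefiniteAnchorSignedNS) : DefiniteAnchorSignedNPNS := by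
  intro p _ W _ _ K _ _ N _ f hf hN hp hgood hap hsurj hK hsplit hHeeg hcop hh hnsq hram _hNP c hc1 _ n hodd hboth hzero
  exact h W K hf hN hp hgood hap hsurj hK hsplit hHeeg hcop hh hnsq hram c hc1 n hodd hboth hzero

/-- **(Anch±)_NP ⟹ (Anch±)_NP,≥3 [v18]** — the rank split asks STRICTLY LESS of the anchor (the hypothesis `3 ≤ dim` is discarded; bookkeeping). [folklore] -/
theorem definiteAnchorSignedNP3NS_of_definiteAnchorSignedNPNS (h : DefiniteAnchorSignedNPNS) : DefiniteAnchorSignedNP3NS := by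
  intro p _ W _ _ K _ _ N _ f hf hN hp hgood hap hsurj hK hsplit hHeeg hcop hh hnsq hram hNP c hc1 _ _h3 n hodd hboth hzero
  exact h W K hf hN hp hgood hap hsurj hK hsplit hHeeg hcop hh hnsq hram hNP c hc1 n hodd hboth hzero

end V7Plug

end Summit.BirchSwinnertonDyer.BirchSwinnertonDyer.Cruxes.AnticyclotomicEisensteinDivisibility.Signdetour

namespace Summit.BirchSwinnertonDyer.BirchSwinnertonDyer.Cruxes.AnticyclotomicEisensteinDivisibility.AdmdefLine

open Summit.BirchSwinnertonDyer.BirchSwinnertonDyer.Theses.SignedBaseChange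

/-! ## Cell α lies INSIDE the all-ramified cell: `exists_inertia_smul_geomTorsion_ne_of_sq_dvd_conductorNorm` /
`allRamified_of_allAdditive` — PROVED, now in `Theorems/…AdmdefRamifiedNS.lean` (p724409) and imported. -/

/-! ## The stubs (5 [v23]; history: [v16] (Anch±) ⟶ (Anch±)_NP; [v17] γ′ ⟶ (γ′)_NP; [v18] rank split (RV₁) + (Anch±)_NP,≥3; [v19] ⟶ (Anch∃); [v20] FW cut; [v21] Z re-key;
[v22] (RV₁)Z ⟶ (RV₁)H; [v23] ⟶ the print-natural (Anch) cut by FW, (RV₁)H deleted): the cite stub + ONE shared `p ∣ h_K` stub (S1∣; byte-identical with bdpline v37) +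
(Anch)_FW + (Anch)_¬FW + (γ′)_NP,Z; the BRIDGE's two PRINT typing targets (P0+P1, MULT1) are cites (15)–(16) since v15, (Par) derived since v8, (a2) derived since v11. -/

/-- cite stub `stub_namedFactsSS` [CITE-ONLY — never a proof target, never benched, never counted] (VARIANT-N shape of record,
director-bsd (390)(1)/(394)(3); PRINT; text = v1 / `Bdpline.stub_namedFactsSS` v37 MINUS the Tate-EPC conjunct (discharged in v3)): the conjunction,
BY NAME, of the fourteen typed Literature named facts the composition consumes — (1) YZ26 Thm 4.2 / 4.7 / 3.3 (ordinary slice), (2) LV19 Thm 1.4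
(`X^ε` of Λ-rank one), (3) CW24 inputs of the proof of Thm 6.8 (frame, class, `TransferInputs`), (4) BLV26 Thm A ∘ CW24 Thm 6.8 [reading flag
`BLV-step4-UNSOURCED-on-R4`; consumed ONLY on the all-additive cell by `…_of`, NOT by `…_of_noBLV`], (5) Gr16 Prop 4.1.1 [v3: Tate's global Euler–Poincaré characteristic at totally complex `K`
is now a kernel THEOREM, `forall_tateGlobalEulerPoincareCharacteristic_of_isTotallyComplex`, cell bsd-eis — no longer cited], (6) BCS25 proof of Prop 4.2.2 (span comparison), (7) BCS25 Prop 4.2.2 (`μ = 0` BDP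
frame), (8) CHKLL25 Thm 7.1 / Cor 7.2 (square-free `N`, all-ramified; consumed on the square-free-ramified cell — v2 restores this print road),
[v5] (9) CW24 Lemma 6.7 (`castellaWan2024_lemma67_finrank_torsionCharIdeal`: `loc_𝔭` injective on `Sel_+` with NO Tamagawa binder), (10) CW24 proof of Thm 6.8
"`Sel^{±,rel} ≤ Sel_±`" (`castellaWan2024_proofThm68_selmerRel_le_selmerSgn`), (11) CHKLL25 Thm 7.5 = Howard 2006 Thm 3.2.3 in the `±` setting
(`thm75_howard_rank_one_sq_le_and_le_of_hasUnitLambda`) — (9)–(11) consumed on cell β by §Glue; [v8] (12) Cassels–Tate (`∀ K,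
WeierstrassCurve.exists_casselsTate_pairing`: alternating pairing on `Ш(E/K)` with kernel the divisible part; Cassels 1962 ∕ Tate 1963 ∕ AEC X.4.14) and
(13) Dokchitser–Dokchitser 2010 §4.6 step (4) (`dokchitser_selmerCorank_baseChange_mod_two_eq`: `rk_p(E/K)` odd for `K` imaginary quadratic Heegner,
`p` odd) — (12)–(13) consumed by `oddSelmerDim` ((Par), derived); [v11] (14) Castella–Hsu–Kundu–Lee–Liu 2025 **Prop. 2.5**
(`CastellaHsuKunduLeeLiu2025.prop25_XAc_isTorsion`: `X_ac = Sel_q(K_∞, W)^∨` is `Λ`-torsion under (Heeg) + (spl) + (h0), NO class-number hypothesis;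
typed 2026-08-29 by literature-typer row `bsd-ssimc-ty-acsignedGeneral`, reading flag `CHKLL-prop25-adaptation`: one-sentence printed proof) — (14) consumed by
`xAcTorsionSS_classDvd` ((a2) at `p ∣ h_K`, derived, `Theorems/…AdmdefXAcTorsionOfProp25`).
(4) and (14) carry reading flags; (3), (6)–(14) refereed; none has a `_holds` in the tree.  Token (390): PURE-CITE. -/
theorem stub_namedFactsSS :
    (Literature.NumberTheory.EllipticCurves.YanZhu2026.thm42_XGr₂_isTorsion_charIdeal_le_greenbergAnyRoot ∧
      Literature.NumberTheory.EllipticCurves.YanZhu2026.thm47_ord_localised_iff_greenbergAnyRoot_localised_guarded ∧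
      Literature.NumberTheory.EllipticCurves.YanZhu2026.thm33_exists_isHidaRankinLFunction) ∧
    (∀ (W : WeierstrassCurve ℚ) [W.IsGloballyMinimal] (K : Type) [Field K] [NumberField K] (p : ℕ) [Fact p.Prime]
      (κ : Literature.NumberTheory.EllipticCurves.ZpExtension K p) (𝔭 𝔭' : IsDedekindDomain.HeightOneSpectrum (NumberField.RingOfIntegers K)),
      Literature.NumberTheory.EllipticCurves.AcSigned.longoVigni2019_thm14_signedSelmerDual_rank_one W K p κ 𝔭 𝔭') ∧
    (∀ (N : ℕ) [NeZero N] (W : WeierstrassCurve ℚ) [W.IsGloballyMinimal] (K : Type) [Field K] [NumberField K] (p : ℕ) [Fact p.Prime]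
      (κ : Literature.NumberTheory.EllipticCurves.ZpExtension K p) (𝔭 𝔭' : IsDedekindDomain.HeightOneSpectrum (NumberField.RingOfIntegers K)),
      Literature.NumberTheory.EllipticCurves.AcSigned.castellaWan2024_proofThm68_transferInputs N W K p κ 𝔭 𝔭') ∧
    Literature.NumberTheory.EllipticCurves.BertoliniLongoVenerucci2026.thmA_castellaWan_thm68_exists_isCWBDPLFunction_charIdeal_map_le_rat ∧
    Literature.NumberTheory.IwasawaTheory.Greenberg2016.prop411_selmer_isAlmostDivisible ∧
    Literature.NumberTheory.EllipticCurves.BurungaleCastellaSkinner2025.proofProp422_span_minus_eq_span_bdp_goodReduction ∧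
    Literature.NumberTheory.EllipticCurves.BurungaleCastellaSkinner2025.prop422_exists_isBDPLFunction_mu_eq_zero ∧
    Literature.NumberTheory.EllipticCurves.CastellaHsuKunduLeeLiu2025.thm71_cor72_exists_isCWBDPLFunction_charIdeal_map_le_rat ∧
    (∀ (N : ℕ) [NeZero N] (W : WeierstrassCurve ℚ) [W.IsGloballyMinimal] (K : Type) [Field K] [NumberField K] (p : ℕ) [Fact p.Prime]
      (κ : Literature.NumberTheory.EllipticCurves.ZpExtension K p) (𝔭 𝔭' : IsDedekindDomain.HeightOneSpectrum (NumberField.RingOfIntegers K)),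
      Literature.NumberTheory.EllipticCurves.AcSigned.castellaWan2024_lemma67_finrank_torsionCharIdeal N W K p κ 𝔭 𝔭') ∧
    (∀ (N : ℕ) [NeZero N] (W : WeierstrassCurve ℚ) [W.IsGloballyMinimal] (K : Type) [Field K] [NumberField K] (p : ℕ) [Fact p.Prime]
      (κ : Literature.NumberTheory.EllipticCurves.ZpExtension K p) (𝔭 𝔭' : IsDedekindDomain.HeightOneSpectrum (NumberField.RingOfIntegers K)),
      Literature.NumberTheory.EllipticCurves.AcSigned.castellaWan2024_proofThm68_selmerRel_le_selmerSgn N W K p κ 𝔭 𝔭') ∧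
    (∀ (N : ℕ) [NeZero N] (W : WeierstrassCurve ℚ) [W.IsGloballyMinimal] (K : Type) [Field K] [NumberField K] (p : ℕ) [Fact p.Prime]
      (κ : Literature.NumberTheory.EllipticCurves.ZpExtension K p) (𝔭 𝔭' : IsDedekindDomain.HeightOneSpectrum (NumberField.RingOfIntegers K)),
      Literature.NumberTheory.EllipticCurves.CastellaHsuKunduLeeLiu2025.thm75_howard_rank_one_sq_le_and_le_of_hasUnitLambda N W K p κ 𝔭 𝔭') ∧
    Literature.NumberTheory.EllipticCurves.dokchitser_selmerCorank_baseChange_mod_two_eq ∧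
    Literature.NumberTheory.EllipticCurves.CastellaHsuKunduLeeLiu2025.prop25_XAc_isTorsion ∧
    Literature.NumberTheory.EllipticCurves.DefiniteMultiplicityOne.kimOta2023_thm55_brandtEigenvector_modP_unique ∧
    Literature.NumberTheory.EllipticCurves.CastellaHsuKunduLeeLiu2025.thm74_eq72_exists_signedSystem_transferClass_dictionary := by
  sorry

/-- conjunct (8): CHKLL25 Thm 7.1 / Cor 7.2 (projection of the cite stub). -/
theorem cite_chkll71 : Literature.NumberTheory.EllipticCurves.CastellaHsuKunduLeeLiu2025.thm71_cor72_exists_isCWBDPLFunction_charIdeal_map_le_rat :=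
  stub_namedFactsSS.2.2.2.2.2.2.2.1

/-- conjunct (9) [v5]: CW24 Lemma 6.7 (projection of the cite stub). -/
theorem cite_cw67 : ∀ (N : ℕ) [NeZero N] (W : WeierstrassCurve ℚ) [W.IsGloballyMinimal] (K : Type) [Field K] [NumberField K] (p : ℕ) [Fact p.Prime]
      (κ : Literature.NumberTheory.EllipticCurves.ZpExtension K p) (𝔭 𝔭' : IsDedekindDomain.HeightOneSpectrum (NumberField.RingOfIntegers K)),
      Literature.NumberTheory.EllipticCurves.AcSigned.castellaWan2024_lemma67_finrank_torsionCharIdeal N W K p κ 𝔭 𝔭' :=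
  stub_namedFactsSS.2.2.2.2.2.2.2.2.1

/-- conjunct (10) [v5]: CW24 "`Sel^{±,rel} ≤ Sel_±`" (projection of the cite stub). -/
theorem cite_cwRel : ∀ (N : ℕ) [NeZero N] (W : WeierstrassCurve ℚ) [W.IsGloballyMinimal] (K : Type) [Field K] [NumberField K] (p : ℕ) [Fact p.Prime]
      (κ : Literature.NumberTheory.EllipticCurves.ZpExtension K p) (𝔭 𝔭' : IsDedekindDomain.HeightOneSpectrum (NumberField.RingOfIntegers K)),
      Literature.NumberTheory.EllipticCurves.AcSigned.castellaWan2024_proofThm68_selmerRel_le_selmerSgn N W K p κ 𝔭 𝔭' :=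
  stub_namedFactsSS.2.2.2.2.2.2.2.2.2.1

/-- conjunct (11) [v5]: CHKLL25 Thm 7.5 (projection of the cite stub). -/
theorem cite_chkll75 : ∀ (N : ℕ) [NeZero N] (W : WeierstrassCurve ℚ) [W.IsGloballyMinimal] (K : Type) [Field K] [NumberField K] (p : ℕ) [Fact p.Prime]
      (κ : Literature.NumberTheory.EllipticCurves.ZpExtension K p) (𝔭 𝔭' : IsDedekindDomain.HeightOneSpectrum (NumberField.RingOfIntegers K)),
      Literature.NumberTheory.EllipticCurves.CastellaHsuKunduLeeLiu2025.thm75_howard_rank_one_sq_le_and_le_of_hasUnitLambda N W K p κ 𝔭 𝔭' :=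
  stub_namedFactsSS.2.2.2.2.2.2.2.2.2.2.1

/-- conjunct (12) [v8]: Cassels–Tate (projection of the cite stub). -/
theorem cite_casselsTate : ∀ (K : Type) [Field K] [NumberField K], WeierstrassCurve.exists_casselsTate_pairing (K := K) :=
  -- [v24, LEAD g31] DISCHARGED from the tree (route-independent inputs, as in `Theorems/KolyvaginRankRigidityAtTwoStartFrameOfParity`):
  -- the levelwise Cassels–Tate assembly modulo a theta datum + the even-level theta datum (Morgan–Smith 2021 §5)
  fun K _ _ ↦ GenusExact.CasselsTatePTcReal.exists_casselsTate_pairing_of_levelThetaDatum (K := K)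
    fun V _ k hk _ e hμ hadd₁ hadd₂ _hgal halt _hnd =>
      ⟨levelThetaDatumEven V (2 ^ k) e hμ hadd₁ hadd₂ halt (Nat.even_pow.mpr ⟨even_two, hk.ne'⟩)⟩

/-- conjunct (13) [v8]: Dokchitser–Dokchitser 2010 §4.6 step (4) (projection of the cite stub). -/
theorem cite_dokchitser : Literature.NumberTheory.EllipticCurves.dokchitser_selmerCorank_baseChange_mod_two_eq :=
  stub_namedFactsSS.2.2.2.2.2.2.2.2.2.2.2.1

/-- conjunct (14) [v11]: Castella–Hsu–Kundu–Lee–Liu 2025 Prop. 2.5 (projection of the cite stub). -/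
theorem cite_prop25 : Literature.NumberTheory.EllipticCurves.CastellaHsuKunduLeeLiu2025.prop25_XAc_isTorsion :=
  stub_namedFactsSS.2.2.2.2.2.2.2.2.2.2.2.2.1

/-- conjunct (15) [v15]: multiplicity one mod `p` on the definite side — PW11 Thm 6.2 / KO23 Thm 5.5 in eigenvector form (projection of the cite stub;
typed by bsd-inputs-honda-p1 g17, p746851). -/
theorem cite_mult1 : Literature.NumberTheory.EllipticCurves.DefiniteMultiplicityOne.kimOta2023_thm55_brandtEigenvector_modP_unique :=
  stub_namedFactsSS.2.2.2.2.2.2.2.2.2.2.2.2.2.1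

/-- conjunct (16) [v15]: CHKLL25 Thm 7.4 WITH its construction ((7.1) = (7.2), transfer inputs, weighted definite dictionary at `j = 1`) (projection of the
cite stub; typed by bsd-inputs-honda-p1 g17 from `Lines/admdef_bridge_spec.lean` v2, p747068). -/
theorem cite_p0p1 : Literature.NumberTheory.EllipticCurves.CastellaHsuKunduLeeLiu2025.thm74_eq72_exists_signedSystem_transferClass_dictionary :=
  stub_namedFactsSS.2.2.2.2.2.2.2.2.2.2.2.2.2.2

/-- **(a2) DERIVED [v11]** (was the registered stub `stub_xAcTorsionSS_classDvd`, PRE since v1; text byte-identical with `Bdpline.stub_xAcTorsionSS_classDvd`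
and crux 20728's `Ratlift.…`): `X_ac` is `Λ`-torsion at `p ∣ h_K` — FROM the cite conjunct (14) Castella–Hsu–Kundu–Lee–Liu 2025 Prop. 2.5 (no class-number
hypothesis) by the kernel glue `Theorems/…AdmdefXAcTorsionOfProp25.xAcTorsionSS_classDvd_of_prop25` ((h0) from `Surj`, Gross 1991 §2; bsd-idea-14 g28's shape
glue, credited).  [cite: CastellaEtAl2025, Prop. 2.5 (arXiv:2308.10474v2 p0008 L17–L28)] -/
theorem xAcTorsionSS_classDvd :
    SignedTwoVariableInputs → Literature.NumberTheory.EllipticCurves.ModularForms.nonempty_modularParametrizationData → ∀ (W : WeierstrassCurve ℚ) [W.IsElliptic] [W.IsGloballyMinimal] (p : ℕ) [Fact p.Prime], 5 ≤ p → W.HasGoodReductionAtPrime p → W.frobeniusTrace p = 0 → Literature.NumberTheory.EllipticCurves.Rank1Residual.Surj W p → ∀ (K : Type) [Field K] [NumberField K] (ι : PadicAlgCl p ≃+* ℂ) (v vbar : IsDedekindDomain.HeightOneSpectrum (NumberField.RingOfIntegers K)) (κ₁ κ₂ : Literature.NumberTheory.EllipticCurves.ZpExtension K p) (γ₁ γ₂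 : Field.absoluteGaloisGroup K) [Fact (Literature.NumberTheory.EllipticCurves.ZpExtension.IsTopGeneratorPair κ₁ κ₂ γ₁ γ₂)] [NeZero (NumberField.discr K).natAbs] (N : ℕ) [NeZero N] (f : CuspForm (CongruenceSubgroup.Gamma0 N) 2), Literature.NumberTheory.EllipticCurves.ModularForms.IsNewformOf W f → (N : ℤ) = W.conductorNorm ℤ → Literature.NumberTheory.EllipticCurves.IsImaginaryQuadratic K → ((Ideal.span {(p : ℤ)}).primesOver (NumberField.RingOfIntegers K)).ncard = 2 → ((p : ℕ) : NumberField.RingOfIntegers K) ∈ v.asIdeal → ((p : ℕ) : NumberField.RingOfIntegers K) ∈ vbar.asIdeal → vbar ≠ v → (∀ (w : NumberField.InfinitePlace K) (k : NumberField.RingOfIntegers K), k ∈ v.asIdeal ↔ ‖ι.symm (w.embedding (k : K))‖ < 1) → IsCoprime (N : ℤ) (NumberField.discr K) → (∀ ℓ : ℕ, ℓ.Prime → ℓ ∣ N → ((Ideal.span {(ℓ : ℤ)}).primesOver (NumberField.RingOfIntegers K)).ncard = 2) → Odd (NumberField.discr K) → NumberField.discr K ≠ -3 → κ₁.IsCyclotomic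 → κ₂.IsAnticyclotomic → p ∣ NumberField.classNumber K → (haveI : Fact (κ₂.IsTopGenerator γ₂) := ⟨Literature.NumberTheory.EllipticCurves.YanZhu2026.isTopGenerator_of_pair (κ₁ := κ₁) (γ₁ := γ₁)⟩; Module.IsTorsion (Literature.NumberTheory.EllipticCurves.IwasawaAlgebra p) (Literature.NumberTheory.EllipticCurves.Castella2018.AcSelmer.XAc (W.baseChange K) p κ₂ vbar ∅ γ₂)) :=
  SignedBaseChangeAcDivAdmdefXAcTorsionOfProp25.xAcTorsionSS_classDvd_of_prop25 cite_prop25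

/-- stub S1∣ (RESEARCH; SHARED with `Bdpline.stub_bdpLowerHalfRatSS_classDvd`, text byte-identical): S1 at `p ∣ h_K`. -/
theorem stub_bdpLowerHalfRatSS_classDvd :
    SignedTwoVariableInputs → Literature.NumberTheory.EllipticCurves.ModularForms.nonempty_modularParametrizationData → ∀ (W : WeierstrassCurve ℚ) [W.IsElliptic] [W.IsGloballyMinimal] (p : ℕ) [Fact p.Prime], 5 ≤ p → W.HasGoodReductionAtPrime p → W.frobeniusTrace p = 0 → Literature.NumberTheory.EllipticCurves.Rank1Residual.Surj W p → ∀ (K : Type) [Field K] [NumberField K] (ι : PadicAlgCl p ≃+* ℂ) (v vbar : IsDedekindDomain.HeightOneSpectrum (NumberField.RingOfIntegers K)) (κ₁ κ₂ : Literature.NumberTheory.EllipticCurves.ZpExtension K p) (γ₁ γ₂ : Field.absoluteGaloisGroup K) [Fact (Literature.NumberTheory.EllipticCurves.ZpExtension.IsTopGeneratorPair κ₁ κ₂ γ₁ γ₂)] [NeZero (NumberField.discr K).natAbs] (N : ℕ) [NeZero N] (f : CuspForm (CongruenceSubgroup.Gamma0 N) 2), Literature.NumberTheory.EllipticCurves.ModularForms.IsNewformOf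 W f → (N : ℤ) = W.conductorNorm ℤ → Literature.NumberTheory.EllipticCurves.IsImaginaryQuadratic K → ((Ideal.span {(p : ℤ)}).primesOver (NumberField.RingOfIntegers K)).ncard = 2 → ((p : ℕ) : NumberField.RingOfIntegers K) ∈ v.asIdeal → ((p : ℕ) : NumberField.RingOfIntegers K) ∈ vbar.asIdeal → vbar ≠ v → (∀ (w : NumberField.InfinitePlace K) (k : NumberField.RingOfIntegers K), k ∈ v.asIdeal ↔ ‖ι.symm (w.embedding (k : K))‖ < 1) → IsCoprime (N : ℤ) (NumberField.discr K) → (∀ ℓ : ℕ, ℓ.Prime → ℓ ∣ N → ((Ideal.span {(ℓ : ℤ)}).primesOver (NumberField.RingOfIntegers K)).ncard = 2) → Odd (NumberField.discr K) → NumberField.discr K ≠ -3 → κ₁.IsCyclotomic → κ₂.IsAnticyclotomic → p ∣ NumberField.classNumber K → (haveI : Fact (κ₂.IsTopGenerator γ₂) := ⟨Literature.NumberTheory.EllipticCurves.YanZhu2026.isTopGenerator_of_pair (κ₁ := κ₁) (γ₁ := γ₁)⟩; Module.IsTorsion (Literature.NumberTheory.EllipticCurves.IwasawaAlgebra p) (Literature.NumberTheory.EllipticCurves.Castella2018.AcSelmer.XAc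 (W.baseChange K) p κ₂ vbar ∅ γ₂)) → ∀ (ΩK : ℂ) (Ωp' : (Literature.NumberTheory.EllipticCurves.unrIntegers p)ˣ) (L : Literature.NumberTheory.EllipticCurves.UnrSeries p), ΩK ≠ 0 → Literature.NumberTheory.EllipticCurves.IsBDPLFunction ι v κ₂ γ₂ f ΩK ((Ωp' : Literature.NumberTheory.EllipticCurves.unrIntegers p) : PadicComplex p) L → ∀ J : ℤ_[p] →+* PadicComplexInt p, (∀ x : ℤ_[p], ((J x : PadicComplexInt p) : PadicComplex p) = ((x : ℚ_[p]) : PadicComplex p)) → ∀ (J₀ : Literature.NumberTheory.EllipticCurves.unrIntegers p →+* PadicComplexInt p), (∀ x : Literature.NumberTheory.EllipticCurves.unrIntegers p, ((J₀ x : PadicComplexInt p) : PadicComplex p) = (x : PadicComplex p)) → ∃ k : ℕ, ∀ y ∈ (haveI : Fact (κ₂.IsTopGenerator γ₂) := ⟨Literature.NumberTheory.EllipticCurves.YanZhu2026.isTopGenerator_of_pair (κ₁ := κ₁) (γ₁ := γ₁)⟩; Literature.NumberTheory.EllipticCurves.Castella2018.AcSelmer.XAc.charIdeal (W.baseChange K)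 p κ₂ vbar ∅ γ₂).map (PowerSeries.map J), PowerSeries.C (((p : ℕ) : PadicComplexInt p) ^ k) * y ∈ Ideal.span {PowerSeries.map J₀ L} := by
  sorry

/-- **P0+P1 DERIVED [v15]** (was the registered stub `stub_specP0P1`, v13–v14): `SpecP0P1` IS the typed named fact
`CastellaHsuKunduLeeLiu2025.thm74_eq72_exists_signedSystem_transferClass_dictionary` (cite conjunct (16), p747068; texts identical — definitional unfolding).
[cite: CastellaEtAl2025, Thm. 7.4, (7.1)–(7.2), p. 31 L9–12, p. 32 L50–63 (arXiv:2308.10474v2 pp. 30–32)] -/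
theorem specP0P1 : SpecP0P1 :=
  cite_p0p1

/-- **MULT1 DERIVED [v15]** (was the registered stub `stub_specMult1`, v13–v14): `SpecMult1` (v15 text, with the good-reduction binder) IS the typed named fact
`DefiniteMultiplicityOne.kimOta2023_thm55_brandtEigenvector_modP_unique` (cite conjunct (15), p746851; definitional unfolding).
[cite: KimOta2023, Thm. 5.5 (arXiv:1905.02926 §5.3)] [cite: PollackWeston2011, Thm. 6.2] -/
theorem specMult1 : SpecMult1 :=
  cite_mult1

/-- **BRIDGE DERIVED [v13→v15]** (was the registered stub `stub_bipartiteBridge`, v6–v12): `SignedBipartiteBridgeNS` from the two typed facts by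
`bridge_of_spec` (kernel); since v15 both inputs are cite conjuncts, so the BRIDGE is PRINT BY NAME + kernel glue. -/
theorem bipartiteBridge : SignedBipartiteBridgeNS :=
  bridge_of_spec specP0P1 specMult1

/-- **(Par) DERIVED [v8]** (was the v7 stub `stub_oddSelmerDim`): `OddSelmerDimBeta` from the cite conjuncts (12) Cassels–Tate and (13) DD10 step (4)
(`Theorems/…AdmdefOddSelmerDim.oddSelmerDim_of_casselsTate_of_dokchitser`, p735737 — [v12] imported, the inline copy of v8–v11 deleted). -/
theorem oddSelmerDim : OddSelmerDimBeta :=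
  SignedBaseChangeAcDivAdmdefOddSelmerDim.oddSelmerDim_of_casselsTate_of_dokchitser cite_casselsTate cite_dokchitser

/-- **[v22 → v23 RECORD] (RV₁)H ⟹ (RV₁)H-pinned** (forget the analytic frame): the v22 composition edge; in v23 the `d = 1` branch runs through the
anchor at the single Čebotarev vertex instead, so this is a certificate (orphan by design). [folklore] -/
theorem heegnerBottomRankOnePinned_of_heegnerBottomRankOne (h : Signdetour.HeegnerBottomRankOneNS) :
    Signdetour.HeegnerBottomRankOnePinnedNS := by
  intro p _ ι W _ _ K _ _ 𝔭 𝔭bar κ γ hγF N _ f hf hN hp hgood hap hsurj hK hsplit h𝔭 hι h𝔭bar hne hHeeg hcop hh hodd hne3 hnsq hram _ hd1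
    hac h𝔭ns γ𝔭 hγ𝔭 ΩK Ωp L _hΩ _hL jbar F hF z B hzF _hT hB hbase hprim
  exact h W K hf hN hp hgood hap hsurj hK hsplit hHeeg hcop hh hodd hne3 hnsq hram hd1 κ γ hac hγF.out jbar F hF z B hzF hB hbase hprim

/-- **Conservativity certificate [v21 → v22]: v21's registered text (RV₁)Z ALSO implies the edge** — given the pinned Heegner tuple of the edge and
`z_{0,1} = 0`, forget the Heegner data: the analytic part IS a `RootZeroNS` tuple, which (RV₁)Z forbids at `d = 1`.  So a proof of the v21 stub would
still close the `d = 1` branch; no work is lost by the re-key.  Orphan by design. [folklore] -/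
theorem heegnerBottomRankOnePinned_of_rootVisibleRankOneZ (h : Signdetour.RootVisibleRankOneZNS) :
    Signdetour.HeegnerBottomRankOnePinnedNS := by
  intro p _ ι W _ _ K _ _ 𝔭 𝔭bar κ γ hγF N _ f hf hN hp hgood hap hsurj hK hsplit h𝔭 hι h𝔭bar hne hHeeg hcop hh _hodd _hne3 hnsq hram _ hd1
    hac h𝔭ns γ𝔭 hγ𝔭 ΩK Ωp L hΩ hL _jbar _F _hF z B _hzF hT hB hbase _hprim hz0
  exact h W K hf hN hp hgood hap hsurj hK hsplit hHeeg hcop hh hnsq hram hd1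
    ⟨ι, 𝔭, 𝔭bar, κ, γ, hγF.out, h𝔭, hne, h𝔭ns, γ𝔭, hγ𝔭, ΩK, Ωp, L, z, B, hac, hι, h𝔭bar, hΩ, hL, hT, hB, hbase, hz0⟩

/-- conjunct (7) [v22: consumed at the core root; v23: no longer consumed there — RECORD projection, feeds `Theorems/…AdmdefHeegnerPrimitive`'s
p-primitivity certificate]: BCS25 Prop. 4.2.2 ∕ Hsieh Thm. B — a Castella-normalised BDP frame with `μ = 0` (projection of the cite stub). -/
theorem cite_mu0 : Literature.NumberTheory.EllipticCurves.BurungaleCastellaSkinner2025.prop422_exists_isBDPLFunction_mu_eq_zero :=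
  stub_namedFactsSS.2.2.2.2.2.2.1

/-- stub (Anch)_FW [v24: BY NAME = the tree constant `Theorems.SignedBaseChangeDefiniteAnchorDefs.DefiniteAnchorFW` (p773583), whose body is v23's text
`DefiniteAnchorFWNS` verbatim — certificate `definiteAnchorFWNS_iff` below] (LOAD-BEARING on β ∩ FW, every odd Selmer rank): the print-natural rank-0 anchor at
every odd Selmer-zero vertex, ON the Fouquet–Wan locus.  PREPRINT-sourced (FW21 Thm 5.1 ∕ Cor 1.10 ×2) modulo the untyped ports T1–T4.  Token (390): CONTENT. -/
theorem stub_definiteAnchorFW : Summit.BirchSwinnertonDyer.BirchSwinnertonDyer.Theorems.SignedBaseChangeDefiniteAnchorDefs.DefiniteAnchorFW := by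
  sorry

/-- stub (Anch)_¬FW = K1 [v24: BY NAME = the registered signature of the route ITEM stmt-BirchSwinnertonDyer-33118 `DefiniteAnchorNonFW` (pen bsd-ssimc-plan
g40, director (543)(a)/(567)(A2)/(572)): the tree constant `Theorems.SignedBaseChangeDefiniteAnchorDefs.DefiniteAnchorNonFW` (p773583), whose body is v23's
text `DefiniteAnchorNFWNS` verbatim — certificate `definiteAnchorNFWNS_iff` below; once the route file renders item 33118 as
`Theses.SignedBaseChange.DefiniteAnchorNonFW := <this constant>`, its closer discharges this stub by `exact` (δ)] (LOAD-BEARING on β ∖ FW, every odd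
Selmer rank): the same OFF the Fouquet–Wan locus.  UNSOURCED.  HARDEST.  Token (390): CONTENT. -/
theorem stub_definiteAnchorNFW : Summit.BirchSwinnertonDyer.BirchSwinnertonDyer.Theorems.SignedBaseChangeDefiniteAnchorDefs.DefiniteAnchorNonFW := by
  sorry

/-- **Certificate [v24]: the by-name constant IS v23's (Anch)_FW text** (`Iff.rfl`). [folklore] -/
theorem definiteAnchorFWNS_iff :
    DefiniteAnchorFWNS ↔ Summit.BirchSwinnertonDyer.BirchSwinnertonDyer.Theorems.SignedBaseChangeDefiniteAnchorDefs.DefiniteAnchorFW :=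
  Iff.rfl

/-- **Certificate [v24]: the by-name constant (= item 33118's signature) IS v23's (Anch)_¬FW text = K1** (`Iff.rfl`). [folklore] -/
theorem definiteAnchorNFWNS_iff :
    DefiniteAnchorNFWNS ↔ Summit.BirchSwinnertonDyer.BirchSwinnertonDyer.Theorems.SignedBaseChangeDefiniteAnchorDefs.DefiniteAnchorNonFW :=
  Iff.rfl

/-- (Anch)_FW in the line's own currency `DefiniteAnchorFWNS` [v24: from the by-name stub]. [folklore] -/
theorem definiteAnchorFW : DefiniteAnchorFWNS :=
  definiteAnchorFWNS_iff.mpr stub_definiteAnchorFW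

/-- (Anch)_¬FW in the line's own currency `DefiniteAnchorNFWNS` [v24: from the by-name stub = item 33118]. [folklore] -/
theorem definiteAnchorNFW : DefiniteAnchorNFWNS :=
  definiteAnchorNFWNS_iff.mpr stub_definiteAnchorNFW

/-- **(Anch) — v7's text `DefiniteAnchorNS` — DERIVED [v23] from the FW-cut pair** (`by_cases` on `Rank1Residual.Additive.FWNonsplitRam W p`).  This is the
theorem the [NV] consumer uses (through `exists_anchorLevel_of_definiteAnchor`) at EVERY odd Selmer rank. [folklore] -/
theorem definiteAnchor : DefiniteAnchorNS := by
  intro p _ W _ _ K _ _ N _ f hf hN hp hgood hap hsurj hK hsplit hHeeg hcop hh hnsq hram c hc1 _ n hodd hzero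
  by_cases hFW : Summit.BirchSwinnertonDyer.Rank1Residual.Additive.FWNonsplitRam W p
  · exact definiteAnchorFW W K hf hN hp hgood hap hsurj hK hsplit hHeeg hcop hh hnsq hram hFW c hc1 n hodd hzero
  · exact definiteAnchorNFW W K hf hN hp hgood hap hsurj hK hsplit hHeeg hcop hh hnsq hram hFW c hc1 n hodd hzero

/-- **Conservativity certificate [v20 → v21]**: the v20 text implies the Z-text. Orphan by design. [folklore] -/
theorem definiteAnchorExistsNP3FWZ_of_definiteAnchorExistsNP3FW (h : Signdetour.DefiniteAnchorExistsNP3FWNS) :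
    Signdetour.DefiniteAnchorExistsNP3FWZNS := by
  intro p _ W _ _ K _ _ N _ f hf hN hp hgood hap hsurj hK hsplit hHeeg hcop hh hnsq hram hFW hZ _ h3
  exact h W K hf hN hp hgood hap hsurj hK hsplit hHeeg hcop hh hnsq hram hFW (Signdetour.rootInvisibleNS_of_rootZeroNS hZ) h3

/-- **Conservativity certificate [v20 → v21]**: the v20 text implies the Z-text. Orphan by design. [folklore] -/
theorem definiteAnchorExistsNP3NFWZ_of_definiteAnchorExistsNP3NFW (h : Signdetour.DefiniteAnchorExistsNP3NFWNS) :
    Signdetour.DefiniteAnchorExistsNP3NFWZNS := by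
  intro p _ W _ _ K _ _ N _ f hf hN hp hgood hap hsurj hK hsplit hHeeg hcop hh hnsq hram hFW hZ _ h3
  exact h W K hf hN hp hgood hap hsurj hK hsplit hHeeg hcop hh hnsq hram hFW (Signdetour.rootInvisibleNS_of_rootZeroNS hZ) h3

/-- **Conservativity certificate [v19 → v20]**: (Anch∃)_NP,≥3 implies each half (the inserted hypothesis is discarded). Orphan by design. [folklore] -/
theorem definiteAnchorExistsNP3FW_of_definiteAnchorExistsNP3 (h : Signdetour.DefiniteAnchorExistsNP3NS) :
    Signdetour.DefiniteAnchorExistsNP3FWNS ∧ Signdetour.DefiniteAnchorExistsNP3NFWNS := by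
  refine ⟨?_, ?_⟩
  · intro p _ W _ _ K _ _ N _ f hf hN hp hgood hap hsurj hK hsplit hHeeg hcop hh hnsq hram _ hNP _ h3
    exact h W K hf hN hp hgood hap hsurj hK hsplit hHeeg hcop hh hnsq hram hNP h3
  · intro p _ W _ _ K _ _ N _ f hf hN hp hgood hap hsurj hK hsplit hHeeg hcop hh hnsq hram _ hNP _ h3
    exact h W K hf hN hp hgood hap hsurj hK hsplit hHeeg hcop hh hnsq hram hNP h3

/-- **Conservativity certificate [v18]**: v16/v17's registered text (Anch±)_NP implies v18's (Anch±)_NP,≥3 (bookkeeping; orphan by design). [folklore] -/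
theorem definiteAnchorSignedNP3_of_definiteAnchorSignedNP (h : Signdetour.DefiniteAnchorSignedNPNS) : Signdetour.DefiniteAnchorSignedNP3NS :=
  Signdetour.definiteAnchorSignedNP3NS_of_definiteAnchorSignedNPNS h

/-- **Conservativity certificate [v16 → v18]**: v9–v15's (Anch±) text implies v18's (Anch±)_NP,≥3 text (bookkeeping; orphan by design). [folklore] -/
theorem definiteAnchorSignedNP3_of_definiteAnchorSigned (h : Signdetour.DefiniteAnchorSignedNS) : Signdetour.DefiniteAnchorSignedNP3NS :=
  Signdetour.definiteAnchorSignedNP3NS_of_definiteAnchorSignedNPNS (Signdetour.definiteAnchorSignedNPNS_of_definiteAnchorSignedNS h)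

/-- **Conservativity certificate [v9 → v18]**: v7/v8's (Anch) text implies v18's (Anch±)_NP,≥3 text (bookkeeping; orphan by design). [folklore] -/
theorem definiteAnchorSignedNP3_of_definiteAnchor (h : DefiniteAnchorNS) : Signdetour.DefiniteAnchorSignedNP3NS :=
  definiteAnchorSignedNP3_of_definiteAnchorSigned (Signdetour.definiteAnchorSignedNS_of_definiteAnchorNS h)

/-- **Conservativity certificate [v18 → v19]: the vertex-wise anchor implies the existential one** — (Anch±)_NP,≥3 (unit weighted period at EVERY odd zero
vertex with both signs) ⟹ (Anch∃)_NP,≥3 (at SOME odd Zhang-admissible level), by W. Zhang's walk + the signed detour on cell β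
(`Signdetour.exists_admissibleOddLevel_of_anchorSigned_of_split`, kernel) fed by (Par) (`oddSelmerDim`, cites (12)–(13)) and complex conjugation
(`exists_conj_of_isImaginaryQuadratic`).  The v19 stub asks STRICTLY LESS than every earlier anchor text.  Orphan by design.
[cite: WZhang2014, Thm. 9.1 (proof), Lemma 7.3, §9 (9.2)] [cite: DokchitserDokchitserAnnals2010, §4.6] -/
theorem definiteAnchorExistsNP3_of_definiteAnchorSignedNP3 (h : Signdetour.DefiniteAnchorSignedNP3NS) :
    Signdetour.DefiniteAnchorExistsNP3NS := by
  intro p _ W _ _ K _ _ N _ f hf hN hp hgood hap hsurj hK hsplit hHeeg hcop hh hnsq hram hNP _ h3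
  obtain ⟨c, hc1, -⟩ := exists_conj_of_isImaginaryQuadratic (K := K) hK
  exact Signdetour.exists_admissibleOddLevel_of_anchorSigned_of_split (W := W) (K := K) (p := p) hN hp hsurj hK hHeeg hsplit hc1
    (oddSelmerDim W K hN hp hsurj hK hHeeg c hc1)
    (fun m ↦ ∃ (S : Brandt.XiSetup N m) (ψ : K →ₐ[ℚ] S.D) (I : Submodule ℤ S.D) (φ : Brandt.ClassSet S.O → ZMod p),
      Brandt.IsGrossPoint S.O ψ I ∧
      (letI : Fintype (Brandt.ClassSet S.O) := Fintype.ofFinite _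
       φ ∈ Brandt.eigenSpace (ZMod p) (N * m) (Brandt.matrix S.O) (fun ℓ ↦ W.frobeniusTrace ℓ)) ∧
      Brandt.toricPeriod S.O ψ I (fun i ↦ (Brandt.weight S.O i : ZMod p) * φ i) ≠ 0)
    (h W K hf hN hp hgood hap hsurj hK hsplit hHeeg hcop hh hnsq hram hNP c hc1 h3)

/-- **Conservativity certificate [v16 → v19]**: v16/v17's registered text (Anch±)_NP implies v19's (Anch∃)_NP,≥3 (chain of the two certificates). Orphan by design. [folklore] -/
theorem definiteAnchorExistsNP3_of_definiteAnchorSignedNP (h : Signdetour.DefiniteAnchorSignedNPNS) : Signdetour.DefiniteAnchorExistsNP3NS :=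
  definiteAnchorExistsNP3_of_definiteAnchorSignedNP3 (definiteAnchorSignedNP3_of_definiteAnchorSignedNP h)

/-! ### [v23] The v19–v22 anchor texts DERIVED from (Anch) (records + conservativity: the v23 pair implies every earlier registered anchor text) -/

/-- **(Anch∃)_NP,≥3 DERIVED [v23]** from (Anch) by W. Zhang's walk + the signed detour + (Par) (the v18 → v19 certificate applied to the v9 → v18 one). -/
theorem definiteAnchorExistsNP3 : Signdetour.DefiniteAnchorExistsNP3NS :=
  definiteAnchorExistsNP3_of_definiteAnchorSignedNP3 (definiteAnchorSignedNP3_of_definiteAnchor definiteAnchor)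

/-- **(Anch∃)_NP,≥3,FW DERIVED [v23]** (v20 registered text; the inserted FW hypothesis is discarded). -/
theorem definiteAnchorExistsNP3FW : Signdetour.DefiniteAnchorExistsNP3FWNS :=
  (definiteAnchorExistsNP3FW_of_definiteAnchorExistsNP3 definiteAnchorExistsNP3).1

/-- **(Anch∃)_NP,≥3,¬FW DERIVED [v23]** (v20 registered text). -/
theorem definiteAnchorExistsNP3NFW : Signdetour.DefiniteAnchorExistsNP3NFWNS :=
  (definiteAnchorExistsNP3FW_of_definiteAnchorExistsNP3 definiteAnchorExistsNP3).2

/-- **(Anch∃)_NP,≥3,FW,Z DERIVED [v23]** (v21–v22 registered text `stub_definiteAnchorExistsNP3FWZ`; the v20 → v21 certificate). -/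
theorem definiteAnchorExistsNP3FWZ : Signdetour.DefiniteAnchorExistsNP3FWZNS :=
  definiteAnchorExistsNP3FWZ_of_definiteAnchorExistsNP3FW definiteAnchorExistsNP3FW

/-- **(Anch∃)_NP,≥3,¬FW,Z DERIVED [v23]** (v21–v22 registered text `stub_definiteAnchorExistsNP3NFWZ`, v22's HARDEST stub; the v20 → v21 certificate). -/
theorem definiteAnchorExistsNP3NFWZ : Signdetour.DefiniteAnchorExistsNP3NFWZNS :=
  definiteAnchorExistsNP3NFWZ_of_definiteAnchorExistsNP3NFW definiteAnchorExistsNP3NFW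

/-- **THE ANCHOR LEVEL FOR THE [NV] CONSUMER, ANY ODD SELMER RANK [v23]**: on cell β, from (Anch) (v7 text, derived from the registered pair) there is an
odd Zhang-admissible level `s` carrying Brandt data with non-zero WEIGHTED toric period — W. Zhang's walk (+ the signed detour) from the bottom, of length
`dim Sel_p(E/K)[p]` (so ONE Čebotarev prime at `d = 1`), fed by (Par) (`oddSelmerDim`, cites (12)–(13)); the kernel plug
`Signdetour.exists_admissibleOddLevel_of_anchorSigned_of_split` with the (Equiv)-sign hypothesis discarded.  No (NP) hypothesis, no rank hypothesis.
[cite: WZhang2014, Thm. 9.1 (proof), Prop. 5.4, Lemma 7.3] [cite: CastellaEtAl2025, §7.4] -/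
theorem exists_anchorLevel_of_definiteAnchor (h : DefiniteAnchorNS) :
    ∀ {p : ℕ} [Fact p.Prime] (W : WeierstrassCurve ℚ) [W.IsElliptic] [W.IsGloballyMinimal]
      (K : Type) [Field K] [NumberField K] {N : ℕ} [NeZero N] {f : CuspForm (CongruenceSubgroup.Gamma0 N) 2}
      (_ : IsNewformOf W f),
      (N : ℤ) = W.conductorNorm ℤ → 5 ≤ p → W.HasGoodReductionAtPrime p → W.frobeniusTrace p = 0 →
      Surj W p →
      IsImaginaryQuadratic K → ((Ideal.span {(p : ℤ)}).primesOver (𝓞 K)).ncard = 2 →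
      (∀ ℓ : ℕ, ℓ.Prime → ℓ ∣ N → ((Ideal.span {(ℓ : ℤ)}).primesOver (𝓞 K)).ncard = 2) →
      IsCoprime (N : ℤ) (NumberField.discr K) → ¬ p ∣ NumberField.classNumber K →
      ¬ Squarefree N →
      (∀ q : ℕ, q.Prime → q ∣ N →
        ∃ v : HeightOneSpectrum (𝓞 ℚ), ((q : ℕ) : 𝓞 ℚ) ∈ v.asIdeal ∧
          ∃ 𝔓 ∈ v.primesAbove, ∃ σ ∈ 𝔓.inertia (absoluteGaloisGroup ℚ),
            ∃ P : W.geomTorsion (p : ℤ), σ • P ≠ P) →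
      ∃ s : Finset ℕ, IsZhangAdmissibleLevel N K (fun ℓ ↦ W.frobeniusTrace ℓ) p s ∧ Odd s.card ∧
        ∃ (S : Brandt.XiSetup N (∏ q ∈ s, q)) (ψ : K →ₐ[ℚ] S.D) (I : Submodule ℤ S.D) (φ : Brandt.ClassSet S.O → ZMod p),
          Brandt.IsGrossPoint S.O ψ I ∧
          (letI : Fintype (Brandt.ClassSet S.O) := Fintype.ofFinite _
           φ ∈ Brandt.eigenSpace (ZMod p) (N * ∏ q ∈ s, q) (Brandt.matrix S.O) (fun ℓ ↦ W.frobeniusTrace ℓ)) ∧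
          Brandt.toricPeriod S.O ψ I (fun i ↦ (Brandt.weight S.O i : ZMod p) * φ i) ≠ 0 := by
  intro p _ W _ _ K _ _ N _ f hf hN hp hgood hap hsurj hK hsplit hHeeg hcop hh hnsq hram
  obtain ⟨c, hc1, -⟩ := exists_conj_of_isImaginaryQuadratic (K := K) hK
  letI : Module (ZMod p) (AdditiveKoly.Vp W K p) := AddCommGroup.zmodModule (Signdetour.p_nsmul_vp_eq_zero' W K)
  exact Signdetour.exists_admissibleOddLevel_of_anchorSigned_of_split (W := W) (K := K) (p := p) hN hp hsurj hK hHeeg hsplit hc1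
    (oddSelmerDim W K hN hp hsurj hK hHeeg c hc1)
    (fun m ↦ ∃ (S : Brandt.XiSetup N m) (ψ : K →ₐ[ℚ] S.D) (I : Submodule ℤ S.D) (φ : Brandt.ClassSet S.O → ZMod p),
      Brandt.IsGrossPoint S.O ψ I ∧
      (letI : Fintype (Brandt.ClassSet S.O) := Fintype.ofFinite _
       φ ∈ Brandt.eigenSpace (ZMod p) (N * m) (Brandt.matrix S.O) (fun ℓ ↦ W.frobeniusTrace ℓ)) ∧
      Brandt.toricPeriod S.O ψ I (fun i ↦ (Brandt.weight S.O i : ZMod p) * φ i) ≠ 0)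
    (fun n hodd _ hzero ↦ h W K hf hN hp hgood hap hsurj hK hsplit hHeeg hcop hh hnsq hram c hc1 n hodd hzero)

/-! [v22 trim] v18's RECOVERY certificate `definiteAnchorSignedNP_of_rankSplit` ((RV₁) ∧ (Anch±)_NP,≥3 ⟹ (Anch±)_NP) is deleted with its source text
(landed form: `Theorems/…AdmdefRankSplitRecovery`, p754256). -/

/-! ## v22 kernel: [NV]♯ DERIVED from the BRIDGE WITH ITS HEEGNER PINNING (cite (16)) + MULT1 (cite (15)) + (Par) + μ = 0 (cite (7)) + (RV₁)H + (Anch∃)_NP,≥3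
through the ROOT DICHOTOMY and the SELMER-RANK SPLIT -/

/-- **[NV]♯ on the whole cell β from the BRIDGE (cites (16)+(15)) and (Anch) [v23].**  For every non-split datum at `𝔭`: cite (16) (`specP0P1`) gives the
frame `(Ω_K, Ω_p, L)`, the class `z ∈ 𝒮_+` with its transfer inputs, the `+` system `B` with base class `z`, and the dictionary; MULT1 (cite (15),
`specMult1`) turns the dictionary into clause (b): Brandt data with non-zero WEIGHTED toric period at an odd admissible level `s` ⟹ `λ⁺_1(∏s)(0) ∈ ℤ_pˣ`.
The ROOT DICHOTOMY wrapper (`…AdmdefRootDichotomy.hasUnitLambda_of_rootDichotomy`, kernel) asks for such data only when no admissible Frobenius sees `z_{0,1}`;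
the data are supplied at EVERY odd Selmer rank by `exists_anchorLevel_of_definiteAnchor` (W. Zhang's walk from the bottom + (Anch), derived from the
registered FW-cut pair) — at `d = 1` the walk has length one (a single Čebotarev prime; Kolyvagin's conjecture is NOT invoked).  Binder-free in the
discriminant (v21 shape; v22's Disc threading through cite (7) is no longer needed).  [cite: CastellaEtAl2025, Thm. 7.4, (7.1)–(7.2), Thm. 7.5, §7.4 (arXiv:2308.10474v2 pp. 30–33)]
[cite: WZhang2014, §5 (5.1), Prop. 5.4, Thm. 9.1, Lemma 7.3] [cite: Howard2006, Thm. 3.2.3 (c)] -/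
theorem bipartiteNV_of_rootDichotomy {p : ℕ} [Fact p.Prime] (ι : PadicAlgCl p ≃+* ℂ) (W : WeierstrassCurve ℚ) [W.IsElliptic]
    [W.IsGloballyMinimal] (K : Type) [Field K] [NumberField K]
    (𝔭 𝔭bar : HeightOneSpectrum (𝓞 K)) (κ : ZpExtension K p) (γ : absoluteGaloisGroup K)
    [hγF : Fact (κ.IsTopGenerator γ)] {N : ℕ} [NeZero N] {f : CuspForm (CongruenceSubgroup.Gamma0 N) 2}
    (hf : IsNewformOf W f)
    (hN : (N : ℤ) = W.conductorNorm ℤ) (hp : 5 ≤ p) (hgood : W.HasGoodReductionAtPrime p) (hap : W.frobeniusTrace p = 0)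
    (hsurj : Surj W p) (hK : IsImaginaryQuadratic K) (hsplit : ((Ideal.span {(p : ℤ)}).primesOver (𝓞 K)).ncard = 2)
    (h𝔭 : ((p : ℕ) : 𝓞 K) ∈ 𝔭.asIdeal)
    (hι : ∀ (w : InfinitePlace K) (k : 𝓞 K), k ∈ 𝔭.asIdeal ↔ ‖ι.symm (w.embedding (k : K))‖ < 1)
    (h𝔭bar : ((p : ℕ) : 𝓞 K) ∈ 𝔭bar.asIdeal) (hne : 𝔭bar ≠ 𝔭)
    (hHeeg : ∀ ℓ : ℕ, ℓ.Prime → ℓ ∣ N → ((Ideal.span {(ℓ : ℤ)}).primesOver (𝓞 K)).ncard = 2)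
    (hcop : IsCoprime (N : ℤ) (NumberField.discr K)) (hh : ¬ p ∣ NumberField.classNumber K)
    (hnsq : ¬ Squarefree N)
    (hram : ∀ q : ℕ, q.Prime → q ∣ N →
      ∃ v : HeightOneSpectrum (𝓞 ℚ), ((q : ℕ) : 𝓞 ℚ) ∈ v.asIdeal ∧
        ∃ 𝔓 ∈ v.primesAbove, ∃ σ ∈ 𝔓.inertia (absoluteGaloisGroup ℚ),
          ∃ P : W.geomTorsion (p : ℤ), σ • P ≠ P)
    (hac : κ.IsAnticyclotomic) (h𝔭ns : AcSigned.IsNonsplitIn κ 𝔭) (γ𝔭 : absoluteGaloisGroup (𝔭.adicCompletion K))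
    (hγ𝔭 : κ (resGalOfEmb (closureEmb (K := K) (𝔭.adicCompletion K)) γ𝔭) = κ γ) :
    ∃ (ΩK : ℂ) (Ωp : (unrIntegers p)ˣ) (L : UnrSeries p), ΩK ≠ 0 ∧
      IsCWBDPLFunction ι 𝔭 κ γ f (NumberField.discr K) ΩK ((Ωp : unrIntegers p) : ℂ_[p]) L ∧
      ∃ (z : AcSigned.selmerLambdaAdic (W.baseChange K) p κ γ (fun _ ↦ .sgn 1))
        (B : CastellaHsuKunduLeeLiu2025.SignedBipartiteSystem W K p κ),
        AcSigned.TransferInputs (W.baseChange K) p κ γ hγF.out 𝔭 h𝔭ns γ𝔭 hγ𝔭 𝔭bar (fun h ↦ hne h.symm) h𝔭 1 z L ∧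
        CastellaHsuKunduLeeLiu2025.IsSignedBipartiteSystem W K p κ γ N 1 B ∧ B.IsLimitBaseClass z.1 ∧ B.HasUnitLambda N := by
  have hprime : p.Prime := Fact.out
  have hp2 : p ≠ 2 := by omega
  -- the bridge WITH its Heegner pinning: cite conjunct (16) = `specP0P1` (as in `bridge_of_spec`, keeping `F` and `hzF`)
  have hS : AcSigned.Setting W K p κ 𝔭 𝔭bar :=
    { isElliptic := ‹_›
      p_ne_two := hp2
      goodSS := ⟨hgood, by rw [hap]; exact dvd_zero _⟩
      frobeniusTrace_eq_zero := hap
      isImaginaryQuadratic := hK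
      mem := h𝔭
      mem' := h𝔭bar
      ne := hne
      anticyclotomic := hac
      not_dvd_classNumber := hh }
  have hN' : (W.conductorNorm ℤ : ℕ) = N := by exact_mod_cast hN.symm
  have hHg : SatisfiesHeegnerHypothesis N K := fun ℓ hℓ hℓN ↦ hHeeg ℓ hℓ hℓN
  obtain ⟨ΩK, Ωp, L, hΩ, hBDP, jbar, F, hF, hsign⟩ :=
    specP0P1 N W K p κ 𝔭 𝔭bar hS ι hf hN' hHg hcop hp hsurj hι γ hγF.out h𝔭ns γ𝔭 hγ𝔭
  obtain ⟨z, B, hB, hbase, hzF, hT, hdict⟩ := hsign 1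
  -- clause (b): unit weighted toric period at an odd admissible level ⟹ unit `λ⁺_1` there (dictionary + MULT1, as in `bridge_of_spec`)
  have hbridge : ∀ s : Finset ℕ, IsZhangAdmissibleLevel N K (fun ℓ ↦ W.frobeniusTrace ℓ) p s → Odd s.card →
      (∃ (S : Brandt.XiSetup N (∏ q ∈ s, q)) (ψ : K →ₐ[ℚ] S.D) (I : Submodule ℤ S.D) (φ : Brandt.ClassSet S.O → ZMod p),
          Brandt.IsGrossPoint S.O ψ I ∧
          (letI : Fintype (Brandt.ClassSet S.O) := Fintype.ofFinite _
           φ ∈ Brandt.eigenSpace (ZMod p) (N * ∏ q ∈ s, q) (Brandt.matrix S.O) (fun ℓ ↦ W.frobeniusTrace ℓ)) ∧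
          Brandt.toricPeriod S.O ψ I (fun i ↦ (Brandt.weight S.O i : ZMod p) * φ i) ≠ 0) →
      IsUnit (PowerSeries.constantCoeff (B.lam 1 (∏ q ∈ s, q))) := by
    rintro s hs hsodd ⟨S, ψ, I, φ, hG, hφ, hper⟩
    have hm : (∏ q ∈ s, q) ∈ CastellaHsuKunduLeeLiu2025.defProducts N K (fun ℓ ↦ W.frobeniusTrace ℓ) p 1 :=
      SignedBaseChangeAcDivAdmdefBipartiteNVLevelOne.prod_mem_defProducts_one hs hsodd
    obtain ⟨φg, hφg0, hφg, hiff⟩ := hdict (∏ q ∈ s, q) hm S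
    have hφ0 : φ ≠ 0 := by
      rintro rfl
      exact hper (by rw [weight_mul_zero']; exact toricPeriod_zero' S.O ψ I)
    obtain ⟨c, hc⟩ := specMult1 N W K p hN hp hgood hsurj hK hHeeg hram (∏ q ∈ s, q) hm S φg φ hφg hφ hφg0
    have hPg : Brandt.toricPeriod S.O ψ I (fun i ↦ (Brandt.weight S.O i : ZMod p) * φg i) ≠ 0 := by
      intro h0
      apply hper
      rw [hc, weight_mul_smul', toricPeriod_smul', h0, smul_zero]
    exact (hiff ψ I hG).mpr hPg
  refine ⟨ΩK, Ωp, L, hΩ, hBDP, z, B, hT, hB, hbase, ?_⟩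
  refine SignedBaseChangeAcDivAdmdefRootDichotomy.hasUnitLambda_of_rootDichotomy hB hbase
    (fun m ↦ ∃ (S : Brandt.XiSetup N m) (ψ : K →ₐ[ℚ] S.D) (I : Submodule ℤ S.D) (φ : Brandt.ClassSet S.O → ZMod p),
      Brandt.IsGrossPoint S.O ψ I ∧
      (letI : Fintype (Brandt.ClassSet S.O) := Fintype.ofFinite _
       φ ∈ Brandt.eigenSpace (ZMod p) (N * m) (Brandt.matrix S.O) (fun ℓ ↦ W.frobeniusTrace ℓ)) ∧
      Brandt.toricPeriod S.O ψ I (fun i ↦ (Brandt.weight S.O i : ZMod p) * φ i) ≠ 0)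
    hbridge fun _ ↦ ?_
  -- [v23] at EVERY odd Selmer rank: the walk from the bottom (length `dim Sel_p(E/K)[p]`, ONE Čebotarev prime at `d = 1`) reaches an odd zero vertex,
  -- where (Anch) (derived from the registered FW-cut pair) supplies the Brandt data — no root dichotomy case analysis, no rank split, no (RV₁)
  exact exists_anchorLevel_of_definiteAnchor definiteAnchor W K hf hN hp hgood hap hsurj hK hsplit hHeeg hcop hh hnsq hram

/-! ## [v17] The ROOT DICHOTOMY on cell γ′ (`Theorems/…AdmdefUnramRootDichotomy.lean`, LEAD g21, p750685, imported [v17.1]): pointwise frame glue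
(cell-free) `exists_pow_mul_mem_span_of_cwPoint`, «C⁺⁺ at a point off (NP)» from five cites (cell-free) `cwPoint_of_facts_of_not_rootInvisible`, and the γ′ text DERIVED -/

/-- **(γ′)_NP — THE v17 REGISTERED TEXT of `stub_unramPlusRatNP`: «C⁺⁺ on cell γ′, asked ONLY on the non-primitive locus (NP)».**  Binders: those of the
β texts in the anticyclotomic currency (`p ≥ 5` good, `a_p = 0`, `ρ̄` onto, `K` imaginary quadratic, `p` split, embedding datum `ι` inducing `𝔭`, every
`ℓ ∣ N` split, `(N, D_K) = 1`, `p ∤ h_K`) with the β line REPLACED by the γ′ line «NOT every `q ∣ N` has an inertia element moving a `p`-torsion point»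
(some `q ∣ N` — necessarily multiplicative, `p ∣ ord_q(Δ)` — with `E[p]` unramified; bsd-idea-14's primkoly locus), `κ` anticyclotomic, and the
NON-PRIMITIVE hypothesis `Signdetour.RootInvisibleNS W K p N f` (some pinned `+` tuple has bottom class invisible at every admissible Frobenius).
Conclusion = CHKLL25 Thm 7.1 / Cor 7.2's shape (= `CHKLLPlusRatNS`'s): a Castella–Wan BDP frame `(Ω_K ≠ 0, Ω_p, L)` with `∀ j, ∃ k,
(p^k)·Ch_Λ(X_ac)·R₀⟦T⟧ ⊆ (L)`.  OFF (NP) the same conclusion is KERNEL modulo the cites (2), (9), (10), (11), (16) (`…AdmdefUnramRootDichotomy.cwPoint_of_facts_of_not_rootInvisible`),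
and the v1–v16 γ′ stub text is DERIVED from the two (`bdpLowerHalfRatSS_unram`).  RESEARCH, no print (CHKLL25 (ii), BCK21, Howard 2004 all require
ramification at `q ∣ N⁺`); HONEST CAVEAT: where the unramified `q ∥ N` is SPLIT multiplicative, `p ∣ c_q` and Jetchev 2008 Thm 1.4 (`c_q ∣` Heegner index)
make (NP) automatic — there this text is ALL of γ′ (the `+` system is imprimitive); the cut is real where every unramified bad prime is non-split
(`a_q = −1`, `c_q ∈ {1, 2}`).  Token (390): CONTENT. [cite: CastellaEtAl2025, Thm. 7.1, Cor. 7.2, §7.4] [cite: Jetchev2008, Thm. 1.4 (arXiv:math/0703431 p. 3)]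
[cite: Sweeting2020, Thm. 1.1] [cite: BurungaleCastellaKim2021, Lem. 3.6] -/
@[conjecture] def UnramPlusRatNPNS : Prop :=
  ∀ {p : ℕ} [Fact p.Prime] (ι : PadicAlgCl p ≃+* ℂ) (W : WeierstrassCurve ℚ) [W.IsElliptic]
      [W.IsGloballyMinimal] (K : Type) [Field K] [NumberField K]
      (𝔭 𝔭bar : HeightOneSpectrum (𝓞 K)) (κ : ZpExtension K p) (γ : absoluteGaloisGroup K)
      [Fact (κ.IsTopGenerator γ)] {N : ℕ} [NeZero N] {f : CuspForm (CongruenceSubgroup.Gamma0 N) 2}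
      (_ : IsNewformOf W f),
      (N : ℤ) = W.conductorNorm ℤ → 5 ≤ p → W.HasGoodReductionAtPrime p → W.frobeniusTrace p = 0 →
      Surj W p →
      IsImaginaryQuadratic K → ((Ideal.span {(p : ℤ)}).primesOver (𝓞 K)).ncard = 2 →
        ((p : ℕ) : 𝓞 K) ∈ 𝔭.asIdeal →
        (∀ (w : InfinitePlace K) (k : 𝓞 K), k ∈ 𝔭.asIdeal ↔ ‖ι.symm (w.embedding (k : K))‖ < 1) →
        ((p : ℕ) : 𝓞 K) ∈ 𝔭bar.asIdeal → 𝔭bar ≠ 𝔭 →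
      (∀ ℓ : ℕ, ℓ.Prime → ℓ ∣ N → ((Ideal.span {(ℓ : ℤ)}).primesOver (𝓞 K)).ncard = 2) →
      IsCoprime (N : ℤ) (NumberField.discr K) → ¬ p ∣ NumberField.classNumber K →
      -- cell γ′: NOT every `q ∣ N` has an inertia element moving a `p`-torsion point (some `q ∣ N` with `E[p]` unramified)
      ¬ (∀ q : ℕ, q.Prime → q ∣ N →
        ∃ v : HeightOneSpectrum (𝓞 ℚ), ((q : ℕ) : 𝓞 ℚ) ∈ v.asIdeal ∧
          ∃ 𝔓 ∈ v.primesAbove, ∃ σ ∈ 𝔓.inertia (absoluteGaloisGroup ℚ),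
            ∃ P : W.geomTorsion (p : ℤ), σ • P ≠ P) →
      κ.IsAnticyclotomic →
      -- (NP): the NON-PRIMITIVE locus — some pinned `+` tuple has bottom class invisible at every admissible Frobenius
      Signdetour.RootInvisibleNS W K p N f →
      ∃ (ΩK : ℂ) (Ωp : (unrIntegers p)ˣ) (L : UnrSeries p),
        ΩK ≠ 0 ∧
        IsCWBDPLFunction ι 𝔭 κ γ f (NumberField.discr K) ΩK ((Ωp : unrIntegers p) : ℂ_[p]) L ∧
        ∀ (j : ℤ_[p] →+* unrIntegers p),
          (∀ x : ℤ_[p], ((j x : unrIntegers p) : ℂ_[p]) = algebraMap ℚ_[p] ℂ_[p] (x : ℚ_[p])) →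
          ∃ k : ℕ,
            Ideal.span {PowerSeries.C ((p : unrIntegers p) ^ k)} *
                (Castella2018.AcSelmer.XAc.charIdeal (W.baseChange K) p κ 𝔭bar ∅ γ).map (PowerSeries.map j) ≤
              Ideal.span {L}

/-- **(γ′)_NP,Z [v21] — THE REGISTERED TEXT of `stub_unramPlusRatNPZ`**: (γ′)_NP with `Signdetour.RootInvisibleNS` RE-KEYED to `Signdetour.RootZeroNS`
(«some pinned `+` tuple has `z_{0,1} = 0`»).  KERNEL-EQUIVALENT to the v17 text (`unramPlusRatNP` ∕ `unramPlusRatNPZ_of_unramPlusRatNP`).  Research, no print;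
the Jetchev caveat on γ′_split stands.  [cite: CastellaEtAl2025, Thm. 7.1, Cor. 7.2, §7.4] [cite: Jetchev2008, Thm. 1.4 (arXiv:math/0703431 p. 3)] -/
@[conjecture] def UnramPlusRatNPZNS : Prop :=
  ∀ {p : ℕ} [Fact p.Prime] (ι : PadicAlgCl p ≃+* ℂ) (W : WeierstrassCurve ℚ) [W.IsElliptic]
      [W.IsGloballyMinimal] (K : Type) [Field K] [NumberField K]
      (𝔭 𝔭bar : HeightOneSpectrum (𝓞 K)) (κ : ZpExtension K p) (γ : absoluteGaloisGroup K)
      [Fact (κ.IsTopGenerator γ)] {N : ℕ} [NeZero N] {f : CuspForm (CongruenceSubgroup.Gamma0 N) 2}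
      (_ : IsNewformOf W f),
      (N : ℤ) = W.conductorNorm ℤ → 5 ≤ p → W.HasGoodReductionAtPrime p → W.frobeniusTrace p = 0 →
      Surj W p →
      IsImaginaryQuadratic K → ((Ideal.span {(p : ℤ)}).primesOver (𝓞 K)).ncard = 2 →
        ((p : ℕ) : 𝓞 K) ∈ 𝔭.asIdeal →
        (∀ (w : InfinitePlace K) (k : 𝓞 K), k ∈ 𝔭.asIdeal ↔ ‖ι.symm (w.embedding (k : K))‖ < 1) →
        ((p : ℕ) : 𝓞 K) ∈ 𝔭bar.asIdeal → 𝔭bar ≠ 𝔭 →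
      (∀ ℓ : ℕ, ℓ.Prime → ℓ ∣ N → ((Ideal.span {(ℓ : ℤ)}).primesOver (𝓞 K)).ncard = 2) →
      IsCoprime (N : ℤ) (NumberField.discr K) → ¬ p ∣ NumberField.classNumber K →
      -- cell γ′: NOT every `q ∣ N` has an inertia element moving a `p`-torsion point (some `q ∣ N` with `E[p]` unramified)
      ¬ (∀ q : ℕ, q.Prime → q ∣ N →
        ∃ v : HeightOneSpectrum (𝓞 ℚ), ((q : ℕ) : 𝓞 ℚ) ∈ v.asIdeal ∧
          ∃ 𝔓 ∈ v.primesAbove, ∃ σ ∈ 𝔓.inertia (absoluteGaloisGroup ℚ),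
            ∃ P : W.geomTorsion (p : ℤ), σ • P ≠ P) →
      κ.IsAnticyclotomic →
      -- (NP): the NON-PRIMITIVE locus — some pinned `+` tuple has bottom class invisible at every admissible Frobenius
      Signdetour.RootZeroNS W K p N f →
      ∃ (ΩK : ℂ) (Ωp : (unrIntegers p)ˣ) (L : UnrSeries p),
        ΩK ≠ 0 ∧
        IsCWBDPLFunction ι 𝔭 κ γ f (NumberField.discr K) ΩK ((Ωp : unrIntegers p) : ℂ_[p]) L ∧
        ∀ (j : ℤ_[p] →+* unrIntegers p),
          (∀ x : ℤ_[p], ((j x : unrIntegers p) : ℂ_[p]) = algebraMap ℚ_[p] ℂ_[p] (x : ℚ_[p])) →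
          ∃ k : ℕ,
            Ideal.span {PowerSeries.C ((p : unrIntegers p) ^ k)} *
                (Castella2018.AcSelmer.XAc.charIdeal (W.baseChange K) p κ 𝔭bar ∅ γ).map (PowerSeries.map j) ≤
              Ideal.span {L}

/-- stub (γ′)_NP,Z [v21 text `UnramPlusRatNPZNS`] (RESEARCH; = «C⁺⁺ on cell γ′ ∩ (NP)Z»): the Z re-key of the v17–v20 stub (KERNEL-EQUIVALENT: `unramPlusRatNP`,
`unramPlusRatNPZ_of_unramPlusRatNP`).  Token (390): CONTENT. -/
theorem stub_unramPlusRatNPZ : UnramPlusRatNPZNS := by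
  sorry

/-- **(γ′)_NP DERIVED [v21]** (was the registered stub `stub_unramPlusRatNP`, v17–v20; text `UnramPlusRatNPNS` unchanged): from the Z-text by the KERNEL
Čebotarev half of (NP) (`Signdetour.rootZeroNS_of_rootInvisibleNS`). [cite: WZhang2014, Lemma 7.3] -/
theorem unramPlusRatNP : UnramPlusRatNPNS := by
  intro p _ ι W _ _ K _ _ 𝔭 𝔭bar κ γ _ N _ f hf hN hp hgood ha0 hs hK hsplit hv hι hvbar hvv hHeeg hcop hh hram hκ hNP
  exact stub_unramPlusRatNPZ ι W K 𝔭 𝔭bar κ γ hf hN hp hgood ha0 hs hK hsplit hv hι hvbar hvv hHeeg hcop hh hram hκ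
    (Signdetour.rootZeroNS_of_rootInvisibleNS hN hp hs hK hsplit hHeeg hNP)

/-- **Conservativity certificate [v20 → v21]**: the v17 text implies the Z-text. Orphan by design. [folklore] -/
theorem unramPlusRatNPZ_of_unramPlusRatNP (h : UnramPlusRatNPNS) : UnramPlusRatNPZNS := by
  intro p _ ι W _ _ K _ _ 𝔭 𝔭bar κ γ _ N _ f hf hN hp hgood ha0 hs hK hsplit hv hι hvbar hvv hHeeg hcop hh hram hκ hZ
  exact h ι W K 𝔭 𝔭bar κ γ hf hN hp hgood ha0 hs hK hsplit hv hι hvbar hvv hHeeg hcop hh hram hκ (Signdetour.rootInvisibleNS_of_rootZeroNS hZ)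

/-- **γ′ DERIVED [v17]** (was the registered stub `stub_bdpLowerHalfRatSS_unram`, v1–v16; the RESEARCH residue is now `stub_unramPlusRatNP` = γ′ ∩ (NP)): the LEAD's S1-rat-mult text (`Bdpline.stub_bdpLowerHalfRatSS_mult` v37)
with its cell binder `¬ (Squarefree N ∧ every q ∣ N has an inertia element moving a p-torsion point)` REPLACED by
`¬ (every q ∣ N has an inertia element moving a p-torsion point)` — i.e. SOME `q ∣ N` at which `E[p]` is unramified
(necessarily a MULTIPLICATIVE `q ∥ N` — additive primes are ramified for `p ≥ 3`, PROVED below as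
`exists_inertia_smul_geomTorsion_ne_of_sq_dvd_conductorNorm` — with `p ∣ ord_q(Δ_E)` (Tate curve, DDT Prop. 2.12 (c); this last
dictionary step is NOT typed here): cell γ of `PrimkolyCells.lean`).  Its third binder `¬ all-additive` is therefore REDUNDANT given
`¬ all-ramified` (`allRamified_of_allAdditive`, PROVED) and is kept only so that the text stays a literal weakening of the LEAD's stub
(one more usable hypothesis, otherwise byte-identical).  This is EXACTLY the live locus of bsd-idea-14's
line `Lines/primkoly.lean` (P-wise non-triviality of the Heegner Kolyvagin system paying the Tamagawa defect `c_q ≡ 0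
(mod p)` by `μ(L_p^BDP) = 0`); cited, not re-derived (non-overlap rider).  No print: CHKLL25 (ii), BCK21 Lem. 3.6 and
Howard 2004 3.2.3 all REQUIRE ramification at `q ∣ N⁺` (it is consumed for `t_q(A_g/K) = 0`, CHKLL §7.4 p. 33).
[cite: CastellaEtAl2025, §7.4 p. 33] [cite: Sweeting2020, Thm. 1.1] [cite: DarmonDiamondTaylor1995, Prop. 2.12 (c)]
[v17]: by cases on (NP) at the point — (NP) ⟹ `stub_unramPlusRatNP`; ¬(NP) ⟹ `…AdmdefUnramRootDichotomy.cwPoint_of_facts_of_not_rootInvisible` (cites (2), (9), (10), (11), (16));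
then the pointwise frame glue `…AdmdefUnramRootDichotomy.exists_pow_mul_mem_span_of_cwPoint`. -/
theorem bdpLowerHalfRatSS_unram :
    SignedTwoVariableInputs → Literature.NumberTheory.EllipticCurves.ModularForms.nonempty_modularParametrizationData → ∀ (W : WeierstrassCurve ℚ) [W.IsElliptic] [W.IsGloballyMinimal] (p : ℕ) [Fact p.Prime], 5 ≤ p → W.HasGoodReductionAtPrime p → W.frobeniusTrace p = 0 → Literature.NumberTheory.EllipticCurves.Rank1Residual.Surj W p → ∀ (K : Type) [Field K] [NumberField K] (ι : PadicAlgCl p ≃+* ℂ) (v vbar : IsDedekindDomain.HeightOneSpectrum (NumberField.RingOfIntegers K)) (κ₁ κ₂ : Literature.NumberTheory.EllipticCurves.ZpExtension K p) (γ₁ γ₂ : Field.absoluteGaloisGroup K) [Fact (Literature.NumberTheory.EllipticCurves.ZpExtension.IsTopGeneratorPair κ₁ κ₂ γ₁ γ₂)] [NeZero (NumberField.discr K).natAbs] (N : ℕ) [NeZero N] (f : CuspForm (CongruenceSubgroup.Gamma0 N) 2), Literature.NumberTheory.EllipticCurves.ModularForms.IsNewformOf W f → (N : ℤ) = W.conductorNorm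 ℤ → Literature.NumberTheory.EllipticCurves.IsImaginaryQuadratic K → ¬ p ∣ NumberField.classNumber K → ¬ (∀ q : ℕ, q.Prime → q ∣ N → ∃ v' : IsDedekindDomain.HeightOneSpectrum (NumberField.RingOfIntegers ℚ), ((q : ℕ) : NumberField.RingOfIntegers ℚ) ∈ v'.asIdeal ∧ ∃ 𝔓 ∈ v'.primesAbove, ∃ σ ∈ 𝔓.inertia (Field.absoluteGaloisGroup ℚ), ∃ P : W.geomTorsion (p : ℤ), σ • P ≠ P) → ¬ (∀ ℓ : ℕ, ℓ.Prime → ℓ ∣ N → ℓ ^ 2 ∣ N) → ((Ideal.span {(p : ℤ)}).primesOver (NumberField.RingOfIntegers K)).ncard = 2 → ((p : ℕ) : NumberField.RingOfIntegers K) ∈ v.asIdeal → ((p : ℕ) : NumberField.RingOfIntegers K) ∈ vbar.asIdeal → vbar ≠ v → (∀ (w : NumberField.InfinitePlace K) (k : NumberField.RingOfIntegers K), k ∈ v.asIdeal ↔ ‖ι.symm (w.embedding (k : K))‖ < 1) → IsCoprime (N : ℤ) (NumberField.discr K) → (∀ ℓ : ℕ, ℓ.Prime → ℓ ∣ N → ((Ideal.span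 {(ℓ : ℤ)}).primesOver (NumberField.RingOfIntegers K)).ncard = 2) → Odd (NumberField.discr K) → NumberField.discr K ≠ -3 → κ₁.IsCyclotomic → κ₂.IsAnticyclotomic → (haveI : Fact (κ₂.IsTopGenerator γ₂) := ⟨Literature.NumberTheory.EllipticCurves.YanZhu2026.isTopGenerator_of_pair (κ₁ := κ₁) (γ₁ := γ₁)⟩; Module.IsTorsion (Literature.NumberTheory.EllipticCurves.IwasawaAlgebra p) (Literature.NumberTheory.EllipticCurves.Castella2018.AcSelmer.XAc (W.baseChange K) p κ₂ vbar ∅ γ₂)) → ∀ (ΩK : ℂ) (Ωp' : (Literature.NumberTheory.EllipticCurves.unrIntegers p)ˣ) (L : Literature.NumberTheory.EllipticCurves.UnrSeries p), ΩK ≠ 0 → Literature.NumberTheory.EllipticCurves.IsBDPLFunction ι v κ₂ γ₂ f ΩK ((Ωp' : Literature.NumberTheory.EllipticCurves.unrIntegers p) : PadicComplex p) L → ∀ J : ℤ_[p] →+* PadicComplexInt p, (∀ x : ℤ_[p], ((J x : PadicComplexInt p) : PadicComplex p) = ((x : ℚ_[p]) : PadicComplex p)) → ∀ (J₀ : Literature.NumberTheory.EllipticCurves.unrIntegers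 p →+* PadicComplexInt p), (∀ x : Literature.NumberTheory.EllipticCurves.unrIntegers p, ((J₀ x : PadicComplexInt p) : PadicComplex p) = (x : PadicComplex p)) → ∃ k : ℕ, ∀ y ∈ (haveI : Fact (κ₂.IsTopGenerator γ₂) := ⟨Literature.NumberTheory.EllipticCurves.YanZhu2026.isTopGenerator_of_pair (κ₁ := κ₁) (γ₁ := γ₁)⟩; Literature.NumberTheory.EllipticCurves.Castella2018.AcSelmer.XAc.charIdeal (W.baseChange K) p κ₂ vbar ∅ γ₂).map (PowerSeries.map J), PowerSeries.C (((p : ℕ) : PadicComplexInt p) ^ k) * y ∈ Ideal.span {PowerSeries.map J₀ L} := by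
  intro hIn hmodP W _ _ p _ hp hgood ha0 hs K _ _ ι v vbar κ₁ κ₂ γ₁ γ₂ _ _ N _ f hf hN hK hh hram hsq hsplit hv hvbar hvv hι hcop
    hHeeg hodd hne3 hκ₁ hκ₂ htors ΩK Ωp' L hΩK hL J hJ J₀ hJ₀
  haveI hγF : Fact (κ₂.IsTopGenerator γ₂) := ⟨isTopGenerator_of_pair (κ₁ := κ₁) (γ₁ := γ₁)⟩
  refine SignedBaseChangeAcDivAdmdefUnramRootDichotomy.exists_pow_mul_mem_span_of_cwPoint ι W K v vbar κ₂ γ₂ hN hp hgood hK hsplit hκ₂ ?_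
    ΩK Ωp' L hΩK hL J hJ J₀ hJ₀
  by_cases hNP : Signdetour.RootInvisibleNS W K p N f
  · exact unramPlusRatNP ι W K v vbar κ₂ γ₂ hf hN hp hgood ha0 hs hK hsplit hv hι hvbar hvv hHeeg hcop hh hram hκ₂ hNP
  · exact SignedBaseChangeAcDivAdmdefUnramRootDichotomy.cwPoint_of_facts_of_not_rootInvisible stub_namedFactsSS.2.1 cite_cw67 cite_cwRel
      cite_chkll75 cite_p0p1 ι W K v vbar κ₂ γ₂ hf hN
      hp hgood ha0 hs hK hv hι hvbar hvv hHeeg hcop hh hκ₂ hNP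


/-! ## §Glue: `Theorems/…AdmdefBipartiteNVGlue.lean` (p730514, imported): C⁺⁺_NS AT A POINT ⟸ [NV]♯ + LV19 1.4 + CW24 6.7 + CW24 rel≤sgn + CHKLL25 7.5 -/

/-! ## [v22] C⁺⁺_NS with the discriminant binders, DERIVED (v4's β′/β″ texts and v3's binder-free `CHKLLPlusRatNS` stay as RECORDS) -/

/-- **`CHKLLPlusRatNSDisc` DERIVED [v22; v23: binders discarded]** from the [NV] consumer `bipartiteNV_of_rootDichotomy` + conjuncts (2), (9), (10), (11) of the cite stub, by §Glue
(`Theorems/…AdmdefBipartiteNVGlue.exists_isCWBDPLFunction_charIdeal_map_le_of_bipartiteNV`, p730514). -/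
theorem chkllPlusRatNSDisc_of_rootDichotomy : CHKLLPlusRatNSDisc := by
  intro p _ ι W _ _ K _ _ 𝔭 𝔭bar κ γ _ N _ f hf hN hp hgood hap hsurj hK hsplit h𝔭 hι h𝔭bar hne hHeeg hcop hh _ _ hnsq hram hac
  exact SignedBaseChangeAcDivAdmdefBipartiteNVGlue.exists_isCWBDPLFunction_charIdeal_map_le_of_bipartiteNV stub_namedFactsSS.2.1
    cite_cw67 cite_cwRel cite_chkll75 ι W K 𝔭 𝔭bar κ γ
    hf hN hp hgood hap hsurj hK h𝔭 hι h𝔭bar hne hHeeg hcop hh hac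
    (bipartiteNV_of_rootDichotomy ι W K 𝔭 𝔭bar κ γ hf hN hp hgood hap hsurj hK hsplit h𝔭 hι h𝔭bar hne hHeeg hcop hh hnsq hram hac)

/-- **`CHKLLPlusRatNS` (v3's binder-free registered research text) DERIVED AGAIN [v23]** (v22 had lost it to the Disc threading): the [NV] consumer + §Glue. -/
theorem chkllPlusRatNS_of_rootDichotomy : CHKLLPlusRatNS := by
  intro p _ ι W _ _ K _ _ 𝔭 𝔭bar κ γ _ N _ f hf hN hp hgood hap hsurj hK hsplit h𝔭 hι h𝔭bar hne hHeeg hcop hh hnsq hram hac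
  exact SignedBaseChangeAcDivAdmdefBipartiteNVGlue.exists_isCWBDPLFunction_charIdeal_map_le_of_bipartiteNV stub_namedFactsSS.2.1
    cite_cw67 cite_cwRel cite_chkll75 ι W K 𝔭 𝔭bar κ γ
    hf hN hp hgood hap hsurj hK h𝔭 hι h𝔭bar hne hHeeg hcop hh hac
    (bipartiteNV_of_rootDichotomy ι W K 𝔭 𝔭bar κ γ hf hN hp hgood hap hsurj hK hsplit h𝔭 hι h𝔭bar hne hHeeg hcop hh hnsq hram hac)

/-! ## Kernel (PROVED): C⁺⁺ closes the all-ramified cell; the LEAD's research stub follows from the two new stubs -/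

/-! `bdpLowerHalfRatSS_ramifiedNS_of_chkllPlusRatNS` (C⁺⁺_NS ⟹ S1 on the non-square-free all-ramified cell at `p ∤ h_K`) —
PROVED, now in `Theorems/…AdmdefRamifiedNS.lean` (p724409) and imported (its hypothesis `hC` is the body of `CHKLLPlusRatNS`). -/

/-- **ADOPTION CERTIFICATE (PROVED): bdpline v37's registered research stub S1-rat-mult (the exact text of
`Bdpline.stub_bdpLowerHalfRatSS_mult`) follows from {CHKLL25 Thm 7.1/Cor 7.2 (PRINT, conjunct 8), `stub_chkllPlusRatNS`,
`stub_bdpLowerHalfRatSS_unram`}**: `by_cases` on "every `q ∣ N` has an inertia element moving a `p`-torsion point" — yes ∧ `Squarefree N`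
⟶ the print fact by `…bdpLowerHalfRatSS_semistable_of_CHKLL` (cannot occur under the stub's own binder, but the branch is cheaper than the
contradiction); yes ∧ `¬ Squarefree N` ⟶ C⁺⁺_NS by `bdpLowerHalfRatSS_ramifiedNS_of_chkllPlusRatNS`; no ⟶ γ′.  So replacing bdpline's one
stub by admdef v2's two is a conservative reshape modulo print (orphan by design: a certificate, not a composition edge). -/
theorem bdpLowerHalfRatSS_mult_of
    (h8 : CastellaHsuKunduLeeLiu2025.thm71_cor72_exists_isCWBDPLFunction_charIdeal_map_le_rat) (hC : CHKLLPlusRatNS)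
    (hU : SignedTwoVariableInputs → Literature.NumberTheory.EllipticCurves.ModularForms.nonempty_modularParametrizationData → ∀ (W : WeierstrassCurve ℚ) [W.IsElliptic] [W.IsGloballyMinimal] (p : ℕ) [Fact p.Prime], 5 ≤ p → W.HasGoodReductionAtPrime p → W.frobeniusTrace p = 0 → Literature.NumberTheory.EllipticCurves.Rank1Residual.Surj W p → ∀ (K : Type) [Field K] [NumberField K] (ι : PadicAlgCl p ≃+* ℂ) (v vbar : IsDedekindDomain.HeightOneSpectrum (NumberField.RingOfIntegers K)) (κ₁ κ₂ : Literature.NumberTheory.EllipticCurves.ZpExtension K p) (γ₁ γ₂ : Field.absoluteGaloisGroup K) [Fact (Literature.NumberTheory.EllipticCurves.ZpExtension.IsTopGeneratorPair κ₁ κ₂ γ₁ γ₂)] [NeZero (NumberField.discr K).natAbs] (N : ℕ) [NeZero N] (f : CuspForm (CongruenceSubgroup.Gamma0 N) 2), Literature.NumberTheory.EllipticCurves.ModularForms.IsNewformOf W f → (N : ℤ) = W.conductorNorm ℤ → Literature.NumberTheory.EllipticCurves.IsImaginaryQuadratic K → ¬ p ∣ NumberField.classNumber K → ¬ (∀ q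 : ℕ, q.Prime → q ∣ N → ∃ v' : IsDedekindDomain.HeightOneSpectrum (NumberField.RingOfIntegers ℚ), ((q : ℕ) : NumberField.RingOfIntegers ℚ) ∈ v'.asIdeal ∧ ∃ 𝔓 ∈ v'.primesAbove, ∃ σ ∈ 𝔓.inertia (Field.absoluteGaloisGroup ℚ), ∃ P : W.geomTorsion (p : ℤ), σ • P ≠ P) → ¬ (∀ ℓ : ℕ, ℓ.Prime → ℓ ∣ N → ℓ ^ 2 ∣ N) → ((Ideal.span {(p : ℤ)}).primesOver (NumberField.RingOfIntegers K)).ncard = 2 → ((p : ℕ) : NumberField.RingOfIntegers K) ∈ v.asIdeal → ((p : ℕ) : NumberField.RingOfIntegers K) ∈ vbar.asIdeal → vbar ≠ v → (∀ (w : NumberField.InfinitePlace K) (k : NumberField.RingOfIntegers K), k ∈ v.asIdeal ↔ ‖ι.symm (w.embedding (k : K))‖ < 1) → IsCoprime (N : ℤ) (NumberField.discr K) → (∀ ℓ : ℕ, ℓ.Prime → ℓ ∣ N → ((Ideal.span {(ℓ : ℤ)}).primesOver (NumberField.RingOfIntegers K)).ncard = 2) → Odd (NumberField.discr K) → NumberField.discr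 K ≠ -3 → κ₁.IsCyclotomic → κ₂.IsAnticyclotomic → (haveI : Fact (κ₂.IsTopGenerator γ₂) := ⟨Literature.NumberTheory.EllipticCurves.YanZhu2026.isTopGenerator_of_pair (κ₁ := κ₁) (γ₁ := γ₁)⟩; Module.IsTorsion (Literature.NumberTheory.EllipticCurves.IwasawaAlgebra p) (Literature.NumberTheory.EllipticCurves.Castella2018.AcSelmer.XAc (W.baseChange K) p κ₂ vbar ∅ γ₂)) → ∀ (ΩK : ℂ) (Ωp' : (Literature.NumberTheory.EllipticCurves.unrIntegers p)ˣ) (L : Literature.NumberTheory.EllipticCurves.UnrSeries p), ΩK ≠ 0 → Literature.NumberTheory.EllipticCurves.IsBDPLFunction ι v κ₂ γ₂ f ΩK ((Ωp' : Literature.NumberTheory.EllipticCurves.unrIntegers p) : PadicComplex p) L → ∀ J : ℤ_[p] →+* PadicComplexInt p, (∀ x : ℤ_[p], ((J x : PadicComplexInt p) : PadicComplex p) = ((x : ℚ_[p]) : PadicComplex p)) → ∀ (J₀ : Literature.NumberTheory.EllipticCurves.unrIntegers p →+* PadicComplexInt p), (∀ x : Literature.NumberTheory.EllipticCurves.unrIntegers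 p, ((J₀ x : PadicComplexInt p) : PadicComplex p) = (x : PadicComplex p)) → ∃ k : ℕ, ∀ y ∈ (haveI : Fact (κ₂.IsTopGenerator γ₂) := ⟨Literature.NumberTheory.EllipticCurves.YanZhu2026.isTopGenerator_of_pair (κ₁ := κ₁) (γ₁ := γ₁)⟩; Literature.NumberTheory.EllipticCurves.Castella2018.AcSelmer.XAc.charIdeal (W.baseChange K) p κ₂ vbar ∅ γ₂).map (PowerSeries.map J), PowerSeries.C (((p : ℕ) : PadicComplexInt p) ^ k) * y ∈ Ideal.span {PowerSeries.map J₀ L}) :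
    SignedTwoVariableInputs → Literature.NumberTheory.EllipticCurves.ModularForms.nonempty_modularParametrizationData → ∀ (W : WeierstrassCurve ℚ) [W.IsElliptic] [W.IsGloballyMinimal] (p : ℕ) [Fact p.Prime], 5 ≤ p → W.HasGoodReductionAtPrime p → W.frobeniusTrace p = 0 → Literature.NumberTheory.EllipticCurves.Rank1Residual.Surj W p → ∀ (K : Type) [Field K] [NumberField K] (ι : PadicAlgCl p ≃+* ℂ) (v vbar : IsDedekindDomain.HeightOneSpectrum (NumberField.RingOfIntegers K)) (κ₁ κ₂ : Literature.NumberTheory.EllipticCurves.ZpExtension K p) (γ₁ γ₂ : Field.absoluteGaloisGroup K) [Fact (Literature.NumberTheory.EllipticCurves.ZpExtension.IsTopGeneratorPair κ₁ κ₂ γ₁ γ₂)] [NeZero (NumberField.discr K).natAbs] (N : ℕ) [NeZero N] (f : CuspForm (CongruenceSubgroup.Gamma0 N) 2), Literature.NumberTheory.EllipticCurves.ModularForms.IsNewformOf W f → (N : ℤ) = W.conductorNorm ℤ → Literature.NumberTheory.EllipticCurves.IsImaginaryQuadratic K → ¬ p ∣ NumberField.classNumber K → ¬ (Squarefree N ∧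 ∀ q : ℕ, q.Prime → q ∣ N → ∃ v' : IsDedekindDomain.HeightOneSpectrum (NumberField.RingOfIntegers ℚ), ((q : ℕ) : NumberField.RingOfIntegers ℚ) ∈ v'.asIdeal ∧ ∃ 𝔓 ∈ v'.primesAbove, ∃ σ ∈ 𝔓.inertia (Field.absoluteGaloisGroup ℚ), ∃ P : W.geomTorsion (p : ℤ), σ • P ≠ P) → ¬ (∀ ℓ : ℕ, ℓ.Prime → ℓ ∣ N → ℓ ^ 2 ∣ N) → ((Ideal.span {(p : ℤ)}).primesOver (NumberField.RingOfIntegers K)).ncard = 2 → ((p : ℕ) : NumberField.RingOfIntegers K) ∈ v.asIdeal → ((p : ℕ) : NumberField.RingOfIntegers K) ∈ vbar.asIdeal → vbar ≠ v → (∀ (w : NumberField.InfinitePlace K) (k : NumberField.RingOfIntegers K), k ∈ v.asIdeal ↔ ‖ι.symm (w.embedding (k : K))‖ < 1) → IsCoprime (N : ℤ) (NumberField.discr K) → (∀ ℓ : ℕ, ℓ.Prime → ℓ ∣ N → ((Ideal.span {(ℓ : ℤ)}).primesOver (NumberField.RingOfIntegers K)).ncard = 2) → Odd (NumberField.discr K)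 → NumberField.discr K ≠ -3 → κ₁.IsCyclotomic → κ₂.IsAnticyclotomic → (haveI : Fact (κ₂.IsTopGenerator γ₂) := ⟨Literature.NumberTheory.EllipticCurves.YanZhu2026.isTopGenerator_of_pair (κ₁ := κ₁) (γ₁ := γ₁)⟩; Module.IsTorsion (Literature.NumberTheory.EllipticCurves.IwasawaAlgebra p) (Literature.NumberTheory.EllipticCurves.Castella2018.AcSelmer.XAc (W.baseChange K) p κ₂ vbar ∅ γ₂)) → ∀ (ΩK : ℂ) (Ωp' : (Literature.NumberTheory.EllipticCurves.unrIntegers p)ˣ) (L : Literature.NumberTheory.EllipticCurves.UnrSeries p), ΩK ≠ 0 → Literature.NumberTheory.EllipticCurves.IsBDPLFunction ι v κ₂ γ₂ f ΩK ((Ωp' : Literature.NumberTheory.EllipticCurves.unrIntegers p) : PadicComplex p) L → ∀ J : ℤ_[p] →+* PadicComplexInt p, (∀ x : ℤ_[p], ((J x : PadicComplexInt p) : PadicComplex p) = ((x : ℚ_[p]) : PadicComplex p)) → ∀ (J₀ : Literature.NumberTheory.EllipticCurves.unrIntegers p →+* PadicComplexInt p), (∀ x : Literature.NumberTheory.EllipticCurves.unrIntegers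 p, ((J₀ x : PadicComplexInt p) : PadicComplex p) = (x : PadicComplex p)) → ∃ k : ℕ, ∀ y ∈ (haveI : Fact (κ₂.IsTopGenerator γ₂) := ⟨Literature.NumberTheory.EllipticCurves.YanZhu2026.isTopGenerator_of_pair (κ₁ := κ₁) (γ₁ := γ₁)⟩; Literature.NumberTheory.EllipticCurves.Castella2018.AcSelmer.XAc.charIdeal (W.baseChange K) p κ₂ vbar ∅ γ₂).map (PowerSeries.map J), PowerSeries.C (((p : ℕ) : PadicComplexInt p) ^ k) * y ∈ Ideal.span {PowerSeries.map J₀ L} := by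
  intro hIn hmodP W _ _ p _ hp hgood ha0 hs K _ _ ι v vbar κ₁ κ₂ γ₁ γ₂ _ _ N _ f hf hN hK hh hss hsq hsplit hv hvbar hvv hι hcop
    hHeeg hodd hne3 hκ₁ hκ₂
  by_cases hram : ∀ q : ℕ, q.Prime → q ∣ N → ∃ v' : IsDedekindDomain.HeightOneSpectrum (NumberField.RingOfIntegers ℚ), ((q : ℕ) : NumberField.RingOfIntegers ℚ) ∈ v'.asIdeal ∧ ∃ 𝔓 ∈ v'.primesAbove, ∃ σ ∈ 𝔓.inertia (Field.absoluteGaloisGroup ℚ), ∃ P : W.geomTorsion (p : ℤ), σ • P ≠ P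
  · by_cases hsqf : Squarefree N
    · exact SignedBaseChangeAcDivBdpLowerHalfSemistable.bdpLowerHalfRatSS_semistable_of_CHKLL h8 hIn hmodP W p hp hgood ha0 hs K ι v
        vbar κ₁ κ₂ γ₁ γ₂ N f hf hN hK hsplit hv hvbar hvv hι hcop hHeeg hodd hne3 hκ₁ hκ₂ hh hsqf hram
    · exact SignedBaseChangeAcDivAdmdefRamifiedNS.bdpLowerHalfRatSS_ramifiedNS_of_chkllPlusRatNS hC hIn hmodP W p hp hgood ha0 hs K ι v vbar κ₁ κ₂ γ₁ γ₂ N f hf hN hK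
        hsplit hv hvbar hvv hι hcop hHeeg hodd hne3 hκ₁ hκ₂ hh hsqf hram
  · exact hU hIn hmodP W p hp hgood ha0 hs K ι v vbar κ₁ κ₂ γ₁ γ₂ N f hf hN hK hh hram hsq hsplit hv hvbar hvv hι hcop hHeeg
      hodd hne3 hκ₁ hκ₂

/-! ## Derived (as in bdpline v37) and the composition to the crux BY NAME -/

/-- (DERIVED) the finite exponent of `X_Gr₂[T₁]` off the support from Gr16 4.1.1 (conjunct 5) + Tate's global Euler–Poincaré
characteristic at totally complex fields — v3: the THEOREM `GaloisCohomology.forall_tateGlobalEulerPoincareCharacteristic_of_isTotallyComplex`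
(cell bsd-eis, Milne ADT I Thm 5.1) — by `SignedBaseChangeAcDivOfFiniteExponentTateTC.finiteExponentSS_of_prop411_of_tateTC` (p683298). -/
theorem finiteExponentSS :
    SignedTwoVariableInputs → Literature.NumberTheory.EllipticCurves.ModularForms.nonempty_modularParametrizationData → ∀ (W : WeierstrassCurve ℚ) [W.IsElliptic] [W.IsGloballyMinimal] (p : ℕ) [Fact p.Prime], 5 ≤ p → W.HasGoodReductionAtPrime p → W.frobeniusTrace p = 0 → Literature.NumberTheory.EllipticCurves.Rank1Residual.Surj W p → ∀ (K : Type) [Field K] [NumberField K] (ι : PadicAlgCl p ≃+* ℂ) (v vbar : IsDedekindDomain.HeightOneSpectrum (NumberField.RingOfIntegers K)) (κ₁ κ₂ : Literature.NumberTheory.EllipticCurves.ZpExtension K p) (γ₁ γ₂ : Field.absoluteGaloisGroup K) [Fact (Literature.NumberTheory.EllipticCurves.ZpExtension.IsTopGeneratorPair κ₁ κ₂ γ₁ γ₂)] [NeZero (NumberField.discr K).natAbs] (N : ℕ) [NeZero N] (f : CuspForm (CongruenceSubgroup.Gamma0 N) 2), Literature.NumberTheory.EllipticCurves.ModularForms.IsNewformOf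 W f → (N : ℤ) = W.conductorNorm ℤ → Literature.NumberTheory.EllipticCurves.IsImaginaryQuadratic K → ((Ideal.span {(p : ℤ)}).primesOver (NumberField.RingOfIntegers K)).ncard = 2 → ((p : ℕ) : NumberField.RingOfIntegers K) ∈ v.asIdeal → ((p : ℕ) : NumberField.RingOfIntegers K) ∈ vbar.asIdeal → vbar ≠ v → (∀ (w : NumberField.InfinitePlace K) (k : NumberField.RingOfIntegers K), k ∈ v.asIdeal ↔ ‖ι.symm (w.embedding (k : K))‖ < 1) → IsCoprime (N : ℤ) (NumberField.discr K) → (∀ ℓ : ℕ, ℓ.Prime → ℓ ∣ N → ((Ideal.span {(ℓ : ℤ)}).primesOver (NumberField.RingOfIntegers K)).ncard = 2) → Odd (NumberField.discr K) → NumberField.discr K ≠ -3 → κ₁.IsCyclotomic → κ₂.IsAnticyclotomic → Literature.NumberTheory.EllipticCurves.Module.lengthAt (Literature.NumberTheory.EllipticCurves.IwasawaAlgebra₂ p) ((W.baseChange K).XGr₂ p κ₁ κ₂ vbar γ₁ γ₂) ⟨Ideal.span {(PowerSeries.X : Literature.NumberTheory.EllipticCurves.IwasawaAlgebra₂ p)},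 PowerSeries.span_X_isPrime⟩ = 0 → ∃ m : ℕ, ∀ x : (W.baseChange K).XGr₂ p κ₁ κ₂ vbar γ₁ γ₂, (PowerSeries.X : Literature.NumberTheory.EllipticCurves.IwasawaAlgebra₂ p) • x = 0 → ((p : Literature.NumberTheory.EllipticCurves.IwasawaAlgebra₂ p) ^ m) • x = 0 :=
  SignedBaseChangeAcDivOfFiniteExponentTateTC.finiteExponentSS_of_prop411_of_tateTC stub_namedFactsSS.2.2.2.2.1
    Literature.NumberTheory.GaloisCohomology.forall_tateGlobalEulerPoincareCharacteristic_of_isTotallyComplex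

/-- **S1 (the registered text, DERIVED through the v2 cut)**: `p ∣ h_K` ⟶ `stub_bdpLowerHalfRatSS_classDvd`; `p ∤ h_K` ∧ all-additive
⟶ the BLV∘CW conjunct (4) via `SignedBaseChangeAcDivBdpLowerHalfAllAdditive.bdpLowerHalfRatSS_allAdditive_of_BLV` (as bdpline);
`p ∤ h_K` ∧ `Squarefree N` ∧ all-ramified ⟶ CHKLL25 (conjunct 8, PRINT) via `SignedBaseChangeAcDivBdpLowerHalfSemistable.bdpLowerHalfRatSS_semistable_of_CHKLL`
(as bdpline v29–v37; RESTORED in v2); `p ∤ h_K` ∧ all-ramified ∧ `¬ Squarefree N` ⟶ C⁺⁺_NS via `bdpLowerHalfRatSS_ramifiedNS_of_chkllPlusRatNS`;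
otherwise ⟶ γ′. -/
theorem stub_bdpLowerHalfRatSS :
    SignedTwoVariableInputs → Literature.NumberTheory.EllipticCurves.ModularForms.nonempty_modularParametrizationData → ∀ (W : WeierstrassCurve ℚ) [W.IsElliptic] [W.IsGloballyMinimal] (p : ℕ) [Fact p.Prime], 5 ≤ p → W.HasGoodReductionAtPrime p → W.frobeniusTrace p = 0 → Literature.NumberTheory.EllipticCurves.Rank1Residual.Surj W p → ∀ (K : Type) [Field K] [NumberField K] (ι : PadicAlgCl p ≃+* ℂ) (v vbar : IsDedekindDomain.HeightOneSpectrum (NumberField.RingOfIntegers K)) (κ₁ κ₂ : Literature.NumberTheory.EllipticCurves.ZpExtension K p) (γ₁ γ₂ : Field.absoluteGaloisGroup K) [Fact (Literature.NumberTheory.EllipticCurves.ZpExtension.IsTopGeneratorPair κ₁ κ₂ γ₁ γ₂)] [NeZero (NumberField.discr K).natAbs] (N : ℕ) [NeZero N] (f : CuspForm (CongruenceSubgroup.Gamma0 N) 2), Literature.NumberTheory.EllipticCurves.ModularForms.IsNewformOf W f → (N : ℤ) = W.conductorNorm ℤ → Literature.NumberTheory.EllipticCurves.IsImaginaryQuadratic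 K → ((Ideal.span {(p : ℤ)}).primesOver (NumberField.RingOfIntegers K)).ncard = 2 → ((p : ℕ) : NumberField.RingOfIntegers K) ∈ v.asIdeal → ((p : ℕ) : NumberField.RingOfIntegers K) ∈ vbar.asIdeal → vbar ≠ v → (∀ (w : NumberField.InfinitePlace K) (k : NumberField.RingOfIntegers K), k ∈ v.asIdeal ↔ ‖ι.symm (w.embedding (k : K))‖ < 1) → IsCoprime (N : ℤ) (NumberField.discr K) → (∀ ℓ : ℕ, ℓ.Prime → ℓ ∣ N → ((Ideal.span {(ℓ : ℤ)}).primesOver (NumberField.RingOfIntegers K)).ncard = 2) → Odd (NumberField.discr K) → NumberField.discr K ≠ -3 → κ₁.IsCyclotomic → κ₂.IsAnticyclotomic → (haveI : Fact (κ₂.IsTopGenerator γ₂) := ⟨Literature.NumberTheory.EllipticCurves.YanZhu2026.isTopGenerator_of_pair (κ₁ := κ₁) (γ₁ := γ₁)⟩; Module.IsTorsion (Literature.NumberTheory.EllipticCurves.IwasawaAlgebra p) (Literature.NumberTheory.EllipticCurves.Castella2018.AcSelmer.XAc (W.baseChange K) p κ₂ vbar ∅ γ₂)) → ∀ (ΩK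 : ℂ) (Ωp' : (Literature.NumberTheory.EllipticCurves.unrIntegers p)ˣ) (L : Literature.NumberTheory.EllipticCurves.UnrSeries p), ΩK ≠ 0 → Literature.NumberTheory.EllipticCurves.IsBDPLFunction ι v κ₂ γ₂ f ΩK ((Ωp' : Literature.NumberTheory.EllipticCurves.unrIntegers p) : PadicComplex p) L → ∀ J : ℤ_[p] →+* PadicComplexInt p, (∀ x : ℤ_[p], ((J x : PadicComplexInt p) : PadicComplex p) = ((x : ℚ_[p]) : PadicComplex p)) → ∀ (J₀ : Literature.NumberTheory.EllipticCurves.unrIntegers p →+* PadicComplexInt p), (∀ x : Literature.NumberTheory.EllipticCurves.unrIntegers p, ((J₀ x : PadicComplexInt p) : PadicComplex p) = (x : PadicComplex p)) → ∃ k : ℕ, ∀ y ∈ (haveI : Fact (κ₂.IsTopGenerator γ₂) := ⟨Literature.NumberTheory.EllipticCurves.YanZhu2026.isTopGenerator_of_pair (κ₁ := κ₁) (γ₁ := γ₁)⟩; Literature.NumberTheory.EllipticCurves.Castella2018.AcSelmer.XAc.charIdeal (W.baseChange K) p κ₂ vbar ∅ γ₂).map (PowerSeries.map J), PowerSeries.C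 (((p : ℕ) : PadicComplexInt p) ^ k) * y ∈ Ideal.span {PowerSeries.map J₀ L} := by
  intro hIn hmodP W _ _ p _ hp hgood ha0 hs K _ _ ι v vbar κ₁ κ₂ γ₁ γ₂ _ _ N _ f hf hN hK hsplit hv hvbar hvv hι hcop hHeeg hodd
    hne3 hκ₁ hκ₂
  by_cases hh : p ∣ NumberField.classNumber K
  · exact stub_bdpLowerHalfRatSS_classDvd hIn hmodP W p hp hgood ha0 hs K ι v vbar κ₁ κ₂ γ₁ γ₂ N f hf hN hK hsplit hv hvbar
      hvv hι hcop hHeeg hodd hne3 hκ₁ hκ₂ hh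
  · by_cases hsq : ∀ ℓ : ℕ, ℓ.Prime → ℓ ∣ N → ℓ ^ 2 ∣ N
    · exact SignedBaseChangeAcDivBdpLowerHalfAllAdditive.bdpLowerHalfRatSS_allAdditive_of_BLV stub_namedFactsSS.2.2.2.1 hIn
        hmodP W p hp hgood ha0 hs K ι v vbar κ₁ κ₂ γ₁ γ₂ N f hf hN hK hsplit hv hvbar hvv hι hcop hHeeg hodd hne3 hκ₁ hκ₂ hh hsq
    · by_cases hram : ∀ q : ℕ, q.Prime → q ∣ N → ∃ v' : IsDedekindDomain.HeightOneSpectrum (NumberField.RingOfIntegers ℚ), ((q : ℕ) : NumberField.RingOfIntegers ℚ) ∈ v'.asIdeal ∧ ∃ 𝔓 ∈ v'.primesAbove, ∃ σ ∈ 𝔓.inertia (Field.absoluteGaloisGroup ℚ), ∃ P : W.geomTorsion (p : ℤ), σ • P ≠ P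
      · by_cases hsqf : Squarefree N
        · -- v2 (= bdpline v29–v37): the SQUARE-FREE all-ramified cell is PRINT — CHKLL25 Thm 7.1 / Cor 7.2 (conjunct 8)
          exact SignedBaseChangeAcDivBdpLowerHalfSemistable.bdpLowerHalfRatSS_semistable_of_CHKLL cite_chkll71
            hIn hmodP W p hp hgood ha0 hs K ι v vbar κ₁ κ₂ γ₁ γ₂ N f hf hN hK hsplit hv hvbar hvv hι hcop hHeeg hodd hne3 hκ₁ hκ₂ hh
            hsqf hram
        · -- the NON-square-free all-ramified cell is the research stub C⁺⁺_NS through the frame-concordance glue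
          exact SignedBaseChangeAcDivAdmdefRamifiedNSDisc.bdpLowerHalfRatSS_ramifiedNS_of_chkllPlusRatNSDisc chkllPlusRatNSDisc_of_rootDichotomy hIn hmodP W p hp hgood ha0 hs K ι v vbar κ₁ κ₂
            γ₁ γ₂ N f hf hN hK hsplit hv hvbar hvv hι hcop hHeeg hodd hne3 hκ₁ hκ₂ hh hsqf hram
      · -- residue γ′: some `q ∣ N` with `E[p]` unramified at `q` (bsd-idea-14's primkoly locus)
        exact bdpLowerHalfRatSS_unram hIn hmodP W p hp hgood ha0 hs K ι v vbar κ₁ κ₂ γ₁ γ₂ N f hf hN hK hh hram hsq hsplit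
          hv hvbar hvv hι hcop hHeeg hodd hne3 hκ₁ hκ₂

/-- **The crux BY NAME from the five stubs** — the composition of bdpline v37 verbatim
(`SignedBaseChangeAcDivOfFiniteExponentTateTC.anticyclotomicEisensteinDivisibility_of_xAcTorsionSS_of_finiteExponent`), fed by
this file's S1. -/
theorem AnticyclotomicEisensteinDivisibility_of :
    Summit.BirchSwinnertonDyer.BirchSwinnertonDyer.Theses.SignedBaseChange.AnticyclotomicEisensteinDivisibility :=
  SignedBaseChangeAcDivOfFiniteExponentTateTC.anticyclotomicEisensteinDivisibility_of_xAcTorsionSS_of_finiteExponent stub_namedFactsSS.1.1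
    stub_namedFactsSS.1.2.1 stub_namedFactsSS.1.2.2
    (SignedBaseChangeAcDivOfFactsRefereed.xAcTorsionSS_of_refereed_of_classDvd stub_namedFactsSS.2.1 stub_namedFactsSS.2.2.1
      xAcTorsionSS_classDvd)
    finiteExponentSS stub_namedFactsSS.2.2.2.2.2.1 stub_namedFactsSS.2.2.2.2.2.2.1 stub_bdpLowerHalfRatSS


/-! ## Variant WITHOUT the BLV∘CW conjunct (PROVED plumbing): S1 and the crux from {S1∣, C⁺⁺, γ′} alone -/

/-- **S1 (the registered text) WITHOUT the BLV∘CW conjunct (4)**: `p ∣ h_K` ⟶ `stub_bdpLowerHalfRatSS_classDvd`; `p ∤ h_K` ∧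
`Squarefree N` ∧ all-ramified ⟶ CHKLL25 (conjunct 8, PRINT); `p ∤ h_K` ∧ all-ramified ∧ `¬ Squarefree N` (this provably CONTAINS the
all-additive cell α: `allRamified_of_allAdditive`, and an all-additive `N` is square-free only if `N = 1`, excluded because the branch is
reached with `¬ Squarefree N` in hand) ⟶ C⁺⁺_NS; otherwise ⟶ γ′ (its `¬ all-additive` hypothesis discharged from `¬ all-ramified`).  The flagged
conjunct (4) (BLV 2026 Thm A ∘ CW, reading flag `BLV-step4-UNSOURCED-on-R4`) is NOT consumed on this road. -/
theorem bdpLowerHalfRatSS_noBLV :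
    SignedTwoVariableInputs → Literature.NumberTheory.EllipticCurves.ModularForms.nonempty_modularParametrizationData → ∀ (W : WeierstrassCurve ℚ) [W.IsElliptic] [W.IsGloballyMinimal] (p : ℕ) [Fact p.Prime], 5 ≤ p → W.HasGoodReductionAtPrime p → W.frobeniusTrace p = 0 → Literature.NumberTheory.EllipticCurves.Rank1Residual.Surj W p → ∀ (K : Type) [Field K] [NumberField K] (ι : PadicAlgCl p ≃+* ℂ) (v vbar : IsDedekindDomain.HeightOneSpectrum (NumberField.RingOfIntegers K)) (κ₁ κ₂ : Literature.NumberTheory.EllipticCurves.ZpExtension K p) (γ₁ γ₂ : Field.absoluteGaloisGroup K) [Fact (Literature.NumberTheory.EllipticCurves.ZpExtension.IsTopGeneratorPair κ₁ κ₂ γ₁ γ₂)] [NeZero (NumberField.discr K).natAbs] (N : ℕ) [NeZero N] (f : CuspForm (CongruenceSubgroup.Gamma0 N) 2), Literature.NumberTheory.EllipticCurves.ModularForms.IsNewformOf W f → (N : ℤ) = W.conductorNorm ℤ → Literature.NumberTheory.EllipticCurves.IsImaginaryQuadratic K → ((Ideal.span {(p : ℤ)}).primesOver (NumberField.RingOfIntegers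 K)).ncard = 2 → ((p : ℕ) : NumberField.RingOfIntegers K) ∈ v.asIdeal → ((p : ℕ) : NumberField.RingOfIntegers K) ∈ vbar.asIdeal → vbar ≠ v → (∀ (w : NumberField.InfinitePlace K) (k : NumberField.RingOfIntegers K), k ∈ v.asIdeal ↔ ‖ι.symm (w.embedding (k : K))‖ < 1) → IsCoprime (N : ℤ) (NumberField.discr K) → (∀ ℓ : ℕ, ℓ.Prime → ℓ ∣ N → ((Ideal.span {(ℓ : ℤ)}).primesOver (NumberField.RingOfIntegers K)).ncard = 2) → Odd (NumberField.discr K) → NumberField.discr K ≠ -3 → κ₁.IsCyclotomic → κ₂.IsAnticyclotomic → (haveI : Fact (κ₂.IsTopGenerator γ₂) := ⟨Literature.NumberTheory.EllipticCurves.YanZhu2026.isTopGenerator_of_pair (κ₁ := κ₁) (γ₁ := γ₁)⟩; Module.IsTorsion (Literature.NumberTheory.EllipticCurves.IwasawaAlgebra p) (Literature.NumberTheory.EllipticCurves.Castella2018.AcSelmer.XAc (W.baseChange K) p κ₂ vbar ∅ γ₂)) → ∀ (ΩK : ℂ) (Ωp' : (Literature.NumberTheory.EllipticCurves.unrIntegers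 p)ˣ) (L : Literature.NumberTheory.EllipticCurves.UnrSeries p), ΩK ≠ 0 → Literature.NumberTheory.EllipticCurves.IsBDPLFunction ι v κ₂ γ₂ f ΩK ((Ωp' : Literature.NumberTheory.EllipticCurves.unrIntegers p) : PadicComplex p) L → ∀ J : ℤ_[p] →+* PadicComplexInt p, (∀ x : ℤ_[p], ((J x : PadicComplexInt p) : PadicComplex p) = ((x : ℚ_[p]) : PadicComplex p)) → ∀ (J₀ : Literature.NumberTheory.EllipticCurves.unrIntegers p →+* PadicComplexInt p), (∀ x : Literature.NumberTheory.EllipticCurves.unrIntegers p, ((J₀ x : PadicComplexInt p) : PadicComplex p) = (x : PadicComplex p)) → ∃ k : ℕ, ∀ y ∈ (haveI : Fact (κ₂.IsTopGenerator γ₂) := ⟨Literature.NumberTheory.EllipticCurves.YanZhu2026.isTopGenerator_of_pair (κ₁ := κ₁) (γ₁ := γ₁)⟩; Literature.NumberTheory.EllipticCurves.Castella2018.AcSelmer.XAc.charIdeal (W.baseChange K) p κ₂ vbar ∅ γ₂).map (PowerSeries.map J), PowerSeries.C (((p : ℕ) : PadicComplexInt p) ^ k) * y ∈ Ideal.span {PowerSeries.map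 J₀ L} := by
  intro hIn hmodP W _ _ p _ hp hgood ha0 hs K _ _ ι v vbar κ₁ κ₂ γ₁ γ₂ _ _ N _ f hf hN hK hsplit hv hvbar hvv hι hcop hHeeg hodd
    hne3 hκ₁ hκ₂
  by_cases hh : p ∣ NumberField.classNumber K
  · exact stub_bdpLowerHalfRatSS_classDvd hIn hmodP W p hp hgood ha0 hs K ι v vbar κ₁ κ₂ γ₁ γ₂ N f hf hN hK hsplit hv hvbar
      hvv hι hcop hHeeg hodd hne3 hκ₁ hκ₂ hh
  · by_cases hram : ∀ q : ℕ, q.Prime → q ∣ N → ∃ v' : IsDedekindDomain.HeightOneSpectrum (NumberField.RingOfIntegers ℚ), ((q : ℕ) : NumberField.RingOfIntegers ℚ) ∈ v'.asIdeal ∧ ∃ 𝔓 ∈ v'.primesAbove, ∃ σ ∈ 𝔓.inertia (Field.absoluteGaloisGroup ℚ), ∃ P : W.geomTorsion (p : ℤ), σ • P ≠ P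
    · by_cases hsqf : Squarefree N
      · exact SignedBaseChangeAcDivBdpLowerHalfSemistable.bdpLowerHalfRatSS_semistable_of_CHKLL cite_chkll71
          hIn hmodP W p hp hgood ha0 hs K ι v vbar κ₁ κ₂ γ₁ γ₂ N f hf hN hK hsplit hv hvbar hvv hι hcop hHeeg hodd hne3 hκ₁ hκ₂ hh
          hsqf hram
      · exact SignedBaseChangeAcDivAdmdefRamifiedNSDisc.bdpLowerHalfRatSS_ramifiedNS_of_chkllPlusRatNSDisc chkllPlusRatNSDisc_of_rootDichotomy hIn hmodP W p hp hgood ha0 hs K ι v vbar κ₁ κ₂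
          γ₁ γ₂ N f hf hN hK hsplit hv hvbar hvv hι hcop hHeeg hodd hne3 hκ₁ hκ₂ hh hsqf hram
    · have hsq : ¬ ∀ ℓ : ℕ, ℓ.Prime → ℓ ∣ N → ℓ ^ 2 ∣ N :=
        fun hsq ↦ hram (SignedBaseChangeAcDivAdmdefRamifiedNS.allRamified_of_allAdditive W hp hgood hN hsq)
      exact bdpLowerHalfRatSS_unram hIn hmodP W p hp hgood ha0 hs K ι v vbar κ₁ κ₂ γ₁ γ₂ N f hf hN hK hh hram hsq hsplit
        hv hvbar hvv hι hcop hHeeg hodd hne3 hκ₁ hκ₂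

/-- **The crux BY NAME without the BLV∘CW conjunct**: bdpline v37's composition fed by `bdpLowerHalfRatSS_noBLV`
(consumes conjuncts 1–3, 5–8, 14 of `stub_namedFactsSS` (`xAcTorsionSS_classDvd` derived from (14)), `stub_bdpLowerHalfRatSS_classDvd`,
`stub_chkllPlusRatNS`, `stub_bdpLowerHalfRatSS_unram`; NOT conjunct 4 = BLV∘CW). -/
theorem AnticyclotomicEisensteinDivisibility_of_noBLV :
    Summit.BirchSwinnertonDyer.BirchSwinnertonDyer.Theses.SignedBaseChange.AnticyclotomicEisensteinDivisibility :=
  SignedBaseChangeAcDivOfFiniteExponentTateTC.anticyclotomicEisensteinDivisibility_of_xAcTorsionSS_of_finiteExponent stub_namedFactsSS.1.1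
    stub_namedFactsSS.1.2.1 stub_namedFactsSS.1.2.2
    (SignedBaseChangeAcDivOfFactsRefereed.xAcTorsionSS_of_refereed_of_classDvd stub_namedFactsSS.2.1 stub_namedFactsSS.2.2.1
      xAcTorsionSS_classDvd)
    finiteExponentSS stub_namedFactsSS.2.2.2.2.2.1 stub_namedFactsSS.2.2.2.2.2.2.1 bdpLowerHalfRatSS_noBLV

end Summit.BirchSwinnertonDyer.BirchSwinnertonDyer.Cruxes.AnticyclotomicEisensteinDivisibility.AdmdefLine

end
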